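import Literature.MathematicalPhysics.QuantumFieldTheory.Balaban1983to89.T4MeanChannel
import Literature.MathematicalPhysics.QuantumFieldTheory.Balaban1983to89.T4MomentMayerStep
import Literature.MathematicalPhysics.QuantumFieldTheory.Balaban1983to89.T4TubeBudget

/-!
# T4PathwiseCoupling — NE1′ by COUPLING OF BLOCK-SPIN TOWERS: the dressed and the undressed run of `(ℝT)^K` on ONE
# probability space, the dressed final density as (undressed) × E[dressing ∣ endpoint], and the CONDITIONAL
# AZUMA–HOEFFDING bound that makes the observable-attached factor K-uniform from an ℓ²- (not ℓ¹-) budget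
(cell `pub-balaban`, T4-DAG v14 §2 node O3b / hypothesis H2, estimate NE1′; journal CLAIM `T4-NE1′-P2-COUPLING*`
2026-08-19T06:10:31Z, unit `b2b-balaban-t4-ne1p-p2` = prover seat P2 «coupling of block-spin towers»; kernel module =
[folklore] probability over Mathlib + typed hypothesis SHAPES; the estimate's physical inputs are NOT proved here;
v1 p184114; v2 = v1 + the VARIANCE FORM — §1 `condExp_exp_mul_le_of_condVar`, §2 product lemma
`condExp_exp_sum_prod_sandwich` + `…_of_condVar`, §3 `IncrementVarBound` / `incrementBound_crude` /
`condExp_exp_dressing_sandwich_of_condVar`, §5 `budget_le` / `fluctuationChannel_le_uniform_of_condVar` — and the header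
items (A1′), (A3); v3 = v2 + the RANDOM-GEOMETRY FORM — §1 `condExp_exp_mul_le_exp_condVarProxy`, §2 Freedman-type
`condExp_exp_sum_sub_var_le_one` + `condExp_indicator_exp_sum_le`, §3 `IncrementVarProxy` /
`condExp_indicator_exp_dressing_le` / `condExp_indicator_compl_exp_dressing_le` /
`condExp_exp_dressing_sandwich_of_varProxy`, §4 `integral_mul_exp_le_of_varProxy` — and header item (A1″);
v4 = v3 + the DOMAIN SPLIT — §3b `condExp_incr_sq_le_condExp_sq_sub` (conditional variance ≤ conditional second moment
about any predictable centre), `incrementVarProxy_of_domainSplit` (discharges `IncrementVarProxy` from predictable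
centres/radii on a domain + the crude `2R` off it), `measureReal_lt_sum_condExp_indicator_le` (the large-field part of
the budget by Markov: only UNCONDITIONAL domain-failure probabilities survive), §4 `integral_mul_exp_le_of_domainSplit`
(the end-to-end consumer form), `integral_mul_exp_mean_le` — and the missing inequalities restated as (MI-1′)/(MI-2′)
below; v5 = v4 + the FIRST-MOMENT CHANNEL — §3c `IncrementVarProxy.ae_nonneg`, `measureReal_lt_sum_le_inv_mul_sum_integral`
(the budget tail by Markov: only the EXPECTED proxies under `μ` survive), `incrementVarProxy_of_predictableDomainSplit`
(domains measurable one level up: a bad event of the future geometry charged ONCE), §4b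
`integral_mul_exp_le_of_varProxy_moments` / `integral_mul_exp_le_of_predictableDomainSplit(_moments)`, §5b `levelSum_le` /
`integral_mul_exp_le_uniform` (the END-TO-END K-UNIFORM form from a LEVEL FIRST-MOMENT PROFILE) — and the located inputs
restated as (MI-1″)/(MI-1‴)/(MI-2″) below, CORRECTING the cost model behind (MI-1′)/(MI-2′); v6 = v5 + §5b
`integral_mul_exp_le_uniform_of_slots` (worst-case counts × per-slot expected proxies) and the header item (A1⁗):
two DEFINITIONAL sentences of [Balaban1989LargeFieldI] pp. 177, 181 read on the cell's render — resampled components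
are SIZE-BOUNDED and components with new large fields are DEFERRED — which correct (A1″)/(β) and sharpen the located
inputs to (MI-F1)/(MI-F2); v7 = v6 + §5c: the exponential moment of a COUNT of product-dominated events
(`integral_pow_card_filter_le_prod`/`_le_exp`: `∫ κ^{#{j : ω ∈ A j}} ≤ μ(Ω)∏(1 + (κ−1)ε_j) ≤ μ(Ω)e^{(κ−1)Σε_j}` from
`μ(⋂_{j∈S} A j) ≤ μ(Ω)∏_{j∈S} ε_j`) — the kernel form of (MI-F2)'s reduction to multi-level large-field probabilities —
and the end-to-end shape `integral_mul_exp_le_uniform_of_nesting` taking (MI-F1)/(MI-F2) in exactly that form; v8 = v7 +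
`integral_mul_exp_le_uniform_of_nesting_add`: the same with an ADDITIVE, separately budgeted proxy term `U i`
(`Σ_{i<n} ∫U i ≤ Utot`) — the receptacle for the locality radii of (A1) and the T-block proxies of (A3); v9 = v8 +
header/docstring CORRECTION of the descriptive reading of the events in (MI-F2)/§5c: product domination holds for
large-field CREATION events (distinct regions), NOT for «the level-j block is irregular» across levels (a region
PERSISTS until integrated), and `irr ≤` lifetime × number of creations — see (MI-F2′); no statement changed)

HONEST FRAMING (cell `pub-balaban`, T4-DAG PAGE 1).  The cell's T4 target is the existence AND uniqueness of the
continuum (`ε = L^{-K} → 0`) limit of Bałaban's unit-scale averaged Wilson-loop expectations on a FIXED FINITE TORUS —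
strictly beyond ultraviolet stability ([Balaban1989LargeFieldII] Thm 1 p. 355); it is FINITE VOLUME, asserts NO MASS
GAP, and is NOT the Clay problem.  Every use of the cell's spine is CONDITIONAL on the named hypotheses `BetaPertH`
(the perturbative β-function input), `(B)` (ultraviolet stability as printed) and `(B^μ)` (its dressed form); none of
them is hidden in a definition below — this module does not even mention Bałaban's objects: it is the abstract
probabilistic skeleton of ONE technique for the cell's counted estimate NE1′ («the printed inductive step re-run in the
observable-attached format with synchronised thresholds», T4-DAG v14 §6), with every physical input a NAMED binder.
Value = kernel-checked reduction + bookkeeping; NOT summit progress; NOT a proof of NE1′.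

CITATION HEADER (lean-in-tree rule 2026-08-18).  NO statement of the audited series [Balaban1985Averaging] –
[Balaban1989LargeFieldII] is asserted, quoted as a hypothesis, or used below; the manuscripts are the object of the
audit and are NOT cited for any disputed step (cell ABSOLUTE RULE).  The two printed facts this module is DESIGNED
AROUND (context only, both certified elsewhere in the tree from the renders): (i) the complete step is `ρ_{k+1} =
ℝ(Tρ_k)` — T first, then ℝ ([Balaban1988Convergent] (0.2) pp. 243–244; tree `T4Spectator`, cross-read
`t4/T4-XREAD-O2.md`); (ii) ℝ is mass preserving: [Balaban1989LargeFieldI] (0.4) p. 176 "It satisfies the basic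
normalization property ∫dV(ℝρ)(V) = ∫dVρ(V)." and acts termwise by the normalized fibre resampling (0.3) p. 176
"(ℝρ)(V) = Σ_Z ρ(Z″, V) ∫dV⌈_{Z′}ρ(Z, V) / ∫dV⌈_{Z′}ρ(Z″, V)" (quoted VERBATIM in the headers of `B15.BasicStep`,
`T4DressedR`, `T4OscSandwich`, whose seats re-read p. 176 = PDF p. 2 on the cell's renders).  (i)+(ii) say exactly
that one complete step is a POSITIVE, MASS-PRESERVING LINEAR map on densities, i.e. a Markov transition; that is the
only structural fact the coupling uses, and it enters below as the EXISTENCE of the path-space measure `μ` (a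
hypothesis of every theorem: "let `μ` be a finite measure and `F` an antitone filtration"), never as a claim.
(iii) (v6; read by THIS seat on the cell's render `paper:balaban1989-cmp122-large-field-i`, PDF pp. 1, 3, 7 = CMP
pp. 175, 177, 181; DEFINITIONAL sentences describing which terms ℝ acts on, used only to correct this header's cost
model (A1⁗), never as a hypothesis): [Balaban1989LargeFieldI] p. 177 "We consider components of sizes smaller than,
or equal to 100 MR_k. More precisely, we consider the class of components such that each satisfies the following two
properties: (i) it is contained in a cube of the size 100 MR_k, (ii) in the preceding N renormalization steps no new
large field regions were created inside this component, and the previous regions contained in it satisfy the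
condition (i) on the corresponding scales."; p. 181 "In components with the function 1 − χ_k^{(0)} we have introduced
new large fields, therefore they do not satisfy the condition (ii), and we exclude them from the region Z. They are
not changed by the subsequent operations, and we treat them in the same way as the remaining large field regions.";
and, for the arithmetic (α) below, p. 175 "For d = 4 the bare coupling constant behaves asymptotically as
(a + b log ε⁻¹)^{−1/2}, for ε → 0, with some positive constants a, b, hence the bound does not give any positive power
of ε. It is still small for ε small, and it controls a large number of steps, but this number is a small fraction of
the total number of steps." (the bound being (0.1), `exp(−p₀(g₀))` per large plaquette, `p₀(g₀) = A₀(log g₀⁻²)^{p₀}`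
loc. cit.).

## THE TECHNIQUE (seat P2; T4-DAG D9 self-row) — coupling of the two towers on path space

Run the undressed tower `ρ₀ ↦ ρ₁ ↦ … ↦ ρ_K`, `ρ_{k+1} = ℝ(Tρ_k)`, as a Markov chain `X₀ → X₁ → … → X_K` (state =
field configuration at scale k together with the term label), law `μ` on PATH SPACE `Ω`.  By linearity the DRESSED
tower started from `ρ₀·f_t`, `f_t = exp(t·W∘avg^K)` (`W` = the unit-lattice loop variable, `|W| ≤ 1`), is THE SAME
chain reweighted by the initial factor `exp(t·f)`, `f := W(avg^K X₀)`.  Hence, with `F K := σ(X_K)` (the endpoint),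
  `ρ_K^t / ρ_K = E_μ[exp(t f) ∣ F K]`   — the dressed final density is the undressed one times the conditional
expectation of the dressing given the endpoint (§4, `integral_mul_exp_eq_integral_mul_dressingFactor`: for every
endpoint observable `g`, `∫ g·e^{tf} dμ = ∫ g·μ[e^{tf} ∣ F K] dμ`).  This is the COUPLING: both runs live on `(Ω, μ)`
and differ by one explicit random factor.  Along the BACKWARD filtration `F 0 ⊇ F 1 ⊇ … ⊇ F n` (antitone; `F 0` =
the whole path, `F n` = the endpoint; the index set is ANY refinement of the scale ladder — in the cell's use one
index per RESAMPLED LARGE-FIELD COMPONENT and per T-fluctuation block, not one per scale, see (A3) below) the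
Doob–Lévy increments
`incr μ F f i = μ[f ∣ F i] − μ[f ∣ F (i+1)]` of `T4MeanChannel` (K14o) telescope:
  `f = μ[f ∣ F n] + Σ_{i<n} incr μ F f i`   (f is `F 0`-measurable; K14s),
each increment is adapted and CONDITIONALLY CENTRED one level up (K14p).  THE POINT OF THIS MODULE is the exponential
(not second-moment) consequence:

  (AZ)  `exp(t·μ[f∣F n]) ≤ μ[exp(t f) ∣ F n] ≤ exp(t·μ[f∣F n]) · exp(t²·Σ_{i<n} σ_i²/2)`   a.e.,
        whenever `|incr μ F f i| ≤ σ_i` a.e. (`condExp_exp_dressing_sandwich`, §3),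

i.e. `log(ρ_K^t/ρ_K) = t·h + Ψ` with `h = μ[f ∣ F K]` (the FIRST-ORDER / mean channel) and `0 ≤ Ψ ≤ ½t²Σσ_i²` (the
FLUCTUATION channel) — a conditional AZUMA–HOEFFDING inequality (upper: Hoeffding's chord `T4MomentMayerStep.
exp_le_cosh_add_mul_sinh_div` under `μ[·∣F (i+1)]`, iterated by the tower property; lower: the tangent `1 + x ≤ eˣ`).
NO smallness of `Σσ_i` is needed — only of `Σσ_i²`; and in the VARIANCE FORM (`…_of_condVar`, for `|t|·2R ≤ 1`)
only of the sum of CONDITIONAL VARIANCES `Σ_i v_i`, `μ[incr_i² ∣ F (i+1)] ≤ v_i`, the range of the increments being the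
crude `2R` (`incrementBound_crude`).  That is the whole gain of the pathwise organisation over an
oscillation × count bookkeeping: T4-DAG O3a v3 COUNT CORRECTION records that `Σ_n (osc ≍ θⁿ)·(count ≍ L^{4n})`
DIVERGES for every `θ > L^{-4}` (dead end (h) strengthened), and `T4MeanChannel` (K14m′) / `T4PairDecorrelation` reach a
log-moment bound only under the ℓ¹ hypothesis `Σ|c_p|b_p ≤ 1`; (AZ) replaces ℓ¹ by ℓ²: with the certified contraction
`θ₁ = L^{-3}` of unit-loop pull-backs (`T4LoopPullback.theta1_exact`) and WORST-CASE counts `≤ N₀(L⁴)ⁿ` of components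
of age `n` under the loop tube (no `e^{-p₀}` weights in the terms, no tube budget (TOB-k)),
`Σσ² ≤ N₀·A·Σ_n (n+1)^q (L⁴θ₁²)ⁿ = N₀·A·C_q(L^{-2}) < ∞` UNIFORMLY IN K (§5, `sqBudget_le`, `ne1p_sqRate_lt_one`) —
PROVIDED the per-event sizes obey that age profile, which is true for components of tame size and FALSE for giant
ones (header (A1″)): in the final, random-geometry form (§3 `condExp_exp_dressing_sandwich_of_varProxy`) the budget is
the EVENT `{Σ V_i ≤ B}` of tame realised geometry, and the large-field suppression enters ONCE, as the conditional
probability of its complement, instead of as ℓ¹ weights in every term.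

## WHAT IS PROVED (all [folklore]; finite measure `μ`, antitone `F`, real `t`)

§1 `condExp_exp_mul_le_of_condCentred` / `one_le_condExp_exp_mul_of_condCentred`: ONE-STEP CONDITIONAL HOEFFDING —
   `|Y| ≤ σ` a.e. and `μ[Y∣m] = 0` a.e. ⇒ `1 ≤ μ[e^{tY}∣m] ≤ e^{t²σ²/2}` a.e. (Mathlib has the unconditional lemma
   `ProbabilityTheory.hasSubgaussianMGF_of_mem_Icc_of_integral_eq_zero` and the kernel-form Azuma sum
   `HasSubgaussianMGF.sum_of_hasCondSubgaussianMGF`; the conditional one-step lemma in `condExp` form is not there, and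
   the chord proof needs no standard-Borel hypothesis); `condExp_exp_mul_le_of_condVar`: ONE-STEP CONDITIONAL
   BERNSTEIN-TYPE bound — `|Y| ≤ b`, `μ[Y∣m] = 0`, `μ[Y²∣m] ≤ v` a.e., `|t|b ≤ 1` ⇒ `μ[e^{tY}∣m] ≤ e^{t²v}` a.e. (from
   Mathlib `Real.abs_exp_sub_one_sub_id_le`: `eˣ ≤ 1 + x + x²` on `|x| ≤ 1`); `condExp_exp_mul_le_exp_condVarProxy`: the
   same with a variance PROXY (a function `V`, `μ[Y²∣m] ≤ V` a.e. ⇒ `μ[e^{tY}∣m] ≤ e^{t²V}` a.e.).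
§2 `condExp_exp_sum_prod_sandwich` (PRODUCT LEMMA: one-step sandwiches `1 ≤ μ[e^{tS_i}∣F (i+1)] ≤ c_i` a.e. ⇒
   `1 ≤ μ[exp(t Σ_{i<n} S i) ∣ F n] ≤ ∏ c_i` a.e., by pull-out + tower + induction on the shifted filtration);
   `condExp_exp_sum_sandwich`: CONDITIONAL AZUMA–HOEFFDING — summands `S i` `F i`-measurable, `|S i| ≤ σ i` a.e.,
   `μ[S i ∣ F (i+1)] = 0` a.e. (i < n) ⇒ `1 ≤ μ[exp(t Σ_{i<n} S i) ∣ F n] ≤ exp(t² Σ_{i<n} σ_i²/2)` a.e.;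
   `condExp_exp_sum_sandwich_of_condVar`: the VARIANCE FORM — additionally `μ[S_i²∣F (i+1)] ≤ v i`, `|t|σ i ≤ 1` ⇒
   upper bound `exp(t² Σ_{i<n} v i)`; `condExp_exp_sum_sub_var_le_one`: the FREEDMAN-TYPE supermartingale bound with
   PREDICTABLE proxies `V i` (`F (i+1)`-measurable, a.e. bounded, `μ[S_i²∣F (i+1)] ≤ V i`), `|t|b ≤ 1` ⇒
   `μ[exp(tΣS_i − t²ΣV_i) ∣ F n] ≤ 1` a.e.; `condExp_indicator_exp_sum_le`: hence
   `μ[1_{ΣV_i ≤ B}·exp(tΣS_i) ∣ F n] ≤ e^{t²B}` a.e.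
§3 `IncrementBound` / `IncrementVarBound` (hypothesis SHAPES: a.e. bounds `σ i` on the Doob–Lévy increments of `f`
   along `F`, resp. a.e. bounds `v i` on their conditional second moments), `incrementBound_crude` (`|f| ≤ R` ⇒ range
   `2R` for free), `condExp_exp_dressing_sandwich_of_incr` (dressing sandwich from ANY increment sandwich),
   `condExp_exp_dressing_sandwich` = (AZ), `condExp_exp_dressing_sandwich_of_condVar` (variance form: `|t|·2R ≤ 1` ⇒
   `exp(t h) ≤ μ[e^{tf}∣F n] ≤ exp(t h)·exp(t²Σ v_i)`); `IncrementVarProxy` (shape: predictable proxies) with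
   `condExp_indicator_exp_dressing_le` (`μ[1_{ΣV ≤ B} e^{tf}∣F n] ≤ e^{th}e^{t²B}`),
   `condExp_indicator_compl_exp_dressing_le` (`μ[1_{B < ΣV} e^{tf}∣F n] ≤ e^{|t|R}·μ[1_{B < ΣV}∣F n]`) and the assembled
   `condExp_exp_dressing_sandwich_of_varProxy` (`e^{th} ≤ μ[e^{tf}∣F n] ≤ e^{th}e^{t²B} + e^{|t|R}μ[1_{B<ΣV}∣F n]`);
   `log_dressingFactor_sub_mean_mem` (the log form `0 ≤ Ψ ≤ ½t²Σσ²`);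
   §3b `condExp_incr_sq_le_condExp_sq_sub` (`μ[incr_i²∣F(i+1)] ≤ μ[(μ[f∣F i] − Z)²∣F(i+1)]` for ANY predictable
   bounded `Z`), `incrementVarProxy_of_domainSplit` (predictable centres `Z i`, `|Z i| ≤ R`, domains `D i ∈ mΩ`,
   predictable radii `c i` with `|μ[f∣F i] − Z i| ≤ c i` a.e. on `D i` ⇒ `IncrementVarProxy` with
   `V i = (c i)² + 4R²·μ[1_{(D i)ᶜ}∣F(i+1)]`; `stronglyMeasurable_domainSplitProxy` / `ae_abs_domainSplitProxy_le`
   supply the predictability and the bound `cmax² + 4R²`), `measureReal_lt_sum_condExp_indicator_le` (Markov: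
   `μ{δ < Σ_i μ[1_{(D i)ᶜ}∣F(i+1)]} ≤ δ⁻¹·Σ_i μ((D i)ᶜ)`);
   §3c `IncrementVarProxy.ae_nonneg` (proxies are a.e. `≥ 0`), `measureReal_lt_sum_le_inv_mul_sum_integral` (Markov for
   the budget itself: predictable a.e.-bounded a.e.-non-negative `V i`, `B > 0` ⇒ `μ{B < Σ_{i<n} V i} ≤ B⁻¹Σ_{i<n}∫V i dμ`),
   `incrementVarProxy_of_predictableDomainSplit` (domains `D i ∈ F(i+1)` ⇒ proxy `(c i)² + 4R²·1_{(D i)ᶜ}`, with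
   `stronglyMeasurable_predictableDomainSplitProxy` / `abs_predictableDomainSplitProxy_le`);
   `dressingFactor_crude_sandwich` (`e^{-|t|R} ≤ μ[e^{tf}∣F n] ≤ e^{|t|R}` from `|f| ≤ R` alone — the path-space form of
   the one-step oscillation sandwich `T4OscSandwich.ropRealIn_exp_osc_sandwich_unif`; it is K-uniform but NOT small and is
   NOT an input of the uniqueness spine: dead end (h)).
§4 `integral_mul_exp_eq_integral_mul_dressingFactor`: the coupling identity (K14b BY NAME);
   `integral_mul_exp_le_of_varProxy`: the INTEGRATED random-geometry bound for bounded non-negative endpoint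
   observables, `∫ g e^{tf} ≤ e^{t²B}∫ g e^{th} + e^{|t|R}·Cg·μ{B < ΣV_i}` — only the UNCONDITIONAL probability of the
   giant-geometry event appears (the consumer form for E4/U5b); `integral_mul_exp_mean_le`: the integrated Jensen
   side `∫ g e^{th} ≤ ∫ g e^{tf}` (no budget); `integral_mul_exp_le_of_domainSplit`: the
   END-TO-END form from the primitive domain-split data —
   `∫ g e^{tf} ≤ e^{t²(B₀+4R²δ)}∫ g e^{th} + e^{|t|R}·Cg·(μ{B₀ < Σ(c i)²} + δ⁻¹Σ_i μ((D i)ᶜ))`, i.e. DRESSED ≤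
   UNDRESSED-reweighted-by-the-mean-channel × a K-uniform factor + crude × (geometry tail + summed UNCONDITIONAL
   domain-failure probabilities);
   §4b `integral_mul_exp_le_of_varProxy_moments` (`… + e^{|t|R}·Cg·B⁻¹·Σ_{i<n}∫V i dμ`, `B > 0`),
   `integral_mul_exp_le_of_predictableDomainSplit` (`∫ g e^{tf} ≤ e^{t²B₀}∫ g e^{th} + e^{|t|R}·Cg·(μ{B₀ < Σ(c i)²} +
   μ(⋃_{i<n}(D i)ᶜ))` — no `δ`, the domain failures as ONE unconditional event) and `…_moments` (its geometric tail by
   Markov: `B₀⁻¹Σ_i ∫(c i)² dμ`).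
§5 `budget_le` / `sqBudget_le`: `Σ_{e∈s} w_e ≤ N₀·A·C_q(Λθ²)` from level counts `≤ N₀Λ^{lvl}` and sizes
   `w_e ≤ A(lvl+1)^q(θ²)^{lvl}` when `Λθ² < 1` (`w = σ²` or `w = v`; `T4TubeBudget.geomPolyConst` BY NAME), K nowhere;
   `ne1p_sqRate_lt_one`: `L⁴·(L^{-3})² < 1` and `ne1p_meanRate_lt_one`: `L⁴·L^{-3}·L^{-2} < 1` for `2 ≤ L` (the two NE1′
   channels' ratios, cf. `T4TubeBudget.tubeBudget_of_sqRate` where the same two products appear as `≤ 1` budget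
   conditions); `fluctuationChannel_le_uniform` / `…_of_condVar` (composition: `0 ≤ Ψ ≤ ½t²B`, resp. `≤ t²B`, a.e.);
   §5b `levelSum_le` (weights indexed by levels `lvl i < K` with per-LEVEL sums `≤ A(m+1)^q r^m`, `0 ≤ r < 1` ⇒ total
   `≤ A·C_q(r)`, no `n`, no `K`), `integral_mul_exp_le_uniform` (THE END-TO-END K-UNIFORM FORM: `IncrementVarProxy` +
   the level first-moment profile `Σ_{lvl i = m}∫V i dμ ≤ A(m+1)^q r^m` ⇒
   `∫ g e^{tf} ≤ e^{t²B}∫ g e^{th} + e^{|t|R}·Cg·B⁻¹·A·C_q(r)` for every `B > 0`, `|t|·2R ≤ 1`), `ne1p_sqRate_nonneg`;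
   `integral_mul_exp_le_uniform_of_slots` (v6, SLOT FORM: increments indexed by slots with levels, COUNTS
   `#{slots of level m} ≤ N₀Λ^m` and PER-SLOT EXPECTED PROXIES `∫V i dμ ≤ A(lvl i+1)^q(θ²)^{lvl i}`, `Λθ² < 1` ⇒
   `∫ g e^{tf} ≤ e^{t²B}∫ g e^{th} + e^{|t|R}·Cg·B⁻¹·N₀·A·C_q(Λθ²)` — the worst-case count is affordable because every
   expected proxy carries `θ^{2·lvl}`; `budget_le` + `integral_mul_exp_le_of_varProxy_moments`).
§5c (v7) `prod_one_add_mul_indicator_eq_pow`, `pow_card_filter_eq_sum_powerset` (pointwise subset expansion of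
   `κ^{#{j ∈ J : ω ∈ A j}}`), `integrable_pow_card_filter`, `integral_pow_card_filter_le_prod` / `_le_exp` (PRODUCT
   DOMINATION `μ(⋂_{j∈S} A j) ≤ μ(Ω)∏_{j∈S} ε_j` for all `S ⊆ J`, `κ ≥ 1` ⇒ `∫ κ^{#{j : ω ∈ A j}} dμ ≤
   μ(Ω)∏_{j∈J}(1 + (κ−1)ε_j) ≤ μ(Ω)exp((κ−1)Σ_{j∈J} ε_j)`), and `integral_mul_exp_le_uniform_of_nesting` (END-TO-END:
   slots with levels and counts `≤ N₀Λ^m`; per slot a finite set of higher levels with irregularity events `A i j`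
   dominated by products with `Σ_j ε i j ≤ E`; proxies dominated a.e. by `C²(θ²)^{lvl i}κ^{#{j irregular}}` ⇒
   `∫ g e^{tf} ≤ e^{t²B}∫ g e^{th} + e^{|t|R}·Cg·B⁻¹·N₀·C²μ(Ω)e^{(κ−1)E}·C_0(Λθ²)`, every `B > 0` — no `n`, no `K`);
   `integral_mul_exp_le_uniform_of_nesting_add` (v8: proxies dominated by the nesting term PLUS `U i ≥ 0` with
   `Σ_{i<n}∫U i dμ ≤ Utot` ⇒ tail `e^{|t|R}·Cg·B⁻¹·(N₀C²μ(Ω)e^{(κ−1)E}C_0(Λθ²) + Utot)` — locality (A1) and T-blocks (A3)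
   may be discharged by ANY K-uniform first-moment budget).

## WHAT IS NOT PROVED — the located inputs of NE1′ in this organisation (none printed as such, none kernel)

(A1) SIZES `σ_e` of the per-component increments: `σ_e ≤ c_e + ℓ_e`, `c_e` = oscillation of the conditional-mean
     function under resampling of component `e` (≲ `C_W·ℓ(C∩tube)·b_n·θ₁ⁿ`, `n` = age, `b_n ≤ 4(100MR_{K−n})⁴`; the
     `θ₁ⁿ` is certified, the rest is the cell's NE1a reading `T4AvgSensitivity.LoopOscBound`), `ℓ_e` = LOCALITY of
     conditional means (how much revealing `e` moves the conditional means of the not-yet-revealed components; zero for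
     an exact product fibre law `T4JointDressing.fibreIntegral_union_mul_eq`, small by inter-component decay otherwise).
(A1′) SUP versus VARIANCE.  The dressing `f = W(avg^K X₀)` is a function of the INITIAL field; a resampling event does
     not touch `X₀` — its increment is the loss of information about `X₀` when the OLD (large-field) values on the
     component are ERASED: `incr_e = ψ(x_old, ext) − ∫ψ(·, ext) d(backward law)`, `ψ = μ[f ∣ state before e]`.  A SUP
     bound `σ_e` (Hoeffding form) ranges over the whole support of the erased values — large fields, where the cell's
     NE1a reading `LoopOscBound av dom …` is only available on its domain `dom`; the VARIANCE form asks instead for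
     `v_e = ∫(ψ − ∫ψ)² d(backward law)`, a second moment under the actual one-step backward law (large old fields weighted
     by the density itself), with the range entering only through `|t|·2·sup|f| ≤ 1`.  Which of `σ_e²`, `v_e` obeys
     the age profile `A(n+1)^q θ₁^{2n}` is (A1)'s content either way; the variance form is the weaker request.
(A1″) COMPONENT SIZES — the budget is an EVENT.  The COUNT of tube-meeting components of age `n` is worst-case
     `≤ N₀Λⁿ` (disjoint components each meeting the tube are fewer than the tube's cubes), but a component's SIZE is
     unbounded, and its direct increment is `≲ min(2, C·θ₁ⁿ·|Λ_e ∩ T_n|)` (`T_n` = the fine bonds on which `W∘avg^n`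
     depends, `|T_n| ≍ |C|·L^{4n}`; total variation `|T_n|θ₁ⁿ ≍ |C|Lⁿ` = the loop's length in fine units), so
     `Σ_e σ_e² ≲ Σ_n |C|·L^{-2n}·max_e |Λ_e ∩ T_n|` + (finitely many young ages `Lⁿ ≲ M`, `O(1)` each): K-UNIFORM on
     paths whose tube-meeting components of age `n` have tube-volume `≤ L^{(2−δ)n}`, and on no others — neither a sup
     bound `σ_e` nor a constant variance bound `v_e` holds path-independently.  The typed answer is the PREDICTABLE-PROXY
     form: `V_i` = a function of the realised geometry of event `i` (it is `F (i+1)`-measurable: the component is part of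
     the term label, which persists into the future), the supermartingale bound `condExp_exp_sum_sub_var_le_one`, and the
     split of the dressing factor along `{Σ V_i ≤ B}` (`condExp_exp_dressing_sandwich_of_varProxy`): the tame part costs
     `exp(t²B)` with `B` K-uniform, the giant part `exp(|t|R)·μ[1_{B < ΣV} ∣ F n]` — and THAT conditional probability is
     where the printed large-field suppression (`e^{−p₀(g_k)}` per large-field cube, B13 (2.30) p. 18 as read in T4-DAG
     O3a v3; CONDITIONAL on (B)) enters, once, as a tail estimate (`P(giant at age n) ≲ |T_n|M^{-4}·exp(−p₀L^{(2−δ)n}/M⁴)`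
     unconditionally — summable and small; integrated against bounded endpoint observables only this unconditional
     probability is needed, cf. §4; the a.e.-conditional form is stronger than the uses require).  NOT PRINTED, NOT
     PROVED: the suppression estimate itself and its survival in the observable-attached format.
(A1⁗) [v6 — CORRECTION of (A1″) and of (β) below, from the definitional sentences (iii) of the CITATION HEADER]  The
     components ℝ resamples are SIZE-BOUNDED BY DEFINITION (p. 177 (i): inside a cube of size `100MR_k`) and a
     component inside which NEW large fields appear is DEFERRED, unchanged, to later steps (p. 181) — so in the chain
     dictionary an ℝ-event erases at most `(100MR_k)^4`-many level-`k` bond variables, a giant large-field region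
     generates NO event until, shrunk by the rescalings, it satisfies (i)–(ii), and the erased variables are RESTRICTED
     by the characteristic functions introduced at the integration steps (p. 181: "we introduce at first new
     characteristic functions in such a way that the function restricting the fluctuation field does not depend on the
     background field"; the precise restricted domain is a READING this seat flags, not asserts) — they are «large» at
     the CREATION scale of their region, not arbitrary at the INTEGRATION scale.  CONSEQUENCES for the cost model (cell
     analysis, NOT printed, NOT proved): the direct part of the radius of event `e` at depth `m(e)` is
     `≲ C_W·|w|·D·(100MR)^4·θ₁^{m(e)}·κ^{irr(e)}`, where `irr(e)` = the number of levels above `e` at which the nested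
     block over `Λ_e` violates NE1a's regular-background condition (because OTHER, persisting large-field regions sit
     inside it) and `κ ≤ L³` is the loss of at most one contraction per such level; the randomness of the budget sits in
     `irr(e)`, in the locality `ℓ_e` and in the COUNT of events — and the WORST-CASE count `N₀L^{4m}` is affordable
     against `θ₁^{2m}` (`sqBudget_le`, `integral_mul_exp_le_uniform_of_slots`), so (α) below is honoured automatically
     (every cost carries `θ₁^{2m}`) and the «giant component» scenario of (A1″) does not arise for the printed ℝ.  Whether
     the printed restrictions place the erased configuration INSIDE NE1a's certified domain ((158)-boxes around
     (52)-regular backgrounds, T4-DAG O3c.E3*) is the domain-match question of row O3c.E3-TS: if YES, the domain `D_e`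
     of (MI-1′) holds on the support of every term (`μ((D_e)ᶜ) = 0`: v4's split applies with NO failure channel); if
     NO, the Λ-relative extension (MI-1″) is needed.  Either way the located inputs take the form (MI-F1)/(MI-F2) at the
     end of this header.
(A2) THE MEAN CHANNEL `h = μ[f ∣ F K] = W(X_K) + m`, `m = μ[f − W(X_K) ∣ F K]` (the conditional mean of the total
     loop discrepancy given the endpoint): it is assembled from the one-event FIRST-ORDER conditional means, whose
     typed homes are `T4FirstOrderSize.MeanLipschitz` / `CondMeanSuppression` (the (β)-node, assembled at birth scale
     in `T4MeanLipschitzBirth`; record `t4/T4-EST-O3Ei1.md`); T4-DAG v14 §6 books the k-UNIFORM form of those binders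
     («the k-UNIFORM (B, α₁) of the slice … and INS-2's level-free (ρ₁, ρ₂, w)») as THE open estimate.  (AZ) isolates
     this channel and says NOTHING about it.  Its count arithmetic is the first-order ratio `Σ_n (L⁴θ₁φ)ⁿ`,
     `φ = L^{-2}` (`ne1p_meanRate_lt_one`).
(A3) THE REFINEMENT: an antitone filtration interpolating the scale ladder one resampled component (and one
     T-fluctuation block) at a time such that (A1) holds.  Per-SCALE indexing is NOT enough: `σ_scale ≍ N·b·θ₁ⁿ` gives
     `Σσ² ≍ Σ L^{2n}` — divergent; the refinement is where (A1)'s `ℓ_e` is paid.  T-STEPS: for a PURE-T tower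
     `f = W(X_K)` and every increment vanishes (spectator identity, `T4Spectator`); in the mixed tower the T-step
     increments do NOT vanish — the T-fibre at scale `k` averages the conditional mean, given the future, of the PAST
     discrepancy (events at scales `j < k`), an `ℓ`-type locality term carrying no new oscillation (per past event `e`:
     `≲ c_e·s_{k−j}` with `s` the coarse-to-fine sensitivity of the backward laws — cell analysis, NOT printed, NOT
     proved); these increments are indexed as well and are meant to fall in the same ℓ² budget with polynomial losses
     (`(lvl+1)^q` in `sqBudget_le`).
(A4) COMPLEX `t` / `μ`-UNIFORM RADII: (AZ) is real-`t`; the derivative at `t = 0` of `log μ[e^{tf}∣F K]` is `h` by the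
     squeeze `0 ≤ Ψ ≤ ½t²Σσ²` (not typed here); analyticity in `t` of radius ∞ with the crude bound `|t|R` is §3's
     `dressingFactor_crude_sandwich` extended off the real axis (not typed here).
The typed statement «NE1′-size ⇐ (A1)+(A3)» is `condExp_exp_dressing_sandwich` + `sqBudget_le` (Hoeffding form),
`condExp_exp_dressing_sandwich_of_condVar` + `budget_le` (variance form), or `condExp_exp_dressing_sandwich_of_varProxy`
(random-geometry form, budget event + tail); the exact missing inequalities for the carver are (MI-1) the age profile
`V_e ≤ A(n+1)^q θ₁^{2n}·(tube-volume of e)·(…)` of the conditional variances incl. the locality part `ℓ_e` (A1)/(A1′),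
(MI-2) the large-field tail `μ[giant old component]` (A1″), and, separately, (MI-3) = (A2) the mean channel — record
`t4/T4-EST-NE1p-P2.md` (alias `T4-EST-NE1p-coupling.md`).  After §3b/§4 (v4) the two inequalities this technique
leaves open take their FINAL, primitive form (the hypotheses of `integral_mul_exp_le_of_domainSplit`; cell analysis,
NOT printed, NOT proved):
(MI-1′) DOMAIN OSCILLATION OF CONDITIONAL MEANS: for every event `e` (component `Λ_e` of age `n(e)`, or T-block) a
     predictable centre `Z_e` and a domain `D_e ∈ mΩ` with `|μ[f∣F e] − Z_e| ≤ c_e := C_W·θ₁^{n(e)}·|Λ_e ∩ T_{n(e)}| + ℓ_e`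
     a.e. on `D_e` (`Z_e` = the conditional mean evaluated at a reference value of the erased variables; `D_e` = «the
     erased configuration of `e` lies in the domain of the cell's NE1a reading `LoopOscBound av dom …`»; `ℓ_e` the
     locality term of (A1)), together with the GEOMETRY TAIL `μ{B₀ < Σ_e c_e²} ≤ ε_geo` K-uniformly (no giant
     tube-meeting components: (A1″));
(MI-2′) SUMMED DOMAIN FAILURE: `Σ_e μ((D_e)ᶜ) ≤ ε_lf` K-uniformly — a sum over events of UNCONDITIONAL probabilities
     that an erased configuration is out of the NE1a domain (if `dom` only excludes fields at a FIXED distance from the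
     identity, these are tails far beyond the printed large-field thresholds `p(g_k)`; where exactly the printed
     suppression B13 (2.30) p. 18 — as read in T4-DAG O3a v3, CONDITIONAL on (B) — places them is a READING this seat did
     not do: GAPS G-ne1p2-2).
Given (MI-1′)+(MI-2′)+(A3): for `|t|·2R ≤ 1` and bounded endpoint observables `g ≥ 0`,
`∫ g e^{tf} ≤ e^{t²(B₀+4R²δ)}·∫ g e^{t h} + e^{|t|R}‖g‖_∞(ε_geo + δ⁻¹ε_lf)` and `∫ g e^{tf} ≥ ∫ g e^{t h}` [kernel];
with (MI-3) in addition `h = W(X_K) + m`, `|m|` small — the full NE1′ in this organisation.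

After §3c/§4b/§5b (v5) — THE FIRST-MOMENT CHANNEL, and a CORRECTION of the cost model behind (MI-1′)/(MI-2′).  Two
counting facts of the cell's own dictionary (cell analysis, NOT printed, NOT proved; record `t4/T4-EST-NE1p-P2.md` v1.2
§5): (α) the EXPECTED NUMBER of resampling events of depth `m` (= `K − k`) under the unit tube is
`≍ N₀·L^{4m}·e^{−p₀(g_{K−m})}`, UNBOUNDED as `K → ∞` — with the printed `p₀(g) = A₀(log g⁻²)^{p₀}` and
`g_k⁻² ≍ β₀·(K−k)·log L` (BetaPertH) the factor `e^{−p₀}` decays slower than any `L^{−4m}` (the same arithmetic T4-DAG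
records at U5.R (0.2): «`e^{−p₀(g_j)}` per unit volume per recent step, NOT summable in K»); hence EVERY per-event cost
must itself carry the rate `θ₁^{2m}`: a per-event failure probability that does not decay with the depth — however
small — is summed against a divergent count (printed form of the same remark: CITATION HEADER (iii), p. 175); (β) the
ERASED values of an ℝ-event belong to a LARGE-FIELD region — large at the region's CREATION scale — and at the
integration scale they are RESTRICTED by the printed characteristic functions, NOT arbitrary (v6 correction (A1⁗); the
v5 wording «fails on EVERY event» presupposed NE1a's domain = small field at the CURRENT threshold, which is exactly the
unresolved domain-match question O3c.E3-TS).  CONSEQUENCES: a domain hypothesis on the erased values is either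
STRUCTURAL (holds on the support of every term, failure probability `0`) or useless — the summed domain-failure channel
of v4 (`δ⁻¹Σ_e μ((D_e)ᶜ)`, (MI-2′)) is adequate only for failure modes whose SUMMED probability is K-uniform (decaying
faster than `L^{−4m}e^{+p₀}`), never for a depth-independent failure rate; and a bad configuration of the geometry on
which many events degrade at once (irregular nesting, (A1⁗)) is either absorbed into random predictable radii paid in
FIRST MOMENTS (§5b) or charged ONCE as a predictable event (§3c/§4b: `D_e ∈ F(e+1)`, tail `μ(⋃_e (D_e)ᶜ)`), never per
event.
The final primitive form of what this technique leaves open (= the hypotheses of `integral_mul_exp_le_uniform`, resp.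
`integral_mul_exp_le_of_predictableDomainSplit_moments`) is therefore:
(MI-1″) LABEL-WISE OSCILLATION RADII (pathwise, predictable, NO domain on the erased set): for every event `e` a
     predictable centre `Z_e`, `|Z_e| ≤ R`, and a PREDICTABLE radius `c_e` — a function of the realised multi-scale
     large-field geometry over `Λ_e`, which is part of the term labels and persists into the future — with
     `|μ[f∣F e] − Z_e| ≤ c_e` a.e.; expected shape `c_e ≤ C_W·|w|·Δ(e)·θ₁^{r(e)} + ℓ_e`, where `r(e) ≤ m(e)` counts the
     levels above `e` at which the nested block over `Λ_e` is REGULAR (sparse in large-field content — every level when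
     no other large-field region of comparable size sits over `Λ_e`), `Δ(e)` = the displacement scale of the block at the
     first regular level (bonds INSIDE an irregular block do not contract: the factor `|Λ_e ∩ T|` of (MI-1′) was too
     optimistic for giant components and is replaced by `Δ(e)·θ₁^{r(e)−m(e)}`-type losses), `ℓ_e` the locality term of
     (A1).  This is the cell's NE1a reading (`T4AvgSensitivity.LoopOscBound`, rate `θ₁` certified on the (158)-box /
     regular-background domains, T4-DAG O3c.E3*) EXTENDED TO LABEL-COMPATIBLE CONFIGURATIONS — arbitrary (label-bounded)
     on the large-field regions of the label, regular off them — i.e. precisely a DOMAIN-MATCH question of the kind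
     T4-DAG row O3c.E3-TS books («which consumer region is a box / collar / tower-small family»), here with consumer
     region = the erased fibre of an ℝ-event; `LoopOscBound`'s `dom k` is ONE FIXED set of level-`k` fields and cannot
     express «regular off Λ, arbitrary on Λ», so (MI-1″) is NOT typed over `T4AvgSensitivity`'s carriers here.  NOT
     PRINTED, NOT PROVED.
(MI-1‴) LEVEL FIRST MOMENTS under the UNDRESSED path law: `Σ_{e : m(e) = m} ∫ c_e² dμ ≤ A·(m+1)^q·(L⁴θ₁²)^m`,
     K-uniformly (`L⁴θ₁² = L⁻² < 1`, `ne1p_sqRate_lt_one`) — sums over term labels of partition-function-normalised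
     weights `∫ρ_k(Z,V)dV` times squared radii, i.e. LARGE-FIELD-REGION PROBABILITIES weighted by the multi-scale
     sparsity functional `θ₁^{2r(e)}Δ(e)²`: the currency of the printed inductive bounds (`e^{−p₀(g_k)}` per large-field
     cube, B13 (2.30) p. 18 as read in T4-DAG O3a v3 / [Balaban1989LargeFieldII] Thm 1-type; CONDITIONAL on (B)); by (α)
     the profile is summable BECAUSE of `θ₁^{2m}`, not because of `e^{−p₀}`.  NOT PRINTED, NOT PROVED.
(MI-2″) (optional) RARE PREDICTABLE PATHOLOGIES `D_e ∈ F(e+1)` with `μ(⋃_e (D_e)ᶜ) ≤ ε` K-uniformly — needed only if the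
     radii of (MI-1″) are not taken worst-case over the label; a NON-predictable domain (a condition on the erased values
     themselves) is admissible only for failure modes summable against (α) (v4's channel).
(MI-3) = (A2), the mean channel — unchanged, the β-node.
Given (MI-1″)+(MI-1‴)+(A3): for `|t|·2R ≤ 1`, every `B > 0` and bounded endpoint observables `g ≥ 0`,
`∫ g e^{t h} ≤ ∫ g e^{tf} ≤ e^{t²B}·∫ g e^{t h} + e^{|t|R}·‖g‖_∞·B⁻¹·A·C_q(L⁻²)` [kernel: `integral_mul_exp_mean_le`,
`integral_mul_exp_le_uniform`] — constants free of `n`, `K`, `ε`; with (MI-3), `h = W(X_K) + m`, `|m|` small.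

After (A1⁗) (v6) — THE LOCATED INPUTS IN SLOT FORM (= the hypotheses `hw` and `hcard` of
`integral_mul_exp_le_uniform_of_slots`; slots = (level `k`, tube cube `c`) and T-blocks, `V_slot = 1_{event at c}·c_e²`,
`hcard` = the worst-case count `≤ N₀(L⁴)^m`, free; cell analysis, NOT printed, NOT proved):
(MI-F1) NESTING-REGULARITY RADII: for every ℝ-event `e` (level `k`, depth `m = K − k`, component `Λ_e ⊂` a `100MR_k`-cube)
     a predictable centre `Z_e` and the predictable radius `c_e = C_W·|w|·D·(100MR)^4·θ₁^{m}·κ^{irr(e)} + ℓ_e` with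
     `|μ[f∣F e] − Z_e| ≤ c_e` a.e. — CONTENT: NE1a on the printed restricted domain of the erased variables (domain match
     O3c.E3-TS, or its Λ-relative extension (MI-1″)), composed through the regular nested levels with a loss `≤ κ ≤ L³`
     per irregular level, plus the locality `ℓ_e` of the backward laws (A1); T-block slots analogously (A3).
(MI-F2) IRREGULAR-NESTING MOMENTS under the UNDRESSED law: `sup_{k, c} ∫ κ^{2·irr_k(c)} dμ ≤ A′` K-uniformly (`irr_k(c)` =
     the number of levels `j > k` at which the level-`j` block over the cube `c` is irregular), together with the same
     first-moment control of `ℓ_e²` and of the T-block proxies — then `hw` holds with `A = (C_W|w|D(100MR)^4)²·A′·(poly)`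
     and `θ = θ₁`.  `irr_k(c) ≥ r` requires `r` nested blocks each containing persisting large-field regions of an
     `L`-INDEPENDENT volume fraction, so (MI-F2) is a statement about MULTI-LEVEL LARGE-FIELD-REGION PROBABILITIES
     (`μ{the blocks over c at levels j₁ < … < j_r are all irregular} ≲ ∏ ε_{j_i}` with `κ²·Σ_j ε_j < ∞`, `ε_j` of the size
     of the printed per-cube suppression `e^{−p₀(g_j)}` divided by the volume fraction) — the currency of the printed
     inductive bounds (B13 (2.30) p. 18 as read in T4-DAG O3a v3 / [Balaban1989LargeFieldII] Thm 1-type; CONDITIONAL on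
     (B); NOT re-read here).  KERNEL FORM (v7, §5c): if the irregularity events of the levels `j ∈ J` above a cube are
     DOMINATED BY PRODUCTS, `μ(⋂_{j∈S} A j) ≤ μ(Ω)∏_{j∈S} ε_j` for all `S ⊆ J`, then `∫ κ^{irr} dμ ≤
     μ(Ω)exp((κ−1)Σ_{j∈J} ε_j)` (`integral_pow_card_filter_le_exp`), so (MI-F2) = product domination + `Σ_j ε_j ≤ E`
     uniformly in `K`; arithmetic of the latter [on p. 175 (iii)]: with `d` = the depth of level `j` below the unit
     scale, `g_j⁻² ≍ a + b·d·log L`, so `Σ_j e^{−p₀(g_j)} = Σ_d exp(−A₀(log(a + b d log L))^{p₀})` converges iff `p₀ ≥ 2`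
     or (`p₀ = 1` and `A₀ > 1`) and is dominated by its `d = 0` term `e^{−p₀(g_unit)}` — small in the small-coupling
     regime; a BetaPertH/(B)-dependent remark.  NOT PRINTED, NOT PROVED.
(MI-F2′) [v9 CORRECTION of the descriptive reading in (MI-F2)]  The events «the level-`j` block over `c` is irregular»
     are NOT dominated by products across levels: a large-field region created at level `h` PERSISTS — it keeps every
     block containing it irregular — until ℝ integrates it, i.e. for its LIFETIME (`≥` the printed waiting rule of
     CITATION (iii) p. 177 (ii), and longer only at the price of further creations inside it), so
     `μ(A_{j} ∩ A_{j'}) ≈ ε`, not `ε²`, for `|j − j'| <` lifetime.  The correct instantiation of §5c is with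
     `A i j` := the ELEMENTARY CREATION events («a large-field region is created at (level, place) `j`» for the finitely
     many pairs `j` within reach of slot `i`'s nested boxes), which ARE the objects the printed inductive bounds weight by
     independent suppression factors (distinct regions ⇒ product of factors — the located product domination `hdom`,
     COND (B), NOT re-read), together with the count inequality `irr ≤ Σ_{regions} lifetime ≤ N_life · #{creations}`, so
     that `κ^{irr} ≤ (κ^{N_life})^{#{j : ω ∈ A i j}}` and `integral_pow_card_filter_le_exp` /
     `integral_mul_exp_le_uniform_of_nesting(_add)` apply with `κ^{N_life}` in place of `κ` (a lifetime with a geometric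
     tail beyond `N_life` is handled by splitting creations by lifetime class, each class its own family of events with
     `ε` shrunk by the tail — bookkeeping, not done here).  `Σ_j ε i j ≤ E`: at level `j'` only regions created at levels
     `> j' − N_life` persist, each nested box holds boundedly many level-`j'` cubes, so `E ≲ N_life·L^{4N_life}·Σ_{j'} ε_{j'}`
     — level-summable as in (MI-F2).  With this reading (MI-F2) stands; its sentence «`μ{blocks … all irregular} ≲ ∏ ε`»
     is withdrawn.
(MI-3) the mean channel (A2).  With (MI-F1)+(MI-F2)+(A3) [kernel `integral_mul_exp_le_uniform_of_slots` /
`integral_mul_exp_le_uniform_of_nesting`, `integral_mul_exp_mean_le`, `ne1p_sqRate_lt_one`]: `∫ g e^{th} ≤ ∫ g e^{tf} ≤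
e^{t²B}∫ g e^{th} + e^{|t|R}‖g‖_∞B⁻¹N₀AC_q(L⁻²)`, every `B > 0`, `|t|·2R ≤ 1` — NE1′-size in this organisation.  What a
closing seat must still supply, in the binders of `integral_mul_exp_le_uniform_of_nesting(_add)`: `hVdom` (= (MI-F1):
the squared nesting-regularity radius dominates the proxy a.e. — NE1a on the printed restricted domain + composition
through the nested levels; locality and T-blocks in the additive term `U` with its first-moment budget `hU`) and
`hdom`/`hE` (= (MI-F2): product domination of multi-level irregularity with level-summable `ε`), both under the
undressed law `μ` of the printed chain ((A3)); plus (MI-3).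
-/

noncomputable section

open MeasureTheory Finset
open scoped BigOperators

namespace Literature.MathematicalPhysics.QuantumFieldTheory.Balaban1983to89.T4PathwiseCoupling

open Literature.MathematicalPhysics.QuantumFieldTheory.Balaban1983to89.T4MeanChannel
  (integrable_of_ae_abs_le integrable_sq_of_ae_abs_le integral_mul_eq_integral_mul_condExp ae_abs_condExp_le
    incr incr_apply stronglyMeasurable_incr condExp_incr_ae_eq_zero condExp_eq_condExp_add_sum_incr)
open Literature.MathematicalPhysics.QuantumFieldTheory.Balaban1983to89.T4MomentMayerStep
  (exp_le_cosh_add_mul_sinh_div one_add_le_exp)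
open Literature.MathematicalPhysics.QuantumFieldTheory.Balaban1983to89.T4TubeBudget
  (geomPolyConst geomPolyConst_nonneg succ_pow_mul_geom_le)

/-! ## §1  One-step conditional Hoeffding lemma (chord form) -/

section OneStep

variable {Ω : Type*} {mΩ : MeasurableSpace Ω} {μ : Measure Ω} [IsFiniteMeasure μ]

omit [IsFiniteMeasure μ] in
/-- [folklore] `exp (t·Y)` is a.e.-strongly measurable with `Y`. -/
theorem aestronglyMeasurable_exp_mul {Y : Ω → ℝ} (hYm : AEStronglyMeasurable Y μ) (t : ℝ) :
    AEStronglyMeasurable (fun ω => Real.exp (t * Y ω)) μ :=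
  Real.continuous_exp.comp_aestronglyMeasurable (hYm.const_mul t)

omit [IsFiniteMeasure μ] in
/-- [folklore] An a.e. bound `|Y| ≤ σ` gives `|exp (t·Y)| ≤ exp (|t|·σ)` a.e. -/
theorem ae_abs_exp_mul_le {Y : Ω → ℝ} {σ : ℝ} (hYb : ∀ᵐ ω ∂μ, |Y ω| ≤ σ) (t : ℝ) :
    ∀ᵐ ω ∂μ, |Real.exp (t * Y ω)| ≤ Real.exp (|t| * σ) := by
  filter_upwards [hYb] with ω hω
  rw [abs_of_pos (Real.exp_pos _), Real.exp_le_exp]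
  calc t * Y ω ≤ |t * Y ω| := le_abs_self _
    _ = |t| * |Y ω| := abs_mul t (Y ω)
    _ ≤ |t| * σ := mul_le_mul_of_nonneg_left hω (abs_nonneg t)

/-- [folklore] … hence `exp (t·Y)` is integrable on a finite measure space. -/
theorem integrable_exp_mul_of_ae_abs_le {Y : Ω → ℝ} (hYm : AEStronglyMeasurable Y μ) {σ : ℝ}
    (hYb : ∀ᵐ ω ∂μ, |Y ω| ≤ σ) (t : ℝ) : Integrable (fun ω => Real.exp (t * Y ω)) μ :=
  integrable_of_ae_abs_le (aestronglyMeasurable_exp_mul hYm t) (ae_abs_exp_mul_le hYb t)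

/-- [folklore] **ONE-STEP CONDITIONAL HOEFFDING LEMMA (upper).**  If `|Y| ≤ σ` a.e. and `Y` is conditionally centred
given `m`, then `μ[exp(t·Y) ∣ m] ≤ exp(t²σ²/2)` a.e.  Proof: Hoeffding's chord `eˣ ≤ cosh s + x·(sinh s/s)` on
`|x| ≤ s = |t|σ` is affine in `x`, so it passes through the conditional expectation, and `cosh s ≤ exp(s²/2)`. -/
theorem condExp_exp_mul_le_of_condCentred {Y : Ω → ℝ} (hYm : AEStronglyMeasurable Y μ)
    {σ : ℝ} (hYb : ∀ᵐ ω ∂μ, |Y ω| ≤ σ) {m : MeasurableSpace Ω} (hm : m ≤ mΩ)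
    (hYc : μ[Y | m] =ᵐ[μ] 0) (t : ℝ) :
    μ[fun ω => Real.exp (t * Y ω) | m] ≤ᵐ[μ] fun _ => Real.exp (t ^ 2 * σ ^ 2 / 2) := by
  set s : ℝ := |t| * σ with hs
  set c : ℝ := Real.sinh s / s * t with hc
  have hYi : Integrable Y μ := integrable_of_ae_abs_le hYm hYb
  -- the chord, written as an affine function of `Y`
  have hchord : (fun ω => Real.exp (t * Y ω)) ≤ᵐ[μ] (fun _ => Real.cosh s) + c • Y := by
    filter_upwards [hYb] with ω hω
    have h1 : |t * Y ω| ≤ s := by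
      rw [hs, abs_mul]; exact mul_le_mul_of_nonneg_left hω (abs_nonneg t)
    have h2 := exp_le_cosh_add_mul_sinh_div h1
    simp only [Pi.add_apply, Pi.smul_apply, smul_eq_mul, hc]
    calc Real.exp (t * Y ω) ≤ Real.cosh s + t * Y ω * (Real.sinh s / s) := h2
      _ = Real.cosh s + Real.sinh s / s * t * Y ω := by ring
  have hlin_int : Integrable ((fun _ => Real.cosh s) + c • Y) μ :=
    (integrable_const _).add (hYi.smul c)
  have hmono := condExp_mono (m := m) (integrable_exp_mul_of_ae_abs_le hYm hYb t) hlin_int hchord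
  have hadd := condExp_add (integrable_const (Real.cosh s)) (hYi.smul c) m
  have hsmul := condExp_smul (μ := μ) c Y m
  have hcosh : Real.cosh s ≤ Real.exp (t ^ 2 * σ ^ 2 / 2) := by
    have h := Real.cosh_le_exp_half_sq s
    have e : s ^ 2 / 2 = t ^ 2 * σ ^ 2 / 2 := by rw [hs, mul_pow, sq_abs]
    rwa [e] at h
  filter_upwards [hmono, hadd, hsmul, hYc] with ω h1 h2 h3 h4
  calc μ[fun ω => Real.exp (t * Y ω) | m] ω ≤ μ[(fun _ => Real.cosh s) + c • Y | m] ω := h1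
    _ = Real.cosh s + c * μ[Y | m] ω := by
        rw [h2, Pi.add_apply, h3, Pi.smul_apply, smul_eq_mul, condExp_const hm (Real.cosh s)]
    _ = Real.cosh s := by rw [h4, Pi.zero_apply, mul_zero, add_zero]
    _ ≤ Real.exp (t ^ 2 * σ ^ 2 / 2) := hcosh

/-- [folklore] **ONE-STEP CONDITIONAL HOEFFDING LEMMA (lower, = conditional Jensen through the tangent).**
`|Y| ≤ σ` a.e. and `μ[Y ∣ m] = 0` a.e. ⇒ `1 ≤ μ[exp(t·Y) ∣ m]` a.e. (from `1 + x ≤ eˣ`). -/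
theorem one_le_condExp_exp_mul_of_condCentred {Y : Ω → ℝ} (hYm : AEStronglyMeasurable Y μ)
    {σ : ℝ} (hYb : ∀ᵐ ω ∂μ, |Y ω| ≤ σ) {m : MeasurableSpace Ω} (hm : m ≤ mΩ)
    (hYc : μ[Y | m] =ᵐ[μ] 0) (t : ℝ) :
    (fun _ => (1 : ℝ)) ≤ᵐ[μ] μ[fun ω => Real.exp (t * Y ω) | m] := by
  have hYi : Integrable Y μ := integrable_of_ae_abs_le hYm hYb
  have htan : (fun _ => (1 : ℝ)) + t • Y ≤ᵐ[μ] fun ω => Real.exp (t * Y ω) :=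
    ae_of_all μ fun ω => by
      simp only [Pi.add_apply, Pi.smul_apply, smul_eq_mul]
      exact one_add_le_exp (t * Y ω)
  have hmono := condExp_mono (m := m) ((integrable_const (1 : ℝ)).add (hYi.smul t))
    (integrable_exp_mul_of_ae_abs_le hYm hYb t) htan
  have hadd := condExp_add (integrable_const (1 : ℝ)) (hYi.smul t) m
  have hsmul := condExp_smul (μ := μ) t Y m
  filter_upwards [hmono, hadd, hsmul, hYc] with ω h1 h2 h3 h4
  calc (1 : ℝ) = μ[(fun _ => (1 : ℝ)) + t • Y | m] ω := by
        rw [h2, Pi.add_apply, h3, Pi.smul_apply, smul_eq_mul, condExp_const hm (1 : ℝ), h4,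
          Pi.zero_apply, mul_zero, add_zero]
    _ ≤ μ[fun ω => Real.exp (t * Y ω) | m] ω := h1

/-- [folklore] **ONE-STEP CONDITIONAL BERNSTEIN-TYPE LEMMA (variance-proxy form).**  If `|Y| ≤ b` a.e., `Y` is
conditionally centred given `m` with conditional second moment `μ[Y² ∣ m] ≤ V` a.e. for some function `V` (in the
use: an `m`-measurable VARIANCE PROXY), and `|t|·b ≤ 1`, then `μ[exp(t·Y) ∣ m] ≤ exp(t²·V)` a.e.  Proof: on `|x| ≤ 1`,
`eˣ ≤ 1 + x + x²` (Mathlib `Real.abs_exp_sub_one_sub_id_le`), a quadratic that passes through the conditional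
expectation.  USE: the range `b` enters only through `|t|b ≤ 1`; the budget is the conditional VARIANCE, a
typical-field quantity under the one-step backward law — this is the form that tolerates increments whose
sup-oscillation is only the crude `2·sup|f|` (header (A1′)), and, with a RANDOM proxy, increments whose size depends on
the realised large-field geometry (header (A1″), §2 `condExp_exp_sum_sub_var_le_one`). -/
theorem condExp_exp_mul_le_exp_condVarProxy {Y : Ω → ℝ} (hYm : AEStronglyMeasurable Y μ) {b : ℝ}
    (hYb : ∀ᵐ ω ∂μ, |Y ω| ≤ b) {m : MeasurableSpace Ω} (hm : m ≤ mΩ) (hYc : μ[Y | m] =ᵐ[μ] 0) {V : Ω → ℝ}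
    (hYV : μ[fun ω => Y ω ^ 2 | m] ≤ᵐ[μ] V) {t : ℝ} (ht : |t| * b ≤ 1) :
    μ[fun ω => Real.exp (t * Y ω) | m] ≤ᵐ[μ] fun ω => Real.exp (t ^ 2 * V ω) := by
  have hYi : Integrable Y μ := integrable_of_ae_abs_le hYm hYb
  have hY2i : Integrable (fun ω => Y ω ^ 2) μ := integrable_sq_of_ae_abs_le hYm hYb
  -- the quadratic majorant, written as an affine-plus-square function of `Y`
  have hquad : (fun ω => Real.exp (t * Y ω)) ≤ᵐ[μ]
      (fun _ => (1 : ℝ)) + t • Y + (t ^ 2) • (fun ω => Y ω ^ 2) := by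
    filter_upwards [hYb] with ω hω
    have h1 : |t * Y ω| ≤ 1 := by
      rw [abs_mul]
      exact (mul_le_mul_of_nonneg_left hω (abs_nonneg t)).trans ht
    have h2 := (abs_le.mp (Real.abs_exp_sub_one_sub_id_le h1)).2
    simp only [Pi.add_apply, Pi.smul_apply, smul_eq_mul]
    have e : (t * Y ω) ^ 2 = t ^ 2 * Y ω ^ 2 := by ring
    linarith [h2, e]
  have hlin_int : Integrable ((fun _ => (1 : ℝ)) + t • Y + (t ^ 2) • (fun ω => Y ω ^ 2)) μ :=
    ((integrable_const _).add (hYi.smul t)).add (hY2i.smul (t ^ 2))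
  have hmono := condExp_mono (m := m) (integrable_exp_mul_of_ae_abs_le hYm hYb t) hlin_int hquad
  have hadd1 := condExp_add ((integrable_const (1 : ℝ)).add (hYi.smul t)) (hY2i.smul (t ^ 2)) m
  have hadd2 := condExp_add (integrable_const (1 : ℝ)) (hYi.smul t) m
  have hsm1 := condExp_smul (μ := μ) t Y m
  have hsm2 := condExp_smul (μ := μ) (t ^ 2) (fun ω => Y ω ^ 2) m
  filter_upwards [hmono, hadd1, hadd2, hsm1, hsm2, hYc, hYV] with ω h1 h2 h3 h4 h5 h6 h7
  have ht2 : 0 ≤ t ^ 2 := sq_nonneg t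
  calc μ[fun ω => Real.exp (t * Y ω) | m] ω
      ≤ μ[(fun _ => (1 : ℝ)) + t • Y + (t ^ 2) • (fun ω => Y ω ^ 2) | m] ω := h1
    _ = 1 + t * μ[Y | m] ω + t ^ 2 * μ[fun ω => Y ω ^ 2 | m] ω := by
        rw [h2, Pi.add_apply, h3, Pi.add_apply, h4, h5, Pi.smul_apply, Pi.smul_apply, smul_eq_mul,
          smul_eq_mul, condExp_const hm (1 : ℝ)]
    _ ≤ 1 + t ^ 2 * V ω := by
        rw [h6, Pi.zero_apply, mul_zero, add_zero]
        have := mul_le_mul_of_nonneg_left h7 ht2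
        linarith
    _ ≤ Real.exp (t ^ 2 * V ω) := by have := Real.add_one_le_exp (t ^ 2 * V ω); linarith

/-- [folklore] The same with a CONSTANT variance bound `v`: `μ[Y²∣m] ≤ v` a.e., `|t|·b ≤ 1` ⇒
`μ[exp(t·Y) ∣ m] ≤ exp(t²·v)` a.e. -/
theorem condExp_exp_mul_le_of_condVar {Y : Ω → ℝ} (hYm : AEStronglyMeasurable Y μ) {b : ℝ}
    (hYb : ∀ᵐ ω ∂μ, |Y ω| ≤ b) {m : MeasurableSpace Ω} (hm : m ≤ mΩ) (hYc : μ[Y | m] =ᵐ[μ] 0) {v : ℝ}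
    (hYv : μ[fun ω => Y ω ^ 2 | m] ≤ᵐ[μ] fun _ => v) {t : ℝ} (ht : |t| * b ≤ 1) :
    μ[fun ω => Real.exp (t * Y ω) | m] ≤ᵐ[μ] fun _ => Real.exp (t ^ 2 * v) :=
  condExp_exp_mul_le_exp_condVarProxy hYm hYb hm hYc hYv ht

end OneStep

/-! ## §2  Conditional Azuma–Hoeffding along an antitone filtration -/

section Azuma

variable {Ω : Type*} {mΩ : MeasurableSpace Ω} {μ : Measure Ω} [IsFiniteMeasure μ]

omit [IsFiniteMeasure μ] in
/-- [folklore] A finite family of a.e. bounds holds simultaneously a.e.; hence the a.e. bound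
`|Σ_{i<n} S i| ≤ Σ_{i<n} σ i`. -/
theorem ae_abs_sum_le {S : ℕ → Ω → ℝ} {σ : ℕ → ℝ} {n : ℕ} (hSb : ∀ i < n, ∀ᵐ ω ∂μ, |S i ω| ≤ σ i) :
    ∀ᵐ ω ∂μ, |∑ i ∈ range n, S i ω| ≤ ∑ i ∈ range n, σ i := by
  have hall : ∀ᵐ ω ∂μ, ∀ i ∈ range n, |S i ω| ≤ σ i :=
    (Filter.eventually_all_finset (range n)).mpr fun i hi => hSb i (mem_range.mp hi)
  filter_upwards [hall] with ω hω
  exact (abs_sum_le_sum_abs _ _).trans (sum_le_sum hω)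

/-- [folklore] **PRODUCT LEMMA along an antitone filtration.**  Along `F 0 ⊇ F 1 ⊇ … ⊇ F n` let `S i` (i < n) be
`F i`-measurable and a.e. bounded, and suppose the ONE-STEP conditional exponential moments are sandwiched:
`1 ≤ μ[exp(t·S i) ∣ F (i+1)] ≤ c i` a.e.  Then, a.e., `1 ≤ μ[exp(t·Σ_{i<n} S i) ∣ F n] ≤ ∏_{i<n} c i`.
Proof: peel `S 0` under `μ[· ∣ F 1]` (the other summands are `F 1`-measurable and pull out,
`condExp_stronglyMeasurable_mul_of_bound`), tower down to `F n` (`condExp_condExp_of_le`), induct on the shifted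
filtration `i ↦ F (i+1)`.  The two instances below feed it the Hoeffding (chord) and the Bernstein (variance)
one-step bounds of §1. -/
theorem condExp_exp_sum_prod_sandwich {F : ℕ → MeasurableSpace Ω} (hF : Antitone F) (hFle : ∀ j, F j ≤ mΩ)
    (n : ℕ) {S : ℕ → Ω → ℝ} {σ c : ℕ → ℝ} {t : ℝ} (hSm : ∀ i < n, StronglyMeasurable[F i] (S i))
    (hSb : ∀ i < n, ∀ᵐ ω ∂μ, |S i ω| ≤ σ i)
    (hlo : ∀ i < n, (fun _ => (1 : ℝ)) ≤ᵐ[μ] μ[fun ω => Real.exp (t * S i ω) | F (i + 1)])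
    (hhi : ∀ i < n, μ[fun ω => Real.exp (t * S i ω) | F (i + 1)] ≤ᵐ[μ] fun _ => c i) :
    ((fun _ => (1 : ℝ)) ≤ᵐ[μ] μ[fun ω => Real.exp (t * ∑ i ∈ range n, S i ω) | F n]) ∧
      (μ[fun ω => Real.exp (t * ∑ i ∈ range n, S i ω) | F n] ≤ᵐ[μ] fun _ => ∏ i ∈ range n, c i) := by
  induction n generalizing F S σ c with
  | zero =>
    have h0 : (fun ω => Real.exp (t * ∑ i ∈ range 0, S i ω)) = fun _ => (1 : ℝ) := by
      funext ω; simp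
    rw [h0, condExp_const (hFle 0) (1 : ℝ)]
    refine ⟨ae_of_all μ fun _ => le_rfl, ae_of_all μ fun _ => ?_⟩
    simp
  | succ n ih =>
    -- the shifted data
    have hF' : Antitone (fun i => F (i + 1)) := fun i j hij => hF (Nat.succ_le_succ hij)
    have hFle' : ∀ j, F (j + 1) ≤ mΩ := fun j => hFle (j + 1)
    have ih' := ih hF' hFle' (S := fun i => S (i + 1)) (σ := fun i => σ (i + 1)) (c := fun i => c (i + 1))
      (fun i hi => hSm (i + 1) (by omega)) (fun i hi => hSb (i + 1) (by omega))
      (fun i hi => hlo (i + 1) (by omega)) (fun i hi => hhi (i + 1) (by omega))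
    obtain ⟨ihlo, ihhi⟩ := ih'
    -- names
    set G : Ω → ℝ := fun ω => Real.exp (t * ∑ i ∈ range n, S (i + 1) ω) with hG
    set E : Ω → ℝ := fun ω => Real.exp (t * S 0 ω) with hE
    have hsplit : (fun ω => Real.exp (t * ∑ i ∈ range (n + 1), S i ω)) = G * E := by
      funext ω
      simp only [hG, hE, Pi.mul_apply, sum_range_succ', mul_add, Real.exp_add]
    -- measurability / integrability of the pieces
    have hF1n : F (n + 1) ≤ F 1 := hF (Nat.le_add_left 1 n)
    have hGm : StronglyMeasurable[F 1] G := by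
      have hsum : StronglyMeasurable[F 1] (fun ω => ∑ i ∈ range n, S (i + 1) ω) :=
        Finset.stronglyMeasurable_fun_sum (range n) fun i hi =>
          (hSm (i + 1) (by have := mem_range.mp hi; omega)).mono (hF (Nat.le_add_left 1 i))
      exact Real.continuous_exp.comp_stronglyMeasurable (hsum.const_mul t)
    have hGb : ∀ᵐ ω ∂μ, ‖G ω‖ ≤ Real.exp (|t| * ∑ i ∈ range n, σ (i + 1)) := by
      filter_upwards [ae_abs_exp_mul_le (ae_abs_sum_le (μ := μ) (n := n)
        (S := fun i => S (i + 1)) (σ := fun i => σ (i + 1)) fun i hi => hSb (i + 1) (by omega)) t]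
        with ω hω
      rw [Real.norm_eq_abs]; exact hω
    have hGnn : ∀ ω, 0 ≤ G ω := fun ω => (Real.exp_pos _).le
    have hGi : Integrable G μ :=
      integrable_of_ae_abs_le ((hGm.mono (hFle 1)).aestronglyMeasurable)
        (hGb.mono fun ω h => by rwa [Real.norm_eq_abs] at h)
    have hS0m : AEStronglyMeasurable (S 0) μ := ((hSm 0 (by omega)).mono (hFle 0)).aestronglyMeasurable
    have hS0b : ∀ᵐ ω ∂μ, |S 0 ω| ≤ σ 0 := hSb 0 (by omega)
    have hEi : Integrable E μ := integrable_exp_mul_of_ae_abs_le hS0m hS0b t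
    -- one-step bounds under `F 1`
    have hE_hi : μ[E | F 1] ≤ᵐ[μ] fun _ => c 0 := by simpa using hhi 0 (by omega)
    have hE_lo : (fun _ => (1 : ℝ)) ≤ᵐ[μ] μ[E | F 1] := by simpa using hlo 0 (by omega)
    -- pull `G` out under `F 1`, then tower down to `F (n+1)`
    haveI : SigmaFinite (μ.trim (hFle 1)) := inferInstance
    have hpull : μ[G * E | F 1] =ᵐ[μ] G * μ[E | F 1] :=
      condExp_stronglyMeasurable_mul_of_bound (hFle 1) hGm hEi _ hGb
    have htower : μ[μ[G * E | F 1] | F (n + 1)] =ᵐ[μ] μ[G * E | F (n + 1)] :=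
      condExp_condExp_of_le hF1n (hFle 1)
    have hcongr : μ[μ[G * E | F 1] | F (n + 1)] =ᵐ[μ] μ[G * μ[E | F 1] | F (n + 1)] :=
      condExp_congr_ae hpull
    -- integrability of `G * μ[E | F 1]` and of `c 0 • G`
    have hGEi : Integrable (G * μ[E | F 1]) μ := by
      have h := (integrable_condExp (m := F 1) (μ := μ) (f := E)).mul_bdd
        ((hGm.mono (hFle 1)).aestronglyMeasurable) hGb
      exact h.congr (ae_of_all μ fun ω => by simp only [Pi.mul_apply]; ring)
    have hcGi : Integrable (c 0 • G) μ := hGi.smul (c 0)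
    -- upper bound
    have hup1 : G * μ[E | F 1] ≤ᵐ[μ] c 0 • G := by
      filter_upwards [hE_hi] with ω hω
      simp only [Pi.mul_apply, Pi.smul_apply, smul_eq_mul]
      calc G ω * μ[E | F 1] ω ≤ G ω * c 0 := mul_le_mul_of_nonneg_left hω (hGnn ω)
        _ = c 0 * G ω := mul_comm _ _
    have hup2 := condExp_mono (m := F (n + 1)) hGEi hcGi hup1
    have hup3 := condExp_smul (μ := μ) (c 0) G (F (n + 1))
    -- lower bound
    have hlo1 : G ≤ᵐ[μ] G * μ[E | F 1] := by
      filter_upwards [hE_lo] with ω hω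
      simp only [Pi.mul_apply]
      calc G ω = G ω * 1 := (mul_one _).symm
        _ ≤ G ω * μ[E | F 1] ω := mul_le_mul_of_nonneg_left hω (hGnn ω)
    have hlo2 := condExp_mono (m := F (n + 1)) hGi hGEi hlo1
    rw [hsplit]
    constructor
    · filter_upwards [ihlo, hlo2, htower, hcongr] with ω h1 h2 h3 h4
      calc (1 : ℝ) ≤ μ[G | F (n + 1)] ω := h1
        _ ≤ μ[G * μ[E | F 1] | F (n + 1)] ω := h2
        _ = μ[G * E | F (n + 1)] ω := by rw [← h4, h3]
    · filter_upwards [ihhi, hup2, hup3, htower, hcongr, hE_lo, hE_hi] with ω h1 h2 h3 h4 h5 h6 h7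
      -- at this point `1 ≤ μ[E | F 1] ω ≤ c 0`, so `0 ≤ c 0`
      have hc0 : 0 ≤ c 0 := zero_le_one.trans (h6.trans h7)
      calc μ[G * E | F (n + 1)] ω = μ[G * μ[E | F 1] | F (n + 1)] ω := by rw [← h4, h5]
        _ ≤ μ[c 0 • G | F (n + 1)] ω := h2
        _ = c 0 * μ[G | F (n + 1)] ω := by rw [h3, Pi.smul_apply, smul_eq_mul]
        _ ≤ c 0 * ∏ i ∈ range n, c (i + 1) := mul_le_mul_of_nonneg_left h1 hc0
        _ = ∏ i ∈ range (n + 1), c i := by rw [prod_range_succ', mul_comm]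

/-- [folklore] **CONDITIONAL AZUMA–HOEFFDING INEQUALITY (sandwich form).**  Along an antitone filtration
`F 0 ⊇ F 1 ⊇ … ⊇ F n` of sub-σ-algebras, let `S i` (i < n) be `F i`-measurable, a.e. bounded by `σ i`, and
conditionally centred one level up (`μ[S i ∣ F (i+1)] = 0` a.e.).  Then, a.e.,
`1 ≤ μ[exp(t·Σ_{i<n} S i) ∣ F n] ≤ exp(t²·Σ_{i<n} σ_i²/2)` — the product lemma fed with the chord bound of §1. -/
theorem condExp_exp_sum_sandwich {F : ℕ → MeasurableSpace Ω} (hF : Antitone F) (hFle : ∀ j, F j ≤ mΩ)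
    (n : ℕ) {S : ℕ → Ω → ℝ} {σ : ℕ → ℝ} (hSm : ∀ i < n, StronglyMeasurable[F i] (S i))
    (hSb : ∀ i < n, ∀ᵐ ω ∂μ, |S i ω| ≤ σ i) (hSc : ∀ i < n, μ[S i | F (i + 1)] =ᵐ[μ] 0) (t : ℝ) :
    ((fun _ => (1 : ℝ)) ≤ᵐ[μ] μ[fun ω => Real.exp (t * ∑ i ∈ range n, S i ω) | F n]) ∧
      (μ[fun ω => Real.exp (t * ∑ i ∈ range n, S i ω) | F n] ≤ᵐ[μ]
        fun _ => Real.exp (t ^ 2 * (∑ i ∈ range n, σ i ^ 2) / 2)) := by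
  have hm : ∀ i < n, AEStronglyMeasurable (S i) μ :=
    fun i hi => ((hSm i hi).mono (hFle i)).aestronglyMeasurable
  obtain ⟨hlo, hhi⟩ := condExp_exp_sum_prod_sandwich (μ := μ) hF hFle n (t := t)
    (c := fun i => Real.exp (t ^ 2 * σ i ^ 2 / 2)) hSm hSb
    (fun i hi => one_le_condExp_exp_mul_of_condCentred (hm i hi) (hSb i hi) (hFle (i + 1)) (hSc i hi) t)
    (fun i hi => condExp_exp_mul_le_of_condCentred (hm i hi) (hSb i hi) (hFle (i + 1)) (hSc i hi) t)
  refine ⟨hlo, hhi.mono fun ω hω => hω.trans_eq ?_⟩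
  rw [← Real.exp_sum, ← sum_div, ← mul_sum]

/-- [folklore] **CONDITIONAL BERNSTEIN-TYPE INEQUALITY (variance form).**  Same setting, with the a.e. ranges
`|S i| ≤ σ i` used only through `|t|·σ i ≤ 1`, and conditional second moments `μ[(S i)² ∣ F (i+1)] ≤ v i` a.e.:
then, a.e., `1 ≤ μ[exp(t·Σ_{i<n} S i) ∣ F n] ≤ exp(t²·Σ_{i<n} v i)` — the product lemma fed with the variance
bound of §1.  This is the form whose budget `Σ v i` is a sum of conditional VARIANCES (header (A1′)). -/
theorem condExp_exp_sum_sandwich_of_condVar {F : ℕ → MeasurableSpace Ω} (hF : Antitone F)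
    (hFle : ∀ j, F j ≤ mΩ) (n : ℕ) {S : ℕ → Ω → ℝ} {σ v : ℕ → ℝ}
    (hSm : ∀ i < n, StronglyMeasurable[F i] (S i)) (hSb : ∀ i < n, ∀ᵐ ω ∂μ, |S i ω| ≤ σ i)
    (hSc : ∀ i < n, μ[S i | F (i + 1)] =ᵐ[μ] 0)
    (hSv : ∀ i < n, μ[fun ω => S i ω ^ 2 | F (i + 1)] ≤ᵐ[μ] fun _ => v i) {t : ℝ}
    (ht : ∀ i < n, |t| * σ i ≤ 1) :
    ((fun _ => (1 : ℝ)) ≤ᵐ[μ] μ[fun ω => Real.exp (t * ∑ i ∈ range n, S i ω) | F n]) ∧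
      (μ[fun ω => Real.exp (t * ∑ i ∈ range n, S i ω) | F n] ≤ᵐ[μ]
        fun _ => Real.exp (t ^ 2 * ∑ i ∈ range n, v i)) := by
  have hm : ∀ i < n, AEStronglyMeasurable (S i) μ :=
    fun i hi => ((hSm i hi).mono (hFle i)).aestronglyMeasurable
  obtain ⟨hlo, hhi⟩ := condExp_exp_sum_prod_sandwich (μ := μ) hF hFle n (t := t)
    (c := fun i => Real.exp (t ^ 2 * v i)) hSm hSb
    (fun i hi => one_le_condExp_exp_mul_of_condCentred (hm i hi) (hSb i hi) (hFle (i + 1)) (hSc i hi) t)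
    (fun i hi => condExp_exp_mul_le_of_condVar (hm i hi) (hSb i hi) (hFle (i + 1)) (hSc i hi) (hSv i hi)
      (ht i hi))
  refine ⟨hlo, hhi.mono fun ω hω => hω.trans_eq ?_⟩
  rw [← Real.exp_sum, ← mul_sum]

/-- [folklore] **FREEDMAN-TYPE SUPERMARTINGALE BOUND (random variance proxies).**  Along `F 0 ⊇ … ⊇ F n` let `S i`
be `F i`-measurable, `|S i| ≤ b` a.e., conditionally centred one level up, with PREDICTABLE variance proxies `V i`
(`F (i+1)`-measurable, a.e. bounded) dominating the conditional second moments, `μ[S_i² ∣ F (i+1)] ≤ V i` a.e., and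
`|t|·b ≤ 1`.  Then `μ[exp(t·Σ_{i<n} S i − t²·Σ_{i<n} V i) ∣ F n] ≤ 1` a.e.  (Peel `S 0`: under `μ[· ∣ F 1]` the factor
`exp(−t²V 0)` pulls out and cancels the one-step bound `exp(t²V 0)`; tower; induct on the shifted filtration.)  USE
(header (A1″)): the sizes of the cell's increments depend on the REALISED large-field geometry under the loop tube (a
component may be arbitrarily large); a predictable proxy books that geometry path by path, and the budget becomes an
event `{Σ V i ≤ B}` (next lemma) instead of a deterministic constant. -/
theorem condExp_exp_sum_sub_var_le_one {F : ℕ → MeasurableSpace Ω} (hF : Antitone F) (hFle : ∀ j, F j ≤ mΩ)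
    (n : ℕ) {S V : ℕ → Ω → ℝ} {b Vmax t : ℝ}
    (hSm : ∀ i < n, StronglyMeasurable[F i] (S i)) (hSb : ∀ i < n, ∀ᵐ ω ∂μ, |S i ω| ≤ b)
    (hSc : ∀ i < n, μ[S i | F (i + 1)] =ᵐ[μ] 0)
    (hVm : ∀ i < n, StronglyMeasurable[F (i + 1)] (V i)) (hVb : ∀ i < n, ∀ᵐ ω ∂μ, |V i ω| ≤ Vmax)
    (hSV : ∀ i < n, μ[fun ω => S i ω ^ 2 | F (i + 1)] ≤ᵐ[μ] V i) (ht : |t| * b ≤ 1) :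
    μ[fun ω => Real.exp (t * ∑ i ∈ range n, S i ω - t ^ 2 * ∑ i ∈ range n, V i ω) | F n] ≤ᵐ[μ]
      fun _ => (1 : ℝ) := by
  induction n generalizing F S V with
  | zero =>
    have h0 : (fun ω => Real.exp (t * ∑ i ∈ range 0, S i ω - t ^ 2 * ∑ i ∈ range 0, V i ω)) =
        fun _ => (1 : ℝ) := by
      funext ω; simp
    rw [h0, condExp_const (hFle 0) (1 : ℝ)]
  | succ n ih =>
    have hF' : Antitone (fun i => F (i + 1)) := fun i j hij => hF (Nat.succ_le_succ hij)
    have hFle' : ∀ j, F (j + 1) ≤ mΩ := fun j => hFle (j + 1)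
    have ih' := ih hF' hFle' (S := fun i => S (i + 1)) (V := fun i => V (i + 1))
      (fun i hi => hSm (i + 1) (by omega)) (fun i hi => hSb (i + 1) (by omega))
      (fun i hi => hSc (i + 1) (by omega)) (fun i hi => hVm (i + 1) (by omega))
      (fun i hi => hVb (i + 1) (by omega)) (fun i hi => hSV (i + 1) (by omega))
    -- names
    set G : Ω → ℝ := fun ω => Real.exp (t * ∑ i ∈ range n, S (i + 1) ω -
      t ^ 2 * ∑ i ∈ range n, V (i + 1) ω) with hG
    set D : Ω → ℝ := fun ω => Real.exp (-(t ^ 2 * V 0 ω)) with hD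
    set E : Ω → ℝ := fun ω => Real.exp (t * S 0 ω) with hE
    have hsplit : (fun ω => Real.exp (t * ∑ i ∈ range (n + 1), S i ω -
        t ^ 2 * ∑ i ∈ range (n + 1), V i ω)) = G * (D * E) := by
      funext ω
      simp only [hG, hD, hE, Pi.mul_apply, sum_range_succ']
      rw [← Real.exp_add, ← Real.exp_add]
      congr 1; ring
    have hF1n : F (n + 1) ≤ F 1 := hF (Nat.le_add_left 1 n)
    -- measurability
    have hGm : StronglyMeasurable[F 1] G := by
      have hsumS : StronglyMeasurable[F 1] (fun ω => ∑ i ∈ range n, S (i + 1) ω) :=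
        Finset.stronglyMeasurable_fun_sum (range n) fun i hi =>
          (hSm (i + 1) (by have := mem_range.mp hi; omega)).mono (hF (Nat.le_add_left 1 i))
      have hsumV : StronglyMeasurable[F 1] (fun ω => ∑ i ∈ range n, V (i + 1) ω) :=
        Finset.stronglyMeasurable_fun_sum (range n) fun i hi =>
          (hVm (i + 1) (by have := mem_range.mp hi; omega)).mono (hF (by omega))
      exact Real.continuous_exp.comp_stronglyMeasurable ((hsumS.const_mul t).sub (hsumV.const_mul (t ^ 2)))
    have hDm : StronglyMeasurable[F 1] D :=
      Real.continuous_exp.comp_stronglyMeasurable ((hVm 0 (by omega)).const_mul (t ^ 2)).neg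
    -- a.e. bounds
    have hSsum : ∀ᵐ ω ∂μ, |∑ i ∈ range n, S (i + 1) ω| ≤ ∑ i ∈ range n, b :=
      ae_abs_sum_le (μ := μ) (S := fun i => S (i + 1)) (σ := fun _ => b) fun i hi => hSb (i + 1) (by omega)
    have hVsum : ∀ᵐ ω ∂μ, |∑ i ∈ range n, V (i + 1) ω| ≤ ∑ i ∈ range n, Vmax :=
      ae_abs_sum_le (μ := μ) (S := fun i => V (i + 1)) (σ := fun _ => Vmax) fun i hi => hVb (i + 1) (by omega)
    set cG : ℝ := Real.exp (|t| * ∑ i ∈ range n, b + t ^ 2 * ∑ i ∈ range n, Vmax) with hcG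
    have hGb : ∀ᵐ ω ∂μ, ‖G ω‖ ≤ cG := by
      filter_upwards [hSsum, hVsum] with ω h1 h2
      rw [Real.norm_eq_abs, Real.abs_exp]
      refine Real.exp_le_exp.mpr ?_
      have h3 : t * ∑ i ∈ range n, S (i + 1) ω ≤ |t| * ∑ i ∈ range n, b := by
        calc t * ∑ i ∈ range n, S (i + 1) ω ≤ |t * ∑ i ∈ range n, S (i + 1) ω| := le_abs_self _
          _ = |t| * |∑ i ∈ range n, S (i + 1) ω| := abs_mul _ _
          _ ≤ |t| * ∑ i ∈ range n, b := mul_le_mul_of_nonneg_left h1 (abs_nonneg t)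
      have h4 : -(t ^ 2 * ∑ i ∈ range n, V (i + 1) ω) ≤ t ^ 2 * ∑ i ∈ range n, Vmax := by
        have := neg_abs_le (∑ i ∈ range n, V (i + 1) ω)
        nlinarith [sq_nonneg t, h2]
      linarith
    have hDb : ∀ᵐ ω ∂μ, ‖D ω‖ ≤ Real.exp (t ^ 2 * Vmax) := by
      filter_upwards [hVb 0 (by omega)] with ω hω
      rw [Real.norm_eq_abs, Real.abs_exp]
      refine Real.exp_le_exp.mpr ?_
      have := neg_abs_le (V 0 ω)
      nlinarith [sq_nonneg t, hω]
    have hGnn : ∀ ω, 0 ≤ G ω := fun ω => (Real.exp_pos _).le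
    have hDnn : ∀ ω, 0 ≤ D ω := fun ω => (Real.exp_pos _).le
    have hS0m : AEStronglyMeasurable (S 0) μ := ((hSm 0 (by omega)).mono (hFle 0)).aestronglyMeasurable
    have hS0b : ∀ᵐ ω ∂μ, |S 0 ω| ≤ b := hSb 0 (by omega)
    have hEi : Integrable E μ := integrable_exp_mul_of_ae_abs_le hS0m hS0b t
    have hDEi : Integrable (D * E) μ :=
      (hEi.bdd_mul ((hDm.mono (hFle 1)).aestronglyMeasurable) hDb)
    have hGi : Integrable G μ :=
      integrable_of_ae_abs_le ((hGm.mono (hFle 1)).aestronglyMeasurable)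
        (hGb.mono fun ω h => by rwa [Real.norm_eq_abs] at h)
    have hGDEi : Integrable (G * (D * E)) μ :=
      (hDEi.bdd_mul ((hGm.mono (hFle 1)).aestronglyMeasurable) hGb)
    haveI : SigmaFinite (μ.trim (hFle 1)) := inferInstance
    -- one step under `F 1`
    have hE1 : μ[E | F 1] ≤ᵐ[μ] fun ω => Real.exp (t ^ 2 * V 0 ω) :=
      condExp_exp_mul_le_exp_condVarProxy hS0m hS0b (hFle 1) (by simpa using hSc 0 (by omega))
        (hSV 0 (by omega)) ht
    have hpullD : μ[D * E | F 1] =ᵐ[μ] D * μ[E | F 1] :=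
      condExp_stronglyMeasurable_mul_of_bound (hFle 1) hDm hEi _ hDb
    have hDE_le : μ[D * E | F 1] ≤ᵐ[μ] fun _ => (1 : ℝ) := by
      filter_upwards [hpullD, hE1] with ω h1 h2
      rw [h1, Pi.mul_apply]
      calc D ω * μ[E | F 1] ω ≤ D ω * Real.exp (t ^ 2 * V 0 ω) := mul_le_mul_of_nonneg_left h2 (hDnn ω)
        _ = 1 := by rw [hD, ← Real.exp_add]; simp
    have hpullG : μ[G * (D * E) | F 1] =ᵐ[μ] G * μ[D * E | F 1] :=
      condExp_stronglyMeasurable_mul_of_bound (hFle 1) hGm hDEi _ hGb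
    have hstep : μ[G * (D * E) | F 1] ≤ᵐ[μ] G := by
      filter_upwards [hpullG, hDE_le] with ω h1 h2
      rw [h1, Pi.mul_apply]
      calc G ω * μ[D * E | F 1] ω ≤ G ω * 1 := mul_le_mul_of_nonneg_left h2 (hGnn ω)
        _ = G ω := mul_one _
    -- tower down to `F (n+1)` and use the induction hypothesis
    have htower : μ[μ[G * (D * E) | F 1] | F (n + 1)] =ᵐ[μ] μ[G * (D * E) | F (n + 1)] :=
      condExp_condExp_of_le hF1n (hFle 1)
    have hmono := condExp_mono (m := F (n + 1)) integrable_condExp hGi hstep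
    rw [hsplit]
    filter_upwards [htower, hmono, ih'] with ω h1 h2 h3
    calc μ[G * (D * E) | F (n + 1)] ω = μ[μ[G * (D * E) | F 1] | F (n + 1)] ω := by rw [h1]
      _ ≤ μ[G | F (n + 1)] ω := h2
      _ ≤ 1 := h3

/-- [folklore] **THE BUDGET AS AN EVENT.**  In the setting of `condExp_exp_sum_sub_var_le_one`, on the event
`{Σ_{i<n} V i ≤ B}` the exponential moment is controlled: `μ[1_{ΣV ≤ B}·exp(t·Σ_{i<n} S i) ∣ F n] ≤ exp(t²·B)` a.e. -/
theorem condExp_indicator_exp_sum_le {F : ℕ → MeasurableSpace Ω} (hF : Antitone F) (hFle : ∀ j, F j ≤ mΩ)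
    (n : ℕ) {S V : ℕ → Ω → ℝ} {b Vmax t : ℝ}
    (hSm : ∀ i < n, StronglyMeasurable[F i] (S i)) (hSb : ∀ i < n, ∀ᵐ ω ∂μ, |S i ω| ≤ b)
    (hSc : ∀ i < n, μ[S i | F (i + 1)] =ᵐ[μ] 0)
    (hVm : ∀ i < n, StronglyMeasurable[F (i + 1)] (V i)) (hVb : ∀ i < n, ∀ᵐ ω ∂μ, |V i ω| ≤ Vmax)
    (hSV : ∀ i < n, μ[fun ω => S i ω ^ 2 | F (i + 1)] ≤ᵐ[μ] V i) (ht : |t| * b ≤ 1) (B : ℝ) :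
    μ[Set.indicator {ω | ∑ i ∈ range n, V i ω ≤ B} (fun ω => Real.exp (t * ∑ i ∈ range n, S i ω)) | F n]
      ≤ᵐ[μ] fun _ => Real.exp (t ^ 2 * B) := by
  set A : Set Ω := {ω | ∑ i ∈ range n, V i ω ≤ B} with hA
  set X : Ω → ℝ := fun ω => Real.exp (t * ∑ i ∈ range n, S i ω) with hX
  set Y : Ω → ℝ := fun ω => Real.exp (t * ∑ i ∈ range n, S i ω - t ^ 2 * ∑ i ∈ range n, V i ω) with hY
  -- measurability / integrability
  have hsumSm : StronglyMeasurable (fun ω => ∑ i ∈ range n, S i ω) :=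
    Finset.stronglyMeasurable_fun_sum (range n) fun i hi => (hSm i (mem_range.mp hi)).mono (hFle i)
  have hsumVm : StronglyMeasurable (fun ω => ∑ i ∈ range n, V i ω) :=
    Finset.stronglyMeasurable_fun_sum (range n) fun i hi => (hVm i (mem_range.mp hi)).mono (hFle (i + 1))
  have hAm : MeasurableSet A := measurableSet_le hsumVm.measurable measurable_const
  have hXi : Integrable X μ :=
    integrable_exp_mul_of_ae_abs_le hsumSm.aestronglyMeasurable (ae_abs_sum_le hSb) t
  have hXAi : Integrable (A.indicator X) μ := hXi.indicator hAm
  have hSsum : ∀ᵐ ω ∂μ, |∑ i ∈ range n, S i ω| ≤ ∑ i ∈ range n, b := ae_abs_sum_le hSb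
  have hVsum : ∀ᵐ ω ∂μ, |∑ i ∈ range n, V i ω| ≤ ∑ i ∈ range n, Vmax := ae_abs_sum_le hVb
  have hYi : Integrable Y μ := by
    refine integrable_of_ae_abs_le ?_ (bu := Real.exp (|t| * ∑ i ∈ range n, b + t ^ 2 * ∑ i ∈ range n, Vmax)) ?_
    · exact (Real.continuous_exp.comp_stronglyMeasurable
        ((hsumSm.const_mul t).sub (hsumVm.const_mul (t ^ 2)))).aestronglyMeasurable
    · filter_upwards [hSsum, hVsum] with ω h1 h2
      rw [Real.abs_exp]
      refine Real.exp_le_exp.mpr ?_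
      have h3 : t * ∑ i ∈ range n, S i ω ≤ |t| * ∑ i ∈ range n, b := by
        calc t * ∑ i ∈ range n, S i ω ≤ |t * ∑ i ∈ range n, S i ω| := le_abs_self _
          _ = |t| * |∑ i ∈ range n, S i ω| := abs_mul _ _
          _ ≤ |t| * ∑ i ∈ range n, b := mul_le_mul_of_nonneg_left h1 (abs_nonneg t)
      have h4 : -(t ^ 2 * ∑ i ∈ range n, V i ω) ≤ t ^ 2 * ∑ i ∈ range n, Vmax := by
        have := neg_abs_le (∑ i ∈ range n, V i ω)
        nlinarith [sq_nonneg t, h2]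
      linarith
  -- pointwise domination `1_A · X ≤ exp(t²B) · Y`
  have hdom : A.indicator X ≤ᵐ[μ] Real.exp (t ^ 2 * B) • Y := by
    refine ae_of_all μ fun ω => ?_
    simp only [Pi.smul_apply, smul_eq_mul]
    by_cases hω : ω ∈ A
    · rw [Set.indicator_of_mem hω]
      have hle : t ^ 2 * ∑ i ∈ range n, V i ω ≤ t ^ 2 * B :=
        mul_le_mul_of_nonneg_left (by simpa [hA] using hω) (sq_nonneg t)
      calc X ω = Real.exp (t ^ 2 * ∑ i ∈ range n, V i ω) * Y ω := by
            rw [hX, hY, ← Real.exp_add]; ring_nf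
        _ ≤ Real.exp (t ^ 2 * B) * Y ω :=
            mul_le_mul_of_nonneg_right (Real.exp_le_exp.mpr hle) (Real.exp_pos _).le
    · rw [Set.indicator_of_notMem hω]
      exact mul_nonneg (Real.exp_pos _).le (Real.exp_pos _).le
  have hmono := condExp_mono (m := F n) hXAi (hYi.smul _) hdom
  have hsm := condExp_smul (μ := μ) (Real.exp (t ^ 2 * B)) Y (F n)
  have hle1 := condExp_exp_sum_sub_var_le_one (μ := μ) hF hFle n hSm hSb hSc hVm hVb hSV ht
  filter_upwards [hmono, hsm, hle1] with ω h1 h2 h3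
  calc μ[A.indicator X | F n] ω ≤ μ[Real.exp (t ^ 2 * B) • Y | F n] ω := h1
    _ = Real.exp (t ^ 2 * B) * μ[Y | F n] ω := by rw [h2, Pi.smul_apply, smul_eq_mul]
    _ ≤ Real.exp (t ^ 2 * B) * 1 := mul_le_mul_of_nonneg_left h3 (Real.exp_pos _).le
    _ = Real.exp (t ^ 2 * B) := mul_one _

end Azuma

/-! ## §3  The dressing factor `μ[exp(t f) ∣ F n]`: Doob decomposition and the sandwich (AZ) -/

section Dressing

variable {Ω : Type*} {mΩ : MeasurableSpace Ω} {μ : Measure Ω} [IsFiniteMeasure μ]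
  {F : ℕ → MeasurableSpace Ω}

/-- HYPOTHESIS SHAPE (A1)+(A3) (cell analysis, NOT PRINTED, NOT PROVED; a `Prop`, asserted nowhere) [folklore]: along
the (refined, antitone) filtration `F`
the Doob–Lévy increments of the initial dressing variable `f` are a.e. bounded, `|incr μ F f i| ≤ σ i` for `i < n`.
In the cell's use `i` runs over the ℝ-resampling events under the loop tube (one per large-field component, ordered
compatibly with the scales) and `σ i = c_i + ℓ_i` (oscillation + locality of conditional means, header (A1)). -/
def IncrementBound (μ : Measure Ω) (F : ℕ → MeasurableSpace Ω) (f : Ω → ℝ) (n : ℕ) (σ : ℕ → ℝ) : Prop :=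
  ∀ i < n, ∀ᵐ ω ∂μ, |incr μ F f i ω| ≤ σ i

/-- [folklore] The telescoping identity of `T4MeanChannel` (K14s) from level `0`: for an `F 0`-measurable bounded `f`,
`f = μ[f ∣ F n] + Σ_{i<n} incr μ F f i` pointwise (for the chosen versions). -/
theorem eq_condExp_add_sum_incr (hFle : ∀ j, F j ≤ mΩ) {f : Ω → ℝ} (hf0 : StronglyMeasurable[F 0] f)
    (hfi : Integrable f μ) (n : ℕ) (ω : Ω) :
    f ω = μ[f | F n] ω + ∑ i ∈ range n, incr μ F f i ω := by
  haveI : SigmaFinite (μ.trim (hFle 0)) := inferInstance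
  have h := condExp_eq_condExp_add_sum_incr (μ := μ) (F := F) f 0 n ω
  rw [condExp_of_stronglyMeasurable (hFle 0) hf0 hfi] at h
  simpa only [zero_add] using h

/-- HYPOTHESIS SHAPE (A1′) (cell analysis, NOT PRINTED, NOT PROVED; a `Prop`, asserted nowhere) [folklore]: the
conditional VARIANCES of the Doob–Lévy increments are bounded, `μ[(incr μ F f i)² ∣ F (i+1)] ≤ v i` a.e. for
`i < n`.  In the cell's use `v i` is a second moment under the ONE-STEP BACKWARD LAW of the erased variables (a
typical-field quantity, weighted by the actual density), whereas `IncrementBound` asks for a sup over their support. -/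
def IncrementVarBound (μ : Measure Ω) (F : ℕ → MeasurableSpace Ω) (f : Ω → ℝ) (n : ℕ) (v : ℕ → ℝ) : Prop :=
  ∀ i < n, μ[fun ω => incr μ F f i ω ^ 2 | F (i + 1)] ≤ᵐ[μ] fun _ => v i

omit [IsFiniteMeasure μ] in
/-- [folklore] The CRUDE range of the increments: `|f| ≤ R` ⇒ `IncrementBound μ F f n (fun _ => 2R)` (each increment
is a difference of two conditional expectations of `f`, `T4MeanChannel.ae_abs_condExp_le`).  With the variance
form below this is all the range control that is needed (`|t|·2R ≤ 1`). -/
theorem incrementBound_crude {f : Ω → ℝ} {R : ℝ} (hfR : ∀ ω, |f ω| ≤ R) (n : ℕ) :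
    IncrementBound μ F f n (fun _ => 2 * R) := by
  intro i _
  filter_upwards [ae_abs_condExp_le (μ := μ) (m := F i) hfR,
    ae_abs_condExp_le (μ := μ) (m := F (i + 1)) hfR] with ω h1 h2
  rw [incr_apply]
  calc |μ[f | F i] ω - μ[f | F (i + 1)] ω| ≤ |μ[f | F i] ω| + |μ[f | F (i + 1)] ω| := abs_sub _ _
    _ ≤ R + R := add_le_add h1 h2
    _ = 2 * R := by ring

/-- [folklore] **THE DRESSING FACTOR FROM AN INCREMENT SANDWICH.**  `f` bounded and `F 0`-measurable,
`IncrementBound μ F f n σ` (for integrability), and a.e. `1 ≤ μ[exp(t·Σ_{i<n} incr_i) ∣ F n] ≤ B` ⇒ a.e.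
`exp(t·μ[f∣F n]) ≤ μ[exp(t f) ∣ F n] ≤ exp(t·μ[f∣F n]) · B`: the Doob decomposition `f = μ[f∣F n] + Σ incr`
(`eq_condExp_add_sum_incr`) and the pull-out of the `F n`-measurable factor. -/
theorem condExp_exp_dressing_sandwich_of_incr (hF : Antitone F) (hFle : ∀ j, F j ≤ mΩ) {f : Ω → ℝ}
    (hf0 : StronglyMeasurable[F 0] f) {R : ℝ} (hfR : ∀ ω, |f ω| ≤ R) (n : ℕ) {σ : ℕ → ℝ}
    (hσ : IncrementBound μ F f n σ) {t B : ℝ}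
    (hlo : (fun _ => (1 : ℝ)) ≤ᵐ[μ] μ[fun ω => Real.exp (t * ∑ i ∈ range n, incr μ F f i ω) | F n])
    (hhi : μ[fun ω => Real.exp (t * ∑ i ∈ range n, incr μ F f i ω) | F n] ≤ᵐ[μ] fun _ => B) :
    ((fun ω => Real.exp (t * μ[f | F n] ω)) ≤ᵐ[μ] μ[fun ω => Real.exp (t * f ω) | F n]) ∧
      (μ[fun ω => Real.exp (t * f ω) | F n] ≤ᵐ[μ] fun ω => Real.exp (t * μ[f | F n] ω) * B) := by
  have hfi : Integrable f μ := integrable_of_ae_abs_le ((hf0.mono (hFle 0)).aestronglyMeasurable)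
    (ae_of_all μ hfR)
  -- Doob decomposition of the exponential
  set H : Ω → ℝ := fun ω => Real.exp (t * μ[f | F n] ω) with hH
  set G : Ω → ℝ := fun ω => Real.exp (t * ∑ i ∈ range n, incr μ F f i ω) with hG
  have hsplit : (fun ω => Real.exp (t * f ω)) = H * G := by
    funext ω
    rw [eq_condExp_add_sum_incr hFle hf0 hfi n ω]
    simp only [hH, hG, Pi.mul_apply, mul_add, Real.exp_add]
  -- pull the `F n`-measurable factor `H` out
  have hHm : StronglyMeasurable[F n] H :=
    Real.continuous_exp.comp_stronglyMeasurable
      ((stronglyMeasurable_condExp (m := F n) (μ := μ) (f := f)).const_mul t)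
  have hHb : ∀ᵐ ω ∂μ, ‖H ω‖ ≤ Real.exp (|t| * R) := by
    filter_upwards [ae_abs_exp_mul_le (ae_abs_condExp_le (μ := μ) (m := F n) hfR) t] with ω hω
    rw [Real.norm_eq_abs]; exact hω
  have hGi : Integrable G μ := by
    refine integrable_exp_mul_of_ae_abs_le ?_ (ae_abs_sum_le hσ) t
    exact (Finset.stronglyMeasurable_fun_sum (range n) fun i _ =>
      (stronglyMeasurable_incr (μ := μ) hF f i).mono (hFle i)).aestronglyMeasurable
  haveI : SigmaFinite (μ.trim (hFle n)) := inferInstance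
  have hpull : μ[H * G | F n] =ᵐ[μ] H * μ[G | F n] :=
    condExp_stronglyMeasurable_mul_of_bound (hFle n) hHm hGi _ hHb
  have hHnn : ∀ ω, 0 ≤ H ω := fun ω => (Real.exp_pos _).le
  rw [hsplit]
  constructor
  · filter_upwards [hpull, hlo] with ω h1 h2
    calc Real.exp (t * μ[f | F n] ω) = H ω * 1 := (mul_one _).symm
      _ ≤ H ω * μ[G | F n] ω := mul_le_mul_of_nonneg_left h2 (hHnn ω)
      _ = μ[H * G | F n] ω := by rw [h1, Pi.mul_apply]
  · filter_upwards [hpull, hhi] with ω h1 h2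
    calc μ[H * G | F n] ω = H ω * μ[G | F n] ω := by rw [h1, Pi.mul_apply]
      _ ≤ H ω * B := mul_le_mul_of_nonneg_left h2 (hHnn ω)

/-- [folklore] **THE SANDWICH (AZ) FOR THE DRESSING FACTOR (Hoeffding form).**  `f` bounded and `F 0`-measurable,
`F` antitone, `IncrementBound μ F f n σ` ⇒ a.e.
`exp(t·μ[f∣F n]) ≤ μ[exp(t f) ∣ F n] ≤ exp(t·μ[f∣F n]) · exp(t²Σ_{i<n}σ_i²/2)`.
The first-order (mean) channel `μ[f ∣ F n]` is ISOLATED, not estimated; the fluctuation channel costs `½t²Σσ²`. -/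
theorem condExp_exp_dressing_sandwich (hF : Antitone F) (hFle : ∀ j, F j ≤ mΩ) {f : Ω → ℝ}
    (hf0 : StronglyMeasurable[F 0] f) {R : ℝ} (hfR : ∀ ω, |f ω| ≤ R) (n : ℕ) {σ : ℕ → ℝ}
    (hσ : IncrementBound μ F f n σ) (t : ℝ) :
    ((fun ω => Real.exp (t * μ[f | F n] ω)) ≤ᵐ[μ] μ[fun ω => Real.exp (t * f ω) | F n]) ∧
      (μ[fun ω => Real.exp (t * f ω) | F n] ≤ᵐ[μ]
        fun ω => Real.exp (t * μ[f | F n] ω) * Real.exp (t ^ 2 * (∑ i ∈ range n, σ i ^ 2) / 2)) := by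
  obtain ⟨hlo, hhi⟩ := condExp_exp_sum_sandwich (μ := μ) hF hFle n (S := fun i => incr μ F f i) (σ := σ)
    (fun i _ => stronglyMeasurable_incr hF f i) hσ (fun i _ => condExp_incr_ae_eq_zero hF hFle f i) t
  exact condExp_exp_dressing_sandwich_of_incr hF hFle hf0 hfR n hσ hlo hhi

/-- [folklore] **THE SANDWICH FOR THE DRESSING FACTOR (variance form).**  `f` bounded by `R` and
`F 0`-measurable, `F` antitone, `IncrementVarBound μ F f n v` and `|t|·2R ≤ 1` ⇒ a.e.
`exp(t·μ[f∣F n]) ≤ μ[exp(t f) ∣ F n] ≤ exp(t·μ[f∣F n]) · exp(t²·Σ_{i<n} v i)`.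
No sup-oscillation input at all: the range of the increments is the crude `2R` (`incrementBound_crude`), the budget
is the sum of conditional variances `Σ v i`; the price is the restriction `|t| ≤ 1/(2R)` — harmless for a dressing
parameter in a fixed small disc. -/
theorem condExp_exp_dressing_sandwich_of_condVar (hF : Antitone F) (hFle : ∀ j, F j ≤ mΩ) {f : Ω → ℝ}
    (hf0 : StronglyMeasurable[F 0] f) {R : ℝ} (hfR : ∀ ω, |f ω| ≤ R) (n : ℕ) {v : ℕ → ℝ}
    (hv : IncrementVarBound μ F f n v) {t : ℝ} (ht : |t| * (2 * R) ≤ 1) :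
    ((fun ω => Real.exp (t * μ[f | F n] ω)) ≤ᵐ[μ] μ[fun ω => Real.exp (t * f ω) | F n]) ∧
      (μ[fun ω => Real.exp (t * f ω) | F n] ≤ᵐ[μ]
        fun ω => Real.exp (t * μ[f | F n] ω) * Real.exp (t ^ 2 * ∑ i ∈ range n, v i)) := by
  have hσ := incrementBound_crude (μ := μ) (F := F) hfR n
  obtain ⟨hlo, hhi⟩ := condExp_exp_sum_sandwich_of_condVar (μ := μ) hF hFle n
    (S := fun i => incr μ F f i) (σ := fun _ => 2 * R) (v := v)
    (fun i _ => stronglyMeasurable_incr hF f i) hσ (fun i _ => condExp_incr_ae_eq_zero hF hFle f i) hv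
    (fun _ _ => ht)
  exact condExp_exp_dressing_sandwich_of_incr hF hFle hf0 hfR n hσ hlo hhi

/-- HYPOTHESIS SHAPE (A1″) (cell analysis, NOT PRINTED, NOT PROVED; a `Prop`, asserted nowhere) [folklore]:
PREDICTABLE VARIANCE PROXIES for the Doob–Lévy increments — functions `V i`, measurable one level up (`F (i+1)`: in
the cell's use, functions of the realised large-field geometry of event `i`, which is part of the term label and hence
of the future), dominating the conditional second moments: `μ[(incr μ F f i)² ∣ F (i+1)] ≤ V i` a.e. for `i < n`. -/
def IncrementVarProxy (μ : Measure Ω) (F : ℕ → MeasurableSpace Ω) (f : Ω → ℝ) (n : ℕ) (V : ℕ → Ω → ℝ) : Prop :=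
  ∀ i < n, μ[fun ω => incr μ F f i ω ^ 2 | F (i + 1)] ≤ᵐ[μ] V i

/-- [folklore] **THE DRESSING FACTOR ON THE GOOD-GEOMETRY EVENT.**  `f` bounded by `R` and `F 0`-measurable, `F`
antitone, predictable a.e.-bounded variance proxies `V i` (`IncrementVarProxy`), `|t|·2R ≤ 1` ⇒ a.e.
`μ[1_{Σ_{i<n} V i ≤ B} · exp(t f) ∣ F n] ≤ exp(t·μ[f∣F n]) · exp(t²·B)`.
The budget is no longer a constant but the EVENT `{Σ V i ≤ B}` ("no giant old components under the tube", header
(A1″)); its complement is charged crudely by the next lemma. -/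
theorem condExp_indicator_exp_dressing_le (hF : Antitone F) (hFle : ∀ j, F j ≤ mΩ) {f : Ω → ℝ}
    (hf0 : StronglyMeasurable[F 0] f) {R : ℝ} (hfR : ∀ ω, |f ω| ≤ R) (n : ℕ) {V : ℕ → Ω → ℝ} {Vmax : ℝ}
    (hVm : ∀ i < n, StronglyMeasurable[F (i + 1)] (V i)) (hVb : ∀ i < n, ∀ᵐ ω ∂μ, |V i ω| ≤ Vmax)
    (hV : IncrementVarProxy μ F f n V) {t : ℝ} (ht : |t| * (2 * R) ≤ 1) (B : ℝ) :
    μ[Set.indicator {ω | ∑ i ∈ range n, V i ω ≤ B} (fun ω => Real.exp (t * f ω)) | F n] ≤ᵐ[μ]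
      fun ω => Real.exp (t * μ[f | F n] ω) * Real.exp (t ^ 2 * B) := by
  have hfi : Integrable f μ := integrable_of_ae_abs_le ((hf0.mono (hFle 0)).aestronglyMeasurable)
    (ae_of_all μ hfR)
  have hσ := incrementBound_crude (μ := μ) (F := F) hfR n
  set A : Set Ω := {ω | ∑ i ∈ range n, V i ω ≤ B} with hA
  set H : Ω → ℝ := fun ω => Real.exp (t * μ[f | F n] ω) with hH
  set X : Ω → ℝ := fun ω => Real.exp (t * ∑ i ∈ range n, incr μ F f i ω) with hX
  have hsplit : A.indicator (fun ω => Real.exp (t * f ω)) = H * A.indicator X := by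
    funext ω
    by_cases hω : ω ∈ A
    · rw [Set.indicator_of_mem hω, Pi.mul_apply, Set.indicator_of_mem hω,
        eq_condExp_add_sum_incr hFle hf0 hfi n ω]
      simp only [hH, hX, mul_add, Real.exp_add]
    · rw [Set.indicator_of_notMem hω, Pi.mul_apply, Set.indicator_of_notMem hω, mul_zero]
  -- the event bound for the increments
  have hev := condExp_indicator_exp_sum_le (μ := μ) hF hFle n (S := fun i => incr μ F f i)
    (b := 2 * R) (V := V) (t := t) (fun i _ => stronglyMeasurable_incr hF f i) (fun i hi => hσ i hi)
    (fun i _ => condExp_incr_ae_eq_zero hF hFle f i) hVm hVb hV ht B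
  -- pull `H` out
  have hHm : StronglyMeasurable[F n] H :=
    Real.continuous_exp.comp_stronglyMeasurable
      ((stronglyMeasurable_condExp (m := F n) (μ := μ) (f := f)).const_mul t)
  have hHb : ∀ᵐ ω ∂μ, ‖H ω‖ ≤ Real.exp (|t| * R) := by
    filter_upwards [ae_abs_exp_mul_le (ae_abs_condExp_le (μ := μ) (m := F n) hfR) t] with ω hω
    rw [Real.norm_eq_abs]; exact hω
  have hsumVm : StronglyMeasurable (fun ω => ∑ i ∈ range n, V i ω) :=
    Finset.stronglyMeasurable_fun_sum (range n) fun i hi => (hVm i (mem_range.mp hi)).mono (hFle (i + 1))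
  have hAm : MeasurableSet A := measurableSet_le hsumVm.measurable measurable_const
  have hXi : Integrable X μ := by
    refine integrable_exp_mul_of_ae_abs_le ?_ (ae_abs_sum_le hσ) t
    exact (Finset.stronglyMeasurable_fun_sum (range n) fun i _ =>
      (stronglyMeasurable_incr (μ := μ) hF f i).mono (hFle i)).aestronglyMeasurable
  have hXAi : Integrable (A.indicator X) μ := hXi.indicator hAm
  haveI : SigmaFinite (μ.trim (hFle n)) := inferInstance
  have hpull : μ[H * A.indicator X | F n] =ᵐ[μ] H * μ[A.indicator X | F n] :=
    condExp_stronglyMeasurable_mul_of_bound (hFle n) hHm hXAi _ hHb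
  have hHnn : ∀ ω, 0 ≤ H ω := fun ω => (Real.exp_pos _).le
  rw [hsplit]
  filter_upwards [hpull, hev] with ω h1 h2
  calc μ[H * A.indicator X | F n] ω = H ω * μ[A.indicator X | F n] ω := by rw [h1, Pi.mul_apply]
    _ ≤ H ω * Real.exp (t ^ 2 * B) := mul_le_mul_of_nonneg_left h2 (hHnn ω)

omit [IsFiniteMeasure μ] in
/-- [folklore] **THE BAD-GEOMETRY EVENT, crude charge.**  `|f| ≤ R` ⇒ a.e.
`μ[1_{B < Σ V i} · exp(t f) ∣ F n] ≤ exp(|t|R) · μ[1_{B < Σ V i} ∣ F n]` — the complement of the budget event costs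
its conditional probability times the crude factor; in the cell's use that probability is where the PRINTED
large-field suppression (`e^{−p₀}` per cube, B13 (2.30) as read in T4-DAG O3a) enters, and nowhere else. -/
theorem condExp_indicator_compl_exp_dressing_le [IsFiniteMeasure μ] (hFle : ∀ j, F j ≤ mΩ) {f : Ω → ℝ}
    (hfm : AEStronglyMeasurable f μ) {R : ℝ} (hfR : ∀ ω, |f ω| ≤ R) (n : ℕ) {V : ℕ → Ω → ℝ}
    (hVm : ∀ i < n, StronglyMeasurable[F (i + 1)] (V i)) (t B : ℝ) :
    μ[Set.indicator {ω | B < ∑ i ∈ range n, V i ω} (fun ω => Real.exp (t * f ω)) | F n] ≤ᵐ[μ]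
      fun ω => Real.exp (|t| * R) *
        μ[Set.indicator {ω | B < ∑ i ∈ range n, V i ω} (fun _ => (1 : ℝ)) | F n] ω := by
  set Ac : Set Ω := {ω | B < ∑ i ∈ range n, V i ω} with hAc
  have hsumVm : StronglyMeasurable (fun ω => ∑ i ∈ range n, V i ω) :=
    Finset.stronglyMeasurable_fun_sum (range n) fun i hi => (hVm i (mem_range.mp hi)).mono (hFle (i + 1))
  have hAcm : MeasurableSet Ac := measurableSet_lt measurable_const hsumVm.measurable
  have hEi : Integrable (fun ω => Real.exp (t * f ω)) μ := integrable_exp_mul_of_ae_abs_le hfm (ae_of_all μ hfR) t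
  have h1i : Integrable (Ac.indicator fun _ => (1 : ℝ)) μ := (integrable_const (1 : ℝ)).indicator hAcm
  have hdom : Ac.indicator (fun ω => Real.exp (t * f ω)) ≤ᵐ[μ]
      Real.exp (|t| * R) • Ac.indicator (fun _ => (1 : ℝ)) := by
    refine ae_of_all μ fun ω => ?_
    simp only [Pi.smul_apply, smul_eq_mul]
    by_cases hω : ω ∈ Ac
    · rw [Set.indicator_of_mem hω, Set.indicator_of_mem hω, mul_one]
      refine Real.exp_le_exp.mpr ((le_abs_self _).trans ?_)
      rw [abs_mul]; exact mul_le_mul_of_nonneg_left (hfR ω) (abs_nonneg t)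
    · rw [Set.indicator_of_notMem hω, Set.indicator_of_notMem hω, mul_zero]
  have hmono := condExp_mono (m := F n) (hEi.indicator hAcm) (h1i.smul _) hdom
  have hsm := condExp_smul (μ := μ) (Real.exp (|t| * R)) (Ac.indicator fun _ => (1 : ℝ)) (F n)
  filter_upwards [hmono, hsm] with ω h1 h2
  calc μ[Ac.indicator (fun ω => Real.exp (t * f ω)) | F n] ω
      ≤ μ[Real.exp (|t| * R) • Ac.indicator (fun _ => (1 : ℝ)) | F n] ω := h1
    _ = Real.exp (|t| * R) * μ[Ac.indicator (fun _ => (1 : ℝ)) | F n] ω := by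
        rw [h2, Pi.smul_apply, smul_eq_mul]

/-- [folklore] **THE DRESSING FACTOR WITH RANDOM GEOMETRY (assembled).**  Under `IncrementVarProxy μ F f n V` with
predictable a.e.-bounded proxies and `|t|·2R ≤ 1`, for every budget level `B`: a.e.
`exp(t·h) ≤ μ[exp(t f) ∣ F n] ≤ exp(t·h)·exp(t²B) + exp(|t|R)·μ[1_{B < ΣV} ∣ F n]`, `h = μ[f ∣ F n]`.
The first term is K-uniform as soon as `B` is (header (A1″): `B` = the affordable budget of tame geometries); the
second is (crude factor) × (conditional probability of a giant old component under the tube). -/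
theorem condExp_exp_dressing_sandwich_of_varProxy (hF : Antitone F) (hFle : ∀ j, F j ≤ mΩ) {f : Ω → ℝ}
    (hf0 : StronglyMeasurable[F 0] f) {R : ℝ} (hfR : ∀ ω, |f ω| ≤ R) (n : ℕ) {V : ℕ → Ω → ℝ} {Vmax : ℝ}
    (hVm : ∀ i < n, StronglyMeasurable[F (i + 1)] (V i)) (hVb : ∀ i < n, ∀ᵐ ω ∂μ, |V i ω| ≤ Vmax)
    (hV : IncrementVarProxy μ F f n V) {t : ℝ} (ht : |t| * (2 * R) ≤ 1) (B : ℝ) :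
    ((fun ω => Real.exp (t * μ[f | F n] ω)) ≤ᵐ[μ] μ[fun ω => Real.exp (t * f ω) | F n]) ∧
      (μ[fun ω => Real.exp (t * f ω) | F n] ≤ᵐ[μ] fun ω =>
        Real.exp (t * μ[f | F n] ω) * Real.exp (t ^ 2 * B) +
          Real.exp (|t| * R) * μ[Set.indicator {ω | B < ∑ i ∈ range n, V i ω} (fun _ => (1 : ℝ)) | F n] ω) := by
  have hfm : AEStronglyMeasurable f μ := (hf0.mono (hFle 0)).aestronglyMeasurable
  have hσ := incrementBound_crude (μ := μ) (F := F) hfR n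
  -- lower bound: the tangent half of (AZ) needs only centring and boundedness
  obtain ⟨hlo, -⟩ := condExp_exp_dressing_sandwich hF hFle hf0 hfR n hσ t
  refine ⟨hlo, ?_⟩
  -- upper bound: split along the budget event
  set A : Set Ω := {ω | ∑ i ∈ range n, V i ω ≤ B} with hA
  set Ac : Set Ω := {ω | B < ∑ i ∈ range n, V i ω} with hAc
  have hAc_eq : Ac = Aᶜ := by
    ext ω; simp [hA, hAc, not_le]
  have hsumVm : StronglyMeasurable (fun ω => ∑ i ∈ range n, V i ω) :=
    Finset.stronglyMeasurable_fun_sum (range n) fun i hi => (hVm i (mem_range.mp hi)).mono (hFle (i + 1))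
  have hAm : MeasurableSet A := measurableSet_le hsumVm.measurable measurable_const
  have hAcm : MeasurableSet Ac := measurableSet_lt measurable_const hsumVm.measurable
  have hEi : Integrable (fun ω => Real.exp (t * f ω)) μ := integrable_exp_mul_of_ae_abs_le hfm (ae_of_all μ hfR) t
  have hdecomp : (fun ω => Real.exp (t * f ω)) =
      A.indicator (fun ω => Real.exp (t * f ω)) + Ac.indicator (fun ω => Real.exp (t * f ω)) := by
    rw [hAc_eq, Set.indicator_self_add_compl]
  have hadd := condExp_add (hEi.indicator hAm) (hEi.indicator hAcm) (F n)
  have h1 := condExp_indicator_exp_dressing_le hF hFle hf0 hfR n hVm hVb hV ht B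
  have h2 := condExp_indicator_compl_exp_dressing_le (μ := μ) (F := F) hFle hfm hfR n hVm t B
  rw [hdecomp]
  filter_upwards [hadd, h1, h2] with ω h3 h4 h5
  rw [h3, Pi.add_apply]
  exact add_le_add h4 h5

/-- [folklore] **THE LOG FORM of (AZ)**: a.e. the dressing factor is positive and
`0 ≤ log μ[exp(t f) ∣ F n] − t·μ[f ∣ F n] ≤ t²Σ_{i<n}σ_i²/2` — `log(ρ_K^t/ρ_K) = t·h + Ψ` with `h` the mean channel
and `Ψ` the fluctuation channel, `0 ≤ Ψ ≤ ½t²Σσ²`, the budget depending on NOTHING but `Σσ²`. -/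
theorem log_dressingFactor_sub_mean_mem (hF : Antitone F) (hFle : ∀ j, F j ≤ mΩ) {f : Ω → ℝ}
    (hf0 : StronglyMeasurable[F 0] f) {R : ℝ} (hfR : ∀ ω, |f ω| ≤ R) (n : ℕ) {σ : ℕ → ℝ}
    (hσ : IncrementBound μ F f n σ) (t : ℝ) :
    ∀ᵐ ω ∂μ, 0 < μ[fun ω => Real.exp (t * f ω) | F n] ω ∧
      0 ≤ Real.log (μ[fun ω => Real.exp (t * f ω) | F n] ω) - t * μ[f | F n] ω ∧
      Real.log (μ[fun ω => Real.exp (t * f ω) | F n] ω) - t * μ[f | F n] ω ≤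
        t ^ 2 * (∑ i ∈ range n, σ i ^ 2) / 2 := by
  obtain ⟨hlo, hhi⟩ := condExp_exp_dressing_sandwich hF hFle hf0 hfR n hσ t
  filter_upwards [hlo, hhi] with ω h1 h2
  have hpos : 0 < μ[fun ω => Real.exp (t * f ω) | F n] ω := lt_of_lt_of_le (Real.exp_pos _) h1
  refine ⟨hpos, ?_, ?_⟩
  · have := Real.log_le_log (Real.exp_pos _) h1
    rw [Real.log_exp] at this; linarith
  · have := Real.log_le_log hpos h2
    rw [Real.log_mul (Real.exp_pos _).ne' (Real.exp_pos _).ne', Real.log_exp, Real.log_exp] at this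
    linarith

/-- [folklore] **THE CRUDE (oscillation) SANDWICH on path space**: from `|f| ≤ R` alone, with NO filtration structure,
`exp(−|t|R) ≤ μ[exp(t f) ∣ m] ≤ exp(|t|R)` a.e. — K-uniform, `g_K`-independent, but of width `2|t|R`, NOT small:
this is the path-space form of dead end (h) (T4-DAG O3a), recorded so that nobody uses it as a uniqueness input. -/
theorem dressingFactor_crude_sandwich {f : Ω → ℝ} (hfm : AEStronglyMeasurable f μ) {R : ℝ}
    (hfR : ∀ ω, |f ω| ≤ R) {m : MeasurableSpace Ω} (hm : m ≤ mΩ) (t : ℝ) :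
    ((fun _ => Real.exp (-(|t| * R))) ≤ᵐ[μ] μ[fun ω => Real.exp (t * f ω) | m]) ∧
      (μ[fun ω => Real.exp (t * f ω) | m] ≤ᵐ[μ] fun _ => Real.exp (|t| * R)) := by
  have hfi := integrable_exp_mul_of_ae_abs_le hfm (ae_of_all μ hfR) t
  have hb : ∀ ω, |t * f ω| ≤ |t| * R := fun ω => by
    rw [abs_mul]; exact mul_le_mul_of_nonneg_left (hfR ω) (abs_nonneg t)
  have hup : (fun ω => Real.exp (t * f ω)) ≤ᵐ[μ] fun _ => Real.exp (|t| * R) :=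
    ae_of_all μ fun ω => Real.exp_le_exp.mpr ((le_abs_self _).trans (hb ω))
  have hdn : (fun _ => Real.exp (-(|t| * R))) ≤ᵐ[μ] fun ω => Real.exp (t * f ω) :=
    ae_of_all μ fun ω => Real.exp_le_exp.mpr ((neg_le_neg (hb ω)).trans (neg_abs_le _))
  constructor
  · have h := condExp_mono (m := m) (integrable_const _) hfi hdn
    rwa [condExp_const hm] at h
  · have h := condExp_mono (m := m) hfi (integrable_const _) hup
    rwa [condExp_const hm] at h

/-! ### §3b  Exhibiting a predictable proxy: the DOMAIN SPLIT, and the bad event by Markov's inequality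

The shape `IncrementVarProxy` is discharged from two more primitive data (cell analysis (A1)/(A1″), NOT PRINTED):
a PREDICTABLE CENTRE `Z i` (any `F (i+1)`-measurable guess for `μ[f ∣ F i]`, `|Z i| ≤ R`) and a DOMAIN `D i ∈ mΩ` on
which the guess is good, `|μ[f ∣ F i] − Z i| ≤ c i` (with `c i` itself predictable — random geometry).  Then
`V i := (c i)² + 4R²·μ[1_{(D i)ᶜ} ∣ F (i+1)]` is a predictable, bounded proxy; and the probability that the
large-field part `Σ_i μ[1_{(D i)ᶜ} ∣ F (i+1)]` of the budget exceeds `δ` is at most `δ⁻¹·Σ_i μ((D i)ᶜ)` — a sum of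
UNCONDITIONAL domain-failure probabilities (where, in the cell's use, the printed large-field suppression lives). -/

/-- [folklore] **Conditional variance ≤ conditional second moment about ANY predictable centre.**  For `Z`
`F (i+1)`-measurable and bounded: `μ[(incr μ F f i)² ∣ F (i+1)] ≤ μ[(μ[f∣F i] − Z)² ∣ F (i+1)]` a.e.
(Expand `(M − Z)² = (M − N)² + 2(M − N)(N − Z) + (N − Z)²` with `N = μ[f∣F(i+1)]`; the cross term has conditional
expectation `0` because `N − Z` is predictable and the increment is conditionally centred, K14b.) -/
theorem condExp_incr_sq_le_condExp_sq_sub (hF : Antitone F) (hFle : ∀ j, F j ≤ mΩ) {f : Ω → ℝ} {R : ℝ}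
    (hfR : ∀ ω, |f ω| ≤ R) (i : ℕ) {Z : Ω → ℝ} (hZm : StronglyMeasurable[F (i + 1)] Z) {CZ : ℝ}
    (hZb : ∀ ω, |Z ω| ≤ CZ) :
    μ[fun ω => incr μ F f i ω ^ 2 | F (i + 1)] ≤ᵐ[μ]
      μ[fun ω => (μ[f | F i] ω - Z ω) ^ 2 | F (i + 1)] := by
  haveI : SigmaFinite (μ.trim (hFle (i + 1))) := inferInstance
  set M : Ω → ℝ := μ[f | F i] with hM
  set N : Ω → ℝ := μ[f | F (i + 1)] with hN
  set Y : Ω → ℝ := incr μ F f i with hY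
  have hYdef : ∀ ω, Y ω = M ω - N ω := fun ω => incr_apply (μ := μ) (F := F) f i ω
  -- measurability / bounds
  have hMm : AEStronglyMeasurable M μ :=
    ((stronglyMeasurable_condExp (m := F i) (μ := μ) (f := f)).mono (hFle i)).aestronglyMeasurable
  have hNm' : StronglyMeasurable[F (i + 1)] N := stronglyMeasurable_condExp
  have hNm : AEStronglyMeasurable N μ := (hNm'.mono (hFle (i + 1))).aestronglyMeasurable
  have hZm' : AEStronglyMeasurable Z μ := (hZm.mono (hFle (i + 1))).aestronglyMeasurable
  have hMb : ∀ᵐ ω ∂μ, |M ω| ≤ R := ae_abs_condExp_le (μ := μ) (m := F i) hfR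
  have hNb : ∀ᵐ ω ∂μ, |N ω| ≤ R := ae_abs_condExp_le (μ := μ) (m := F (i + 1)) hfR
  have hYm : AEStronglyMeasurable Y μ :=
    ((stronglyMeasurable_incr (μ := μ) hF f i).mono (hFle i)).aestronglyMeasurable
  have hYb : ∀ᵐ ω ∂μ, |Y ω| ≤ 2 * R := incrementBound_crude (μ := μ) (F := F) hfR (i + 1) i i.lt_succ_self
  -- the predictable factor `P := N - Z` and its bound
  set P : Ω → ℝ := fun ω => N ω - Z ω with hP
  have hPm : StronglyMeasurable[F (i + 1)] P := hNm'.sub hZm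
  have hPb : ∀ᵐ ω ∂μ, ‖P ω‖ ≤ R + CZ := by
    filter_upwards [hNb] with ω hω
    rw [Real.norm_eq_abs]
    calc |N ω - Z ω| ≤ |N ω| + |Z ω| := abs_sub _ _
      _ ≤ R + CZ := add_le_add hω (hZb ω)
  -- integrability
  have hYi : Integrable Y μ := integrable_of_ae_abs_le hYm hYb
  have hY2i : Integrable (fun ω => Y ω ^ 2) μ := integrable_sq_of_ae_abs_le hYm hYb
  have hPYi : Integrable (fun ω => P ω * Y ω) μ :=
    hYi.bdd_mul ((hPm.mono (hFle (i + 1))).aestronglyMeasurable) hPb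
  have hP2m : AEStronglyMeasurable (fun ω => P ω ^ 2) μ :=
    ((hPm.mono (hFle (i + 1))).aestronglyMeasurable).pow 2
  have hPb' : ∀ᵐ ω ∂μ, |P ω| ≤ R + CZ := hPb.mono fun ω h => by rwa [Real.norm_eq_abs] at h
  have hP2i : Integrable (fun ω => P ω ^ 2) μ :=
    integrable_sq_of_ae_abs_le ((hPm.mono (hFle (i + 1))).aestronglyMeasurable) hPb'
  -- pointwise algebra: `(M - Z)^2 = Y^2 + 2 (P * Y) + P^2`, as functions
  have halg : (fun ω => (M ω - Z ω) ^ 2) =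
      (fun ω => Y ω ^ 2) + (2 : ℝ) • (P * Y) + fun ω => P ω ^ 2 := by
    funext ω
    simp only [Pi.add_apply, Pi.smul_apply, Pi.mul_apply, smul_eq_mul]
    rw [hYdef ω]; ring
  have hPYi' : Integrable (P * Y) μ := hPYi
  -- conditional expectations of the three pieces
  have hcross : μ[P * Y | F (i + 1)] =ᵐ[μ] 0 := by
    have hpull : μ[P * Y | F (i + 1)] =ᵐ[μ] P * μ[Y | F (i + 1)] :=
      condExp_stronglyMeasurable_mul_of_bound (hFle (i + 1)) hPm hYi _ hPb
    have h0 : μ[Y | F (i + 1)] =ᵐ[μ] 0 := condExp_incr_ae_eq_zero hF hFle f i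
    filter_upwards [hpull, h0] with ω h1 h2
    rw [h1, Pi.mul_apply, h2, Pi.zero_apply, mul_zero]
  have hsq : μ[fun ω => P ω ^ 2 | F (i + 1)] = fun ω => P ω ^ 2 :=
    condExp_of_stronglyMeasurable (hFle (i + 1)) (hPm.pow 2) hP2i
  have h12 := condExp_add hY2i (hPYi'.smul (2 : ℝ)) (F (i + 1))
  have h123 := condExp_add (hY2i.add (hPYi'.smul (2 : ℝ))) hP2i (F (i + 1))
  have h2 := condExp_smul (μ := μ) (2 : ℝ) (P * Y) (F (i + 1))
  rw [halg]
  filter_upwards [h123, h12, h2, hcross] with ω e123 e12 e2 ec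
  rw [e123, Pi.add_apply, e12, Pi.add_apply, e2, Pi.smul_apply, ec, Pi.zero_apply, smul_zero, add_zero]
  simp only [hsq]
  nlinarith [sq_nonneg (P ω)]

/-- [folklore] **THE DOMAIN-SPLIT PROXY** (discharges `IncrementVarProxy`).  Data for `i < n`: predictable centres
`Z i` (`F (i+1)`-measurable, `|Z i| ≤ R`), domains `D i ∈ mΩ`, predictable radii `c i` (`F (i+1)`-measurable,
`|c i| ≤ cmax`) with `|μ[f∣F i] − Z i| ≤ c i` a.e. ON `D i`.  Then `IncrementVarProxy μ F f n V` holds with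
`V i = (c i)² + 4R²·μ[1_{(D i)ᶜ} ∣ F (i+1)]`. -/
theorem incrementVarProxy_of_domainSplit (hF : Antitone F) (hFle : ∀ j, F j ≤ mΩ) {f : Ω → ℝ} {R : ℝ}
    (hfR : ∀ ω, |f ω| ≤ R) (n : ℕ) {Z : ℕ → Ω → ℝ} (hZm : ∀ i < n, StronglyMeasurable[F (i + 1)] (Z i))
    (hZb : ∀ i < n, ∀ ω, |Z i ω| ≤ R) {D : ℕ → Set Ω} (hD : ∀ i < n, MeasurableSet (D i))
    {c : ℕ → Ω → ℝ} {cmax : ℝ} (hcm : ∀ i < n, StronglyMeasurable[F (i + 1)] (c i))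
    (hcb : ∀ i < n, ∀ ω, |c i ω| ≤ cmax)
    (hdom : ∀ i < n, ∀ᵐ ω ∂μ, ω ∈ D i → |μ[f | F i] ω - Z i ω| ≤ c i ω) :
    IncrementVarProxy μ F f n fun i ω =>
      c i ω ^ 2 + 4 * R ^ 2 * μ[(D i)ᶜ.indicator (fun _ => (1 : ℝ)) | F (i + 1)] ω := by
  intro i hi
  haveI : SigmaFinite (μ.trim (hFle (i + 1))) := inferInstance
  have h1 := condExp_incr_sq_le_condExp_sq_sub (μ := μ) hF hFle hfR i (hZm i hi) (hZb i hi)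
  refine h1.trans ?_
  set M : Ω → ℝ := μ[f | F i] with hM
  have hMb : ∀ᵐ ω ∂μ, |M ω| ≤ R := ae_abs_condExp_le (μ := μ) (m := F i) hfR
  set χ : Ω → ℝ := (D i)ᶜ.indicator (fun _ => (1 : ℝ)) with hχ
  -- pointwise: `(M - Z)^2 ≤ c^2 + 4R^2 χ` a.e.
  have hptw : (fun ω => (M ω - Z i ω) ^ 2) ≤ᵐ[μ] (fun ω => c i ω ^ 2) + (4 * R ^ 2) • χ := by
    filter_upwards [hMb, hdom i hi] with ω hMω hdω
    simp only [Pi.add_apply, Pi.smul_apply, smul_eq_mul]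
    by_cases hω : ω ∈ D i
    · have hc := hdω hω
      have hDc : ω ∉ (D i)ᶜ := fun h => h hω
      simp only [hχ, Set.indicator_of_notMem hDc, mul_zero, add_zero]
      calc (M ω - Z i ω) ^ 2 = |M ω - Z i ω| ^ 2 := (sq_abs _).symm
        _ ≤ c i ω ^ 2 := pow_le_pow_left₀ (abs_nonneg _) hc 2
    · have hDc : ω ∈ (D i)ᶜ := hω
      simp only [hχ, Set.indicator_of_mem hDc, mul_one]
      have hle : |M ω - Z i ω| ≤ 2 * R :=
        (abs_sub _ _).trans (by linarith [hZb i hi ω])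
      calc (M ω - Z i ω) ^ 2 = |M ω - Z i ω| ^ 2 := (sq_abs _).symm
        _ ≤ (2 * R) ^ 2 := pow_le_pow_left₀ (abs_nonneg _) hle 2
        _ = 4 * R ^ 2 := by ring
        _ ≤ c i ω ^ 2 + 4 * R ^ 2 := by nlinarith [sq_nonneg (c i ω)]
  -- integrability
  have hMm : AEStronglyMeasurable M μ :=
    ((stronglyMeasurable_condExp (m := F i) (μ := μ) (f := f)).mono (hFle i)).aestronglyMeasurable
  have hZm' : AEStronglyMeasurable (Z i) μ := ((hZm i hi).mono (hFle (i + 1))).aestronglyMeasurable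
  have hMZb : ∀ᵐ ω ∂μ, |M ω - Z i ω| ≤ 2 * R := by
    filter_upwards [hMb] with ω hω
    exact (abs_sub _ _).trans (by linarith [hZb i hi ω])
  have hMZ2i : Integrable (fun ω => (M ω - Z i ω) ^ 2) μ :=
    integrable_sq_of_ae_abs_le (hMm.sub hZm') hMZb
  have hχi : Integrable χ μ := (integrable_const (1 : ℝ)).indicator (hD i hi).compl
  have hc2m : StronglyMeasurable[F (i + 1)] (fun ω => c i ω ^ 2) := (hcm i hi).pow 2
  have hc2i : Integrable (fun ω => c i ω ^ 2) μ :=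
    integrable_sq_of_ae_abs_le (((hcm i hi).mono (hFle (i + 1))).aestronglyMeasurable)
      (ae_of_all μ (hcb i hi))
  have hRχi : Integrable ((4 * R ^ 2) • χ) μ := hχi.smul _
  have hGi : Integrable ((fun ω => c i ω ^ 2) + (4 * R ^ 2) • χ) μ := hc2i.add hRχi
  -- conditional expectation of the dominating function
  have hmono := condExp_mono (m := F (i + 1)) hMZ2i hGi hptw
  have hadd := condExp_add hc2i hRχi (F (i + 1))
  have hc2 : μ[fun ω => c i ω ^ 2 | F (i + 1)] = fun ω => c i ω ^ 2 :=
    condExp_of_stronglyMeasurable (hFle (i + 1)) hc2m hc2i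
  have hsm := condExp_smul (μ := μ) (4 * R ^ 2 : ℝ) χ (F (i + 1))
  filter_upwards [hmono, hadd, hsm] with ω h2 h3 h4
  refine h2.trans (le_of_eq ?_)
  rw [h3, Pi.add_apply, hc2, h4, Pi.smul_apply, smul_eq_mul]

omit [IsFiniteMeasure μ] in
/-- [folklore] The domain-split proxies are predictable … -/
theorem stronglyMeasurable_domainSplitProxy {R : ℝ} (n : ℕ) {D : ℕ → Set Ω}
    {c : ℕ → Ω → ℝ} (hcm : ∀ i < n, StronglyMeasurable[F (i + 1)] (c i)) :
    ∀ i < n, StronglyMeasurable[F (i + 1)] (fun ω =>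
      c i ω ^ 2 + 4 * R ^ 2 * μ[(D i)ᶜ.indicator (fun _ => (1 : ℝ)) | F (i + 1)] ω) := fun i hi =>
  ((hcm i hi).pow 2).add (stronglyMeasurable_condExp.const_mul _)

/-- [folklore] … and a.e. bounded by `cmax² + 4R²` (a conditional probability is a.e. in `[0,1]`). -/
theorem ae_abs_domainSplitProxy_le (hFle : ∀ j, F j ≤ mΩ) {R : ℝ} (n : ℕ) {D : ℕ → Set Ω}
    (hD : ∀ i < n, MeasurableSet (D i)) {c : ℕ → Ω → ℝ} {cmax : ℝ} (hcb : ∀ i < n, ∀ ω, |c i ω| ≤ cmax) :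
    ∀ i < n, ∀ᵐ ω ∂μ,
      |c i ω ^ 2 + 4 * R ^ 2 * μ[(D i)ᶜ.indicator (fun _ => (1 : ℝ)) | F (i + 1)] ω| ≤ cmax ^ 2 + 4 * R ^ 2 := by
  intro i hi
  haveI : SigmaFinite (μ.trim (hFle (i + 1))) := inferInstance
  set χ : Ω → ℝ := (D i)ᶜ.indicator (fun _ => (1 : ℝ)) with hχ
  have hχi : Integrable χ μ := (integrable_const (1 : ℝ)).indicator (hD i hi).compl
  have hχ0 : (fun _ => (0 : ℝ)) ≤ᵐ[μ] χ := ae_of_all μ fun ω => by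
    simp only [hχ]; exact Set.indicator_nonneg (fun _ _ => zero_le_one) ω
  have hχ1 : χ ≤ᵐ[μ] fun _ => (1 : ℝ) := ae_of_all μ fun ω => by
    simp only [hχ]; exact Set.indicator_le_self' (fun _ _ => zero_le_one) ω
  have hlo : (fun _ => (0 : ℝ)) ≤ᵐ[μ] μ[χ | F (i + 1)] := by
    have h := condExp_mono (m := F (i + 1)) (integrable_const (0 : ℝ)) hχi hχ0
    filter_upwards [h] with ω hω
    simpa [condExp_const (hFle (i + 1)) (0 : ℝ)] using hω
  have hhi : μ[χ | F (i + 1)] ≤ᵐ[μ] fun _ => (1 : ℝ) := by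
    have h := condExp_mono (m := F (i + 1)) hχi (integrable_const (1 : ℝ)) hχ1
    filter_upwards [h] with ω hω
    simpa [condExp_const (hFle (i + 1)) (1 : ℝ)] using hω
  filter_upwards [hlo, hhi] with ω h0 h1
  have hc : c i ω ^ 2 ≤ cmax ^ 2 := by
    calc c i ω ^ 2 = |c i ω| ^ 2 := (sq_abs _).symm
      _ ≤ cmax ^ 2 := pow_le_pow_left₀ (abs_nonneg _) (hcb i hi ω) 2
  have hR : 0 ≤ 4 * R ^ 2 * μ[χ | F (i + 1)] ω := by positivity
  rw [abs_of_nonneg (by positivity)]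
  nlinarith [sq_nonneg R]

/-- [folklore] **THE BAD EVENT BY MARKOV.**  For domains `D i ∈ mΩ` and `δ > 0`:
`μ{δ < Σ_{i<n} μ[1_{(D i)ᶜ} ∣ F (i+1)]} ≤ δ⁻¹ · Σ_{i<n} μ((D i)ᶜ)` — the large-field part of the budget exceeds `δ`
with probability controlled by the SUM OF UNCONDITIONAL domain-failure probabilities (where the printed large-field
suppression is to be inserted, header (A1″); nothing conditional survives). -/
theorem measureReal_lt_sum_condExp_indicator_le (hFle : ∀ j, F j ≤ mΩ) (n : ℕ) {D : ℕ → Set Ω}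
    (hD : ∀ i < n, MeasurableSet (D i)) {δ : ℝ} (hδ : 0 < δ) :
    μ.real {ω | δ < ∑ i ∈ range n, μ[(D i)ᶜ.indicator (fun _ => (1 : ℝ)) | F (i + 1)] ω} ≤
      δ⁻¹ * ∑ i ∈ range n, μ.real (D i)ᶜ := by
  set S : Ω → ℝ := fun ω => ∑ i ∈ range n, μ[(D i)ᶜ.indicator (fun _ => (1 : ℝ)) | F (i + 1)] ω with hS
  have hχi : ∀ i < n, Integrable ((D i)ᶜ.indicator fun _ => (1 : ℝ)) μ := fun i hi =>
    (integrable_const (1 : ℝ)).indicator (hD i hi).compl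
  -- `S ≥ 0` a.e. and `∫ S = Σ μ((D i)ᶜ)`
  have hS0 : 0 ≤ᵐ[μ] S := by
    have hterm : ∀ i ∈ range n, ∀ᵐ ω ∂μ,
        0 ≤ μ[(D i)ᶜ.indicator (fun _ => (1 : ℝ)) | F (i + 1)] ω := by
      intro i hi
      have hi' := mem_range.mp hi
      haveI : SigmaFinite (μ.trim (hFle (i + 1))) := inferInstance
      have h := condExp_mono (m := F (i + 1)) (integrable_const (0 : ℝ)) (hχi i hi')
        (ae_of_all μ fun ω => Set.indicator_nonneg (fun _ _ => zero_le_one) ω)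
      filter_upwards [h] with ω hω
      simpa [condExp_const (hFle (i + 1)) (0 : ℝ)] using hω
    have hall : ∀ᵐ ω ∂μ, ∀ i ∈ range n,
        0 ≤ μ[(D i)ᶜ.indicator (fun _ => (1 : ℝ)) | F (i + 1)] ω :=
      (Filter.eventually_all_finset (range n)).mpr hterm
    filter_upwards [hall] with ω hω
    exact Finset.sum_nonneg fun i hi => hω i hi
  have hSi : Integrable S μ :=
    integrable_finsetSum (range n) fun i hi => integrable_condExp
  have hSint : ∫ ω, S ω ∂μ = ∑ i ∈ range n, μ.real (D i)ᶜ := by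
    rw [integral_finsetSum (range n) fun i hi => integrable_condExp]
    refine Finset.sum_congr rfl fun i hi => ?_
    have hi' := mem_range.mp hi
    haveI : SigmaFinite (μ.trim (hFle (i + 1))) := inferInstance
    rw [integral_condExp (hFle (i + 1)), integral_indicator_const (1 : ℝ) (hD i hi').compl, smul_eq_mul,
      mul_one]
  -- Markov
  have hmk : δ * μ.real {ω | δ ≤ S ω} ≤ ∫ ω, S ω ∂μ := mul_meas_ge_le_integral_of_nonneg hS0 hSi δ
  have hsub : {ω | δ < S ω} ⊆ {ω | δ ≤ S ω} := fun ω (hω : δ < S ω) => show δ ≤ S ω from le_of_lt hω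
  have hmono : μ.real {ω | δ < S ω} ≤ μ.real {ω | δ ≤ S ω} := measureReal_mono hsub (measure_ne_top μ _)
  calc μ.real {ω | δ < S ω} ≤ μ.real {ω | δ ≤ S ω} := hmono
    _ ≤ δ⁻¹ * ∫ ω, S ω ∂μ := by rw [le_inv_mul_iff₀ hδ]; exact hmk
    _ = δ⁻¹ * ∑ i ∈ range n, μ.real (D i)ᶜ := by rw [hSint]


/-! ### §3c  Non-negative proxies, the budget tail by FIRST MOMENTS, and PREDICTABLE domains (a bad event of the
future geometry is charged ONCE, not once per event) -/

omit [IsFiniteMeasure μ] in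
/-- [folklore] A variance proxy dominates a conditional second moment, hence is a.e. non-negative (Mathlib
`condExp_nonneg`; no integrability is needed). -/
theorem IncrementVarProxy.ae_nonneg {f : Ω → ℝ} {n : ℕ} {V : ℕ → Ω → ℝ} (hV : IncrementVarProxy μ F f n V) :
    ∀ i < n, ∀ᵐ ω ∂μ, 0 ≤ V i ω := by
  intro i hi
  have h0 : (0 : Ω → ℝ) ≤ᵐ[μ] μ[fun ω => incr μ F f i ω ^ 2 | F (i + 1)] :=
    condExp_nonneg (ae_of_all μ fun ω => sq_nonneg (incr μ F f i ω))
  filter_upwards [h0, hV i hi] with ω h1 h2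
  simpa only [Pi.zero_apply] using h1.trans h2

/-- [folklore] **THE BUDGET TAIL BY FIRST MOMENTS (Markov).**  Predictable, a.e.-bounded, a.e. non-negative proxies
`V i` and a level `B > 0` ⇒ `μ{B < Σ_{i<n} V i} ≤ B⁻¹ · Σ_{i<n} ∫ V i dμ`.  Only the UNCONDITIONAL EXPECTATIONS of the
proxies under the (undressed) path law survive — sums over events of first moments of geometric functionals, the
currency in which large-field suppression is printed (header (MI-1‴); nothing of it is asserted here). -/
theorem measureReal_lt_sum_le_inv_mul_sum_integral (hFle : ∀ j, F j ≤ mΩ) (n : ℕ) {V : ℕ → Ω → ℝ}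
    {Vmax : ℝ} (hVm : ∀ i < n, StronglyMeasurable[F (i + 1)] (V i))
    (hVb : ∀ i < n, ∀ᵐ ω ∂μ, |V i ω| ≤ Vmax) (hV0 : ∀ i < n, ∀ᵐ ω ∂μ, 0 ≤ V i ω) {B : ℝ} (hB : 0 < B) :
    μ.real {ω | B < ∑ i ∈ range n, V i ω} ≤ B⁻¹ * ∑ i ∈ range n, ∫ ω, V i ω ∂μ := by
  set S : Ω → ℝ := fun ω => ∑ i ∈ range n, V i ω with hS
  have hVi : ∀ i ∈ range n, Integrable (V i) μ := fun i hi =>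
    integrable_of_ae_abs_le (((hVm i (mem_range.mp hi)).mono (hFle (i + 1))).aestronglyMeasurable)
      (hVb i (mem_range.mp hi))
  have hS0 : 0 ≤ᵐ[μ] S := by
    have hall : ∀ᵐ ω ∂μ, ∀ i ∈ range n, 0 ≤ V i ω :=
      (Filter.eventually_all_finset (range n)).mpr fun i hi => hV0 i (mem_range.mp hi)
    filter_upwards [hall] with ω hω
    exact Finset.sum_nonneg fun i hi => hω i hi
  have hSi : Integrable S μ := integrable_finsetSum (range n) hVi
  have hSint : ∫ ω, S ω ∂μ = ∑ i ∈ range n, ∫ ω, V i ω ∂μ := integral_finsetSum (range n) hVi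
  have hmk : B * μ.real {ω | B ≤ S ω} ≤ ∫ ω, S ω ∂μ := mul_meas_ge_le_integral_of_nonneg hS0 hSi B
  have hsub : {ω | B < S ω} ⊆ {ω | B ≤ S ω} := fun ω (hω : B < S ω) => show B ≤ S ω from le_of_lt hω
  calc μ.real {ω | B < S ω} ≤ μ.real {ω | B ≤ S ω} := measureReal_mono hsub (measure_ne_top μ _)
    _ ≤ B⁻¹ * ∫ ω, S ω ∂μ := by rw [le_inv_mul_iff₀ hB]; exact hmk
    _ = B⁻¹ * ∑ i ∈ range n, ∫ ω, V i ω ∂μ := by rw [hSint]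

/-- [folklore] **DOMAIN SPLIT WITH PREDICTABLE DOMAINS.**  If the domains are measurable ONE LEVEL UP
(`D i ∈ F (i+1)`: conditions on the FUTURE / coarser part of the path — in the cell's use, on the realised multi-scale
large-field geometry above event `i`, which is part of the term labels and persists), the conditional failure
probability `μ[1_{(D i)ᶜ} ∣ F (i+1)]` IS the indicator, and the proxy of `incrementVarProxy_of_domainSplit` becomes
`V i = (c i)² + 4R²·1_{(D i)ᶜ}`.  Its bad event is then contained in `⋃_i (D i)ᶜ` — ONE event of the path law, charged
once (`integral_mul_exp_le_of_predictableDomainSplit`), however many events fail on it. -/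
theorem incrementVarProxy_of_predictableDomainSplit (hF : Antitone F) (hFle : ∀ j, F j ≤ mΩ) {f : Ω → ℝ}
    {R : ℝ} (hfR : ∀ ω, |f ω| ≤ R) (n : ℕ) {Z : ℕ → Ω → ℝ}
    (hZm : ∀ i < n, StronglyMeasurable[F (i + 1)] (Z i)) (hZb : ∀ i < n, ∀ ω, |Z i ω| ≤ R)
    {D : ℕ → Set Ω} (hD : ∀ i < n, MeasurableSet[F (i + 1)] (D i)) {c : ℕ → Ω → ℝ} {cmax : ℝ}
    (hcm : ∀ i < n, StronglyMeasurable[F (i + 1)] (c i)) (hcb : ∀ i < n, ∀ ω, |c i ω| ≤ cmax)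
    (hdom : ∀ i < n, ∀ᵐ ω ∂μ, ω ∈ D i → |μ[f | F i] ω - Z i ω| ≤ c i ω) :
    IncrementVarProxy μ F f n fun i ω =>
      c i ω ^ 2 + 4 * R ^ 2 * (D i)ᶜ.indicator (fun _ => (1 : ℝ)) ω := by
  have hD' : ∀ i < n, MeasurableSet (D i) := fun i hi => hFle (i + 1) _ (hD i hi)
  have h := incrementVarProxy_of_domainSplit hF hFle hfR n hZm hZb hD' hcm hcb hdom
  intro i hi
  haveI : SigmaFinite (μ.trim (hFle (i + 1))) := inferInstance
  have hχm : StronglyMeasurable[F (i + 1)] ((D i)ᶜ.indicator fun _ => (1 : ℝ)) :=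
    stronglyMeasurable_const.indicator (hD i hi).compl
  have hχi : Integrable ((D i)ᶜ.indicator fun _ => (1 : ℝ)) μ :=
    (integrable_const (1 : ℝ)).indicator (hD' i hi).compl
  have hχ : μ[(D i)ᶜ.indicator (fun _ => (1 : ℝ)) | F (i + 1)] = (D i)ᶜ.indicator fun _ => (1 : ℝ) :=
    condExp_of_stronglyMeasurable (hFle (i + 1)) hχm hχi
  have hgoal : μ[fun ω => incr μ F f i ω ^ 2 | F (i + 1)] ≤ᵐ[μ]
      fun ω => c i ω ^ 2 + 4 * R ^ 2 * μ[(D i)ᶜ.indicator (fun _ => (1 : ℝ)) | F (i + 1)] ω := h i hi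
  rw [hχ] at hgoal
  exact hgoal

omit [IsFiniteMeasure μ] in
/-- [folklore] The predictable-domain proxies are predictable … -/
theorem stronglyMeasurable_predictableDomainSplitProxy {R : ℝ} (n : ℕ) {D : ℕ → Set Ω}
    (hD : ∀ i < n, MeasurableSet[F (i + 1)] (D i)) {c : ℕ → Ω → ℝ}
    (hcm : ∀ i < n, StronglyMeasurable[F (i + 1)] (c i)) :
    ∀ i < n, StronglyMeasurable[F (i + 1)] (fun ω =>
      c i ω ^ 2 + 4 * R ^ 2 * (D i)ᶜ.indicator (fun _ => (1 : ℝ)) ω) := fun i hi =>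
  ((hcm i hi).pow 2).add ((stronglyMeasurable_const.indicator (hD i hi).compl).const_mul _)

omit [IsFiniteMeasure μ] in
/-- [folklore] … and bounded by `cmax² + 4R²` everywhere. -/
theorem abs_predictableDomainSplitProxy_le {R : ℝ} (n : ℕ) (D : ℕ → Set Ω) {c : ℕ → Ω → ℝ} {cmax : ℝ}
    (hcb : ∀ i < n, ∀ ω, |c i ω| ≤ cmax) :
    ∀ i < n, ∀ ω, |c i ω ^ 2 + 4 * R ^ 2 * (D i)ᶜ.indicator (fun _ => (1 : ℝ)) ω| ≤ cmax ^ 2 + 4 * R ^ 2 := by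
  intro i hi ω
  have hc : c i ω ^ 2 ≤ cmax ^ 2 := by
    calc c i ω ^ 2 = |c i ω| ^ 2 := (sq_abs _).symm
      _ ≤ cmax ^ 2 := pow_le_pow_left₀ (abs_nonneg _) (hcb i hi ω) 2
  have hχ0 : 0 ≤ (D i)ᶜ.indicator (fun _ => (1 : ℝ)) ω := Set.indicator_nonneg (fun _ _ => zero_le_one) ω
  have hχ1 : (D i)ᶜ.indicator (fun _ => (1 : ℝ)) ω ≤ 1 := Set.indicator_le_self' (fun _ _ => zero_le_one) ω
  have hR2 : 0 ≤ 4 * R ^ 2 := by positivity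
  rw [abs_of_nonneg (add_nonneg (sq_nonneg _) (mul_nonneg hR2 hχ0))]
  exact add_le_add hc (mul_le_of_le_one_right hR2 hχ1)

end Dressing

/-! ## §4  The coupling identity: dressed expectations of endpoint observables -/

section Coupling

variable {Ω : Type*} {mΩ : MeasurableSpace Ω} {μ : Measure Ω} [IsFiniteMeasure μ]

/-- [folklore] **DRESSED = UNDRESSED × E[dressing ∣ endpoint].**  For every endpoint observable `g` (measurable for the
endpoint σ-algebra `m`, bounded) the dressed integral `∫ g·exp(t f) dμ` equals `∫ g·μ[exp(t f) ∣ m] dμ`: on the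
coupled path space the dressed final density is the undressed one times the `m`-measurable DRESSING FACTOR
`μ[exp(t f) ∣ m]` (K14b `T4MeanChannel.integral_mul_eq_integral_mul_condExp` BY NAME). -/
theorem integral_mul_exp_eq_integral_mul_dressingFactor {g f : Ω → ℝ} (hfm : AEStronglyMeasurable f μ)
    {R : ℝ} (hfR : ∀ ω, |f ω| ≤ R) {Cg : ℝ} (hgC : ∀ ω, |g ω| ≤ Cg) {m : MeasurableSpace Ω} (hm : m ≤ mΩ)
    (hg : StronglyMeasurable[m] g) (t : ℝ) :
    ∫ ω, g ω * Real.exp (t * f ω) ∂μ = ∫ ω, g ω * μ[fun ω => Real.exp (t * f ω) | m] ω ∂μ := by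
  haveI : SigmaFinite (μ.trim hm) := inferInstance
  have hfi := integrable_exp_mul_of_ae_abs_le hfm (ae_of_all μ hfR) t
  refine integral_mul_eq_integral_mul_condExp hm hg hfi ?_
  have h := hfi.mul_bdd ((hg.mono hm).aestronglyMeasurable)
    (ae_of_all μ fun ω => by rw [Real.norm_eq_abs]; exact hgC ω)
  exact h.congr (ae_of_all μ fun ω => mul_comm _ _)

/-- [folklore] The NORMALISED form: the dressed expectation of an endpoint observable is the undressed expectation
against the dressing factor, `∫ g e^{tf} / ∫ e^{tf} = ∫ g·D / ∫ D` with `D = μ[exp(t f) ∣ m]` (take `g = 1` above for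
the denominator). -/
theorem integral_exp_eq_integral_dressingFactor {f : Ω → ℝ} (hfm : AEStronglyMeasurable f μ) {R : ℝ}
    (hfR : ∀ ω, |f ω| ≤ R) {m : MeasurableSpace Ω} (hm : m ≤ mΩ) (t : ℝ) :
    ∫ ω, Real.exp (t * f ω) ∂μ = ∫ ω, μ[fun ω => Real.exp (t * f ω) | m] ω ∂μ := by
  have h := integral_mul_exp_eq_integral_mul_dressingFactor (g := fun _ => (1 : ℝ)) hfm hfR (Cg := 1)
    (fun _ => by simp) hm stronglyMeasurable_const t
  simpa using h

/-- [folklore] **THE INTEGRATED RANDOM-GEOMETRY BOUND (consumer form).**  For a bounded non-negative endpoint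
observable `g` (`F n`-measurable, `0 ≤ g ≤ Cg`), under `IncrementVarProxy μ F f n V` with predictable a.e.-bounded
proxies and `|t|·2R ≤ 1`, for every budget level `B`:
`∫ g·exp(t f) dμ ≤ exp(t²B)·∫ g·exp(t·μ[f∣F n]) dμ + exp(|t|R)·Cg·μ{B < Σ V_i}`.
Only the UNCONDITIONAL probability of the giant-geometry event appears (header (A1″)): this is the shape in which the
printed large-field suppression would be consumed by the uniqueness half (E4/U5b) — as ONE tail estimate. -/
theorem integral_mul_exp_le_of_varProxy {F : ℕ → MeasurableSpace Ω} (hF : Antitone F) (hFle : ∀ j, F j ≤ mΩ)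
    {f : Ω → ℝ} (hf0 : StronglyMeasurable[F 0] f) {R : ℝ} (hfR : ∀ ω, |f ω| ≤ R) (n : ℕ)
    {V : ℕ → Ω → ℝ} {Vmax : ℝ} (hVm : ∀ i < n, StronglyMeasurable[F (i + 1)] (V i))
    (hVb : ∀ i < n, ∀ᵐ ω ∂μ, |V i ω| ≤ Vmax) (hV : IncrementVarProxy μ F f n V) {t : ℝ}
    (ht : |t| * (2 * R) ≤ 1) (B : ℝ) {g : Ω → ℝ} (hg : StronglyMeasurable[F n] g) (hg0 : ∀ ω, 0 ≤ g ω)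
    {Cg : ℝ} (hgC : ∀ ω, g ω ≤ Cg) :
    ∫ ω, g ω * Real.exp (t * f ω) ∂μ ≤
      Real.exp (t ^ 2 * B) * ∫ ω, g ω * Real.exp (t * μ[f | F n] ω) ∂μ +
        Real.exp (|t| * R) * (Cg * μ.real {ω | B < ∑ i ∈ range n, V i ω}) := by
  haveI : SigmaFinite (μ.trim (hFle n)) := inferInstance
  have hfm : AEStronglyMeasurable f μ := (hf0.mono (hFle 0)).aestronglyMeasurable
  have hgabs : ∀ ω, |g ω| ≤ Cg := fun ω => abs_le.mpr ⟨by linarith [hg0 ω, hgC ω], hgC ω⟩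
  have hgm : AEStronglyMeasurable g μ := (hg.mono (hFle n)).aestronglyMeasurable
  have hgnorm : ∀ᵐ ω ∂μ, ‖g ω‖ ≤ Cg := ae_of_all μ fun ω => by rw [Real.norm_eq_abs]; exact hgabs ω
  set Ac : Set Ω := {ω | B < ∑ i ∈ range n, V i ω} with hAc
  have hsumVm : StronglyMeasurable (fun ω => ∑ i ∈ range n, V i ω) :=
    Finset.stronglyMeasurable_fun_sum (range n) fun i hi => (hVm i (mem_range.mp hi)).mono (hFle (i + 1))
  have hAcm : MeasurableSet Ac := measurableSet_lt measurable_const hsumVm.measurable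
  -- names for the three integrands
  set D : Ω → ℝ := μ[fun ω => Real.exp (t * f ω) | F n] with hD
  set H : Ω → ℝ := fun ω => Real.exp (t * μ[f | F n] ω) with hH
  set P : Ω → ℝ := μ[Ac.indicator fun _ => (1 : ℝ) | F n] with hP
  -- step 1: dressed = undressed × dressing factor
  have hstep1 : ∫ ω, g ω * Real.exp (t * f ω) ∂μ = ∫ ω, g ω * D ω ∂μ :=
    integral_mul_exp_eq_integral_mul_dressingFactor hfm hfR hgabs (hFle n) hg t
  -- step 2: the a.e. bound on the dressing factor, multiplied by `g ≥ 0`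
  obtain ⟨-, hup⟩ := condExp_exp_dressing_sandwich_of_varProxy hF hFle hf0 hfR n hVm hVb hV ht B
  have hH_int : Integrable H μ :=
    integrable_exp_mul_of_ae_abs_le (stronglyMeasurable_condExp.mono (hFle n)).aestronglyMeasurable
      (ae_abs_condExp_le (μ := μ) (m := F n) hfR) t
  have hgD : Integrable (fun ω => g ω * D ω) μ := by
    have h := (integrable_condExp (m := F n) (μ := μ) (f := fun ω => Real.exp (t * f ω))).bdd_mul hgm hgnorm
    exact h
  have hgH : Integrable (fun ω => g ω * H ω) μ := hH_int.bdd_mul hgm hgnorm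
  have hgP : Integrable (fun ω => g ω * P ω) μ :=
    (integrable_condExp (m := F n) (μ := μ) (f := Ac.indicator fun _ => (1 : ℝ))).bdd_mul hgm hgnorm
  have hdom : (fun ω => g ω * D ω) ≤ᵐ[μ]
      fun ω => Real.exp (t ^ 2 * B) * (g ω * H ω) + Real.exp (|t| * R) * (g ω * P ω) := by
    filter_upwards [hup] with ω hω
    have := mul_le_mul_of_nonneg_left hω (hg0 ω)
    calc g ω * D ω ≤ g ω * (H ω * Real.exp (t ^ 2 * B) + Real.exp (|t| * R) * P ω) := this
      _ = Real.exp (t ^ 2 * B) * (g ω * H ω) + Real.exp (|t| * R) * (g ω * P ω) := by ring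
  have hRHS : Integrable (fun ω => Real.exp (t ^ 2 * B) * (g ω * H ω) +
      Real.exp (|t| * R) * (g ω * P ω)) μ := (hgH.const_mul _).add (hgP.const_mul _)
  have hsum : ∫ ω, (Real.exp (t ^ 2 * B) * (g ω * H ω) + Real.exp (|t| * R) * (g ω * P ω)) ∂μ =
      Real.exp (t ^ 2 * B) * ∫ ω, g ω * H ω ∂μ + Real.exp (|t| * R) * ∫ ω, g ω * P ω ∂μ := by
    rw [integral_add (hgH.const_mul _) (hgP.const_mul _), integral_const_mul, integral_const_mul]
  have hstep2 : ∫ ω, g ω * D ω ∂μ ≤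
      Real.exp (t ^ 2 * B) * ∫ ω, g ω * H ω ∂μ + Real.exp (|t| * R) * ∫ ω, g ω * P ω ∂μ :=
    (integral_mono_ae hgD hRHS hdom).trans_eq hsum
  -- step 3: `∫ g·P = ∫ g·1_{Ac} ≤ Cg·μ(Ac)`
  have h1i : Integrable (Ac.indicator fun _ => (1 : ℝ)) μ := (integrable_const (1 : ℝ)).indicator hAcm
  have hg1i : Integrable (fun ω => g ω * Ac.indicator (fun _ => (1 : ℝ)) ω) μ := by
    have h := h1i.bdd_mul hgm hgnorm
    exact h
  have hstep3 : ∫ ω, g ω * P ω ∂μ = ∫ ω, g ω * Ac.indicator (fun _ => (1 : ℝ)) ω ∂μ :=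
    (integral_mul_eq_integral_mul_condExp (hFle n) hg h1i hg1i).symm
  have hstep4 : ∫ ω, g ω * Ac.indicator (fun _ => (1 : ℝ)) ω ∂μ ≤ Cg * μ.real Ac := by
    have hdom' : (fun ω => g ω * Ac.indicator (fun _ => (1 : ℝ)) ω) ≤ᵐ[μ]
        fun ω => Cg * Ac.indicator (fun _ => (1 : ℝ)) ω := by
      refine ae_of_all μ fun ω => ?_
      by_cases hω : ω ∈ Ac
      · simp only [Set.indicator_of_mem hω, mul_one]; exact hgC ω
      · simp only [Set.indicator_of_notMem hω, mul_zero]; exact le_rfl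
    have hCi : Integrable (fun ω => Cg * Ac.indicator (fun _ => (1 : ℝ)) ω) μ := h1i.const_mul Cg
    have h := integral_mono_ae hg1i hCi hdom'
    have hval : ∫ ω, Cg * Ac.indicator (fun _ => (1 : ℝ)) ω ∂μ = Cg * μ.real Ac := by
      rw [integral_const_mul, integral_indicator_const (1 : ℝ) hAcm, smul_eq_mul, mul_one]
    exact h.trans_eq hval
  -- assemble
  rw [hstep1]
  refine hstep2.trans ?_
  rw [hstep3]
  have hpos : 0 ≤ Real.exp (|t| * R) := (Real.exp_pos _).le
  have := mul_le_mul_of_nonneg_left hstep4 hpos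
  linarith

/-- [folklore] **THE INTEGRATED LOWER BOUND (Jensen side).**  For bounded `g ≥ 0` measurable at the endpoint and
every real `t`: `∫ g·exp(t·μ[f∣F n]) dμ ≤ ∫ g·exp(t f) dμ` — UNDRESSED-reweighted-by-the-mean-channel ≤ DRESSED, with
no budget at all. -/
theorem integral_mul_exp_mean_le {F : ℕ → MeasurableSpace Ω} (hF : Antitone F) (hFle : ∀ j, F j ≤ mΩ)
    {f : Ω → ℝ} (hf0 : StronglyMeasurable[F 0] f) {R : ℝ} (hfR : ∀ ω, |f ω| ≤ R) (n : ℕ) (t : ℝ)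
    {g : Ω → ℝ} (hg : StronglyMeasurable[F n] g) (hg0 : ∀ ω, 0 ≤ g ω) {Cg : ℝ} (hgC : ∀ ω, g ω ≤ Cg) :
    ∫ ω, g ω * Real.exp (t * μ[f | F n] ω) ∂μ ≤ ∫ ω, g ω * Real.exp (t * f ω) ∂μ := by
  haveI : SigmaFinite (μ.trim (hFle n)) := inferInstance
  have hfm : AEStronglyMeasurable f μ := (hf0.mono (hFle 0)).aestronglyMeasurable
  have hgabs : ∀ ω, |g ω| ≤ Cg := fun ω => abs_le.mpr ⟨by linarith [hg0 ω, hgC ω], hgC ω⟩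
  have hgm : AEStronglyMeasurable g μ := (hg.mono (hFle n)).aestronglyMeasurable
  have hgnorm : ∀ᵐ ω ∂μ, ‖g ω‖ ≤ Cg := ae_of_all μ fun ω => by rw [Real.norm_eq_abs]; exact hgabs ω
  set D : Ω → ℝ := μ[fun ω => Real.exp (t * f ω) | F n] with hD
  set H : Ω → ℝ := fun ω => Real.exp (t * μ[f | F n] ω) with hH
  have hstep1 : ∫ ω, g ω * Real.exp (t * f ω) ∂μ = ∫ ω, g ω * D ω ∂μ :=
    integral_mul_exp_eq_integral_mul_dressingFactor hfm hfR hgabs (hFle n) hg t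
  obtain ⟨hlo, -⟩ := condExp_exp_dressing_sandwich (μ := μ) hF hFle hf0 hfR n
    (incrementBound_crude (μ := μ) (F := F) hfR n) t
  have hH_int : Integrable H μ :=
    integrable_exp_mul_of_ae_abs_le (stronglyMeasurable_condExp.mono (hFle n)).aestronglyMeasurable
      (ae_abs_condExp_le (μ := μ) (m := F n) hfR) t
  have hgD : Integrable (fun ω => g ω * D ω) μ :=
    (integrable_condExp (m := F n) (μ := μ) (f := fun ω => Real.exp (t * f ω))).bdd_mul hgm hgnorm
  have hgH : Integrable (fun ω => g ω * H ω) μ := hH_int.bdd_mul hgm hgnorm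
  have hdom : (fun ω => g ω * H ω) ≤ᵐ[μ] fun ω => g ω * D ω := by
    filter_upwards [hlo] with ω hω
    exact mul_le_mul_of_nonneg_left hω (hg0 ω)
  rw [hstep1]
  exact integral_mono_ae hgH hgD hdom

/-- [folklore] **END-TO-END CONSUMER FORM FROM THE DOMAIN SPLIT.**  Only primitive data enter: predictable
centres `Z i`, domains `D i`, predictable radii `c i` with `|μ[f∣F i] − Z i| ≤ c i` a.e. on `D i` (§3b), a budget
level `B₀` for the geometric part `Σ (c i)²` and a level `δ > 0` for the large-field part.  Conclusion, for
`|t|·2R ≤ 1` and bounded `g ≥ 0` measurable at the endpoint: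
`∫ g e^{tf} ≤ e^{t²(B₀ + 4R²δ)} ∫ g e^{t·μ[f∣F n]} + e^{|t|R}·Cg·( μ{B₀ < Σ (c i)²} + δ⁻¹ Σ_i μ((D i)ᶜ) )` —
DRESSED ≤ UNDRESSED-reweighted-by-the-mean-channel × a K-uniform factor, plus the crude factor times TWO
UNCONDITIONAL TAILS: the giant-geometry tail and the summed domain-failure (large-field) probabilities.  In the
cell's use (header (A1″), NOT PROVED) both tails are where the printed large-field suppression is to be inserted. -/
theorem integral_mul_exp_le_of_domainSplit {F : ℕ → MeasurableSpace Ω} (hF : Antitone F)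
    (hFle : ∀ j, F j ≤ mΩ) {f : Ω → ℝ} (hf0 : StronglyMeasurable[F 0] f) {R : ℝ} (hfR : ∀ ω, |f ω| ≤ R)
    (n : ℕ) {Z : ℕ → Ω → ℝ} (hZm : ∀ i < n, StronglyMeasurable[F (i + 1)] (Z i))
    (hZb : ∀ i < n, ∀ ω, |Z i ω| ≤ R) {D : ℕ → Set Ω} (hD : ∀ i < n, MeasurableSet (D i))
    {c : ℕ → Ω → ℝ} {cmax : ℝ} (hcm : ∀ i < n, StronglyMeasurable[F (i + 1)] (c i))
    (hcb : ∀ i < n, ∀ ω, |c i ω| ≤ cmax)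
    (hdom : ∀ i < n, ∀ᵐ ω ∂μ, ω ∈ D i → |μ[f | F i] ω - Z i ω| ≤ c i ω) {t : ℝ}
    (ht : |t| * (2 * R) ≤ 1) (B₀ : ℝ) {δ : ℝ} (hδ : 0 < δ) {g : Ω → ℝ} (hg : StronglyMeasurable[F n] g)
    (hg0 : ∀ ω, 0 ≤ g ω) {Cg : ℝ} (hCg : 0 ≤ Cg) (hgC : ∀ ω, g ω ≤ Cg) :
    ∫ ω, g ω * Real.exp (t * f ω) ∂μ ≤
      Real.exp (t ^ 2 * (B₀ + 4 * R ^ 2 * δ)) * ∫ ω, g ω * Real.exp (t * μ[f | F n] ω) ∂μ +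
        Real.exp (|t| * R) * (Cg * (μ.real {ω | B₀ < ∑ i ∈ range n, c i ω ^ 2} +
          δ⁻¹ * ∑ i ∈ range n, μ.real (D i)ᶜ)) := by
  set V : ℕ → Ω → ℝ := fun i ω =>
    c i ω ^ 2 + 4 * R ^ 2 * μ[(D i)ᶜ.indicator (fun _ => (1 : ℝ)) | F (i + 1)] ω with hV
  have hVP : IncrementVarProxy μ F f n V :=
    incrementVarProxy_of_domainSplit hF hFle hfR n hZm hZb hD hcm hcb hdom
  have hVm := stronglyMeasurable_domainSplitProxy (μ := μ) (F := F) (R := R) n (D := D) hcm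
  have hVb := ae_abs_domainSplitProxy_le (μ := μ) (F := F) hFle (R := R) n hD hcb
  have hmain := integral_mul_exp_le_of_varProxy hF hFle hf0 hfR n hVm hVb hVP ht (B₀ + 4 * R ^ 2 * δ)
    hg hg0 hgC
  refine hmain.trans ?_
  -- the bad event of the proxies is contained in the union of the two primitive bad events
  set E₁ : Set Ω := {ω | B₀ < ∑ i ∈ range n, c i ω ^ 2} with hE₁
  set E₂ : Set Ω := {ω | δ < ∑ i ∈ range n, μ[(D i)ᶜ.indicator (fun _ => (1 : ℝ)) | F (i + 1)] ω}
    with hE₂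
  have hsub : {ω | B₀ + 4 * R ^ 2 * δ < ∑ i ∈ range n, V i ω} ⊆ E₁ ∪ E₂ := by
    intro ω hω
    by_contra hnot
    simp only [Set.mem_union, hE₁, hE₂, Set.mem_setOf_eq, not_or, not_lt] at hnot
    obtain ⟨h1, h2⟩ := hnot
    have hsum : ∑ i ∈ range n, V i ω = ∑ i ∈ range n, c i ω ^ 2 +
        4 * R ^ 2 * ∑ i ∈ range n, μ[(D i)ᶜ.indicator (fun _ => (1 : ℝ)) | F (i + 1)] ω := by
      simp only [hV, Finset.sum_add_distrib, Finset.mul_sum]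
    have hR2 : 0 ≤ 4 * R ^ 2 := by positivity
    have hle : ∑ i ∈ range n, V i ω ≤ B₀ + 4 * R ^ 2 * δ := by
      rw [hsum]; exact add_le_add h1 (mul_le_mul_of_nonneg_left h2 hR2)
    exact absurd hω (not_lt.mpr hle)
  have hmeas : μ.real {ω | B₀ + 4 * R ^ 2 * δ < ∑ i ∈ range n, V i ω} ≤
      μ.real E₁ + δ⁻¹ * ∑ i ∈ range n, μ.real (D i)ᶜ :=
    calc μ.real {ω | B₀ + 4 * R ^ 2 * δ < ∑ i ∈ range n, V i ω}
        ≤ μ.real (E₁ ∪ E₂) := measureReal_mono hsub (measure_ne_top μ _)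
      _ ≤ μ.real E₁ + μ.real E₂ := measureReal_union_le _ _
      _ ≤ μ.real E₁ + δ⁻¹ * ∑ i ∈ range n, μ.real (D i)ᶜ :=
          add_le_add le_rfl (measureReal_lt_sum_condExp_indicator_le hFle n hD hδ)
  have h1 : Cg * μ.real {ω | B₀ + 4 * R ^ 2 * δ < ∑ i ∈ range n, V i ω} ≤
      Cg * (μ.real E₁ + δ⁻¹ * ∑ i ∈ range n, μ.real (D i)ᶜ) := mul_le_mul_of_nonneg_left hmeas hCg
  have h2 := mul_le_mul_of_nonneg_left h1 (Real.exp_pos (|t| * R)).le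
  exact add_le_add le_rfl h2


/-! ### §4b  The tails by FIRST MOMENTS; predictable domains charged once -/

/-- [folklore] **THE INTEGRATED BOUND WITH THE TAIL BY FIRST MOMENTS.**  `integral_mul_exp_le_of_varProxy` with its
budget tail estimated by Markov (`measureReal_lt_sum_le_inv_mul_sum_integral`): for `|t|·2R ≤ 1`, `B > 0` and bounded
`g ≥ 0` measurable at the endpoint,
`∫ g e^{tf} ≤ e^{t²B} ∫ g e^{t·μ[f∣F n]} + e^{|t|R}·Cg·B⁻¹·Σ_{i<n} ∫ V i dμ`.
All that is asked of the geometry is the SUM OF THE EXPECTED PROXIES under `μ` (header (MI-1‴)). -/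
theorem integral_mul_exp_le_of_varProxy_moments {F : ℕ → MeasurableSpace Ω} (hF : Antitone F)
    (hFle : ∀ j, F j ≤ mΩ) {f : Ω → ℝ} (hf0 : StronglyMeasurable[F 0] f) {R : ℝ} (hfR : ∀ ω, |f ω| ≤ R)
    (n : ℕ) {V : ℕ → Ω → ℝ} {Vmax : ℝ} (hVm : ∀ i < n, StronglyMeasurable[F (i + 1)] (V i))
    (hVb : ∀ i < n, ∀ᵐ ω ∂μ, |V i ω| ≤ Vmax) (hV : IncrementVarProxy μ F f n V) {t : ℝ}
    (ht : |t| * (2 * R) ≤ 1) {B : ℝ} (hB : 0 < B) {g : Ω → ℝ} (hg : StronglyMeasurable[F n] g)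
    (hg0 : ∀ ω, 0 ≤ g ω) {Cg : ℝ} (hCg : 0 ≤ Cg) (hgC : ∀ ω, g ω ≤ Cg) :
    ∫ ω, g ω * Real.exp (t * f ω) ∂μ ≤
      Real.exp (t ^ 2 * B) * ∫ ω, g ω * Real.exp (t * μ[f | F n] ω) ∂μ +
        Real.exp (|t| * R) * (Cg * (B⁻¹ * ∑ i ∈ range n, ∫ ω, V i ω ∂μ)) := by
  have hmain := integral_mul_exp_le_of_varProxy hF hFle hf0 hfR n hVm hVb hV ht B hg hg0 hgC
  have htail := measureReal_lt_sum_le_inv_mul_sum_integral (μ := μ) hFle n hVm hVb hV.ae_nonneg hB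
  have h1 := mul_le_mul_of_nonneg_left htail hCg
  have h2 := mul_le_mul_of_nonneg_left h1 (Real.exp_pos (|t| * R)).le
  exact hmain.trans (add_le_add le_rfl h2)

/-- [folklore] **END-TO-END FORM WITH PREDICTABLE DOMAINS — the bad geometry is charged ONCE.**  Data as in
`integral_mul_exp_le_of_domainSplit` but with domains `D i ∈ F (i+1)` (§3c).  For `|t|·2R ≤ 1` and bounded `g ≥ 0`
measurable at the endpoint:
`∫ g e^{tf} ≤ e^{t²B₀} ∫ g e^{t·μ[f∣F n]} + e^{|t|R}·Cg·( μ{B₀ < Σ (c i)²} + μ(⋃_{i<n} (D i)ᶜ) )` —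
no `δ`, no `4R²δ` in the exponent, and the domain failures enter through ONE UNCONDITIONAL EVENT of the path law
(not summed over events): the form in which a single bad configuration of the future geometry, on which arbitrarily
many events fail at once, costs its probability once. -/
theorem integral_mul_exp_le_of_predictableDomainSplit {F : ℕ → MeasurableSpace Ω} (hF : Antitone F)
    (hFle : ∀ j, F j ≤ mΩ) {f : Ω → ℝ} (hf0 : StronglyMeasurable[F 0] f) {R : ℝ} (hfR : ∀ ω, |f ω| ≤ R)
    (n : ℕ) {Z : ℕ → Ω → ℝ} (hZm : ∀ i < n, StronglyMeasurable[F (i + 1)] (Z i))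
    (hZb : ∀ i < n, ∀ ω, |Z i ω| ≤ R) {D : ℕ → Set Ω} (hD : ∀ i < n, MeasurableSet[F (i + 1)] (D i))
    {c : ℕ → Ω → ℝ} {cmax : ℝ} (hcm : ∀ i < n, StronglyMeasurable[F (i + 1)] (c i))
    (hcb : ∀ i < n, ∀ ω, |c i ω| ≤ cmax)
    (hdom : ∀ i < n, ∀ᵐ ω ∂μ, ω ∈ D i → |μ[f | F i] ω - Z i ω| ≤ c i ω) {t : ℝ}
    (ht : |t| * (2 * R) ≤ 1) (B₀ : ℝ) {g : Ω → ℝ} (hg : StronglyMeasurable[F n] g)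
    (hg0 : ∀ ω, 0 ≤ g ω) {Cg : ℝ} (hCg : 0 ≤ Cg) (hgC : ∀ ω, g ω ≤ Cg) :
    ∫ ω, g ω * Real.exp (t * f ω) ∂μ ≤
      Real.exp (t ^ 2 * B₀) * ∫ ω, g ω * Real.exp (t * μ[f | F n] ω) ∂μ +
        Real.exp (|t| * R) * (Cg * (μ.real {ω | B₀ < ∑ i ∈ range n, c i ω ^ 2} +
          μ.real (⋃ i ∈ range n, (D i)ᶜ))) := by
  set V : ℕ → Ω → ℝ := fun i ω => c i ω ^ 2 + 4 * R ^ 2 * (D i)ᶜ.indicator (fun _ => (1 : ℝ)) ω with hV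
  have hVP : IncrementVarProxy μ F f n V :=
    incrementVarProxy_of_predictableDomainSplit hF hFle hfR n hZm hZb hD hcm hcb hdom
  have hVm := stronglyMeasurable_predictableDomainSplitProxy (F := F) (R := R) n hD hcm
  have hVb : ∀ i < n, ∀ᵐ ω ∂μ, |V i ω| ≤ cmax ^ 2 + 4 * R ^ 2 := fun i hi =>
    ae_of_all μ (abs_predictableDomainSplitProxy_le (R := R) n D hcb i hi)
  have hmain := integral_mul_exp_le_of_varProxy hF hFle hf0 hfR n hVm hVb hVP ht B₀ hg hg0 hgC
  refine hmain.trans ?_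
  set E₁ : Set Ω := {ω | B₀ < ∑ i ∈ range n, c i ω ^ 2} with hE₁
  set E₂ : Set Ω := ⋃ i ∈ range n, (D i)ᶜ with hE₂
  have hsub : {ω | B₀ < ∑ i ∈ range n, V i ω} ⊆ E₁ ∪ E₂ := by
    intro ω hω
    by_cases h2 : ω ∈ E₂
    · exact Or.inr h2
    left
    -- off `E₂` every indicator vanishes, so `Σ V i ω = Σ (c i ω)²`
    have hzero : ∀ i ∈ range n, (D i)ᶜ.indicator (fun _ => (1 : ℝ)) ω = 0 := by
      intro i hi
      have hωi : ω ∉ (D i)ᶜ := fun hmem => h2 (Set.mem_iUnion₂.mpr ⟨i, hi, hmem⟩)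
      exact Set.indicator_of_notMem hωi _
    have hsum : ∑ i ∈ range n, V i ω = ∑ i ∈ range n, c i ω ^ 2 :=
      Finset.sum_congr rfl fun i hi => by simp only [hV, hzero i hi, mul_zero, add_zero]
    show B₀ < ∑ i ∈ range n, c i ω ^ 2
    rw [← hsum]; exact hω
  have hmeas : μ.real {ω | B₀ < ∑ i ∈ range n, V i ω} ≤ μ.real E₁ + μ.real E₂ :=
    (measureReal_mono hsub (measure_ne_top μ _)).trans (measureReal_union_le _ _)
  have h1 := mul_le_mul_of_nonneg_left hmeas hCg
  have h2 := mul_le_mul_of_nonneg_left h1 (Real.exp_pos (|t| * R)).le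
  exact add_le_add le_rfl h2

/-- [folklore] **… AND WITH THE GEOMETRIC TAIL BY FIRST MOMENTS.**  Same data; the geometric bad event
`{B₀ < Σ (c i)²}` estimated by Markov: for `B₀ > 0`,
`∫ g e^{tf} ≤ e^{t²B₀} ∫ g e^{t·μ[f∣F n]} + e^{|t|R}·Cg·( B₀⁻¹·Σ_{i<n} ∫ (c i)² dμ + μ(⋃_{i<n} (D i)ᶜ) )`.
What is asked of the geometry: the SUM OVER EVENTS OF THE EXPECTED SQUARED RADII under the undressed path law
(header (MI-1‴)) and the probability of ONE predictable bad event (header (MI-2″)). -/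
theorem integral_mul_exp_le_of_predictableDomainSplit_moments {F : ℕ → MeasurableSpace Ω} (hF : Antitone F)
    (hFle : ∀ j, F j ≤ mΩ) {f : Ω → ℝ} (hf0 : StronglyMeasurable[F 0] f) {R : ℝ} (hfR : ∀ ω, |f ω| ≤ R)
    (n : ℕ) {Z : ℕ → Ω → ℝ} (hZm : ∀ i < n, StronglyMeasurable[F (i + 1)] (Z i))
    (hZb : ∀ i < n, ∀ ω, |Z i ω| ≤ R) {D : ℕ → Set Ω} (hD : ∀ i < n, MeasurableSet[F (i + 1)] (D i))
    {c : ℕ → Ω → ℝ} {cmax : ℝ} (hcm : ∀ i < n, StronglyMeasurable[F (i + 1)] (c i))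
    (hcb : ∀ i < n, ∀ ω, |c i ω| ≤ cmax)
    (hdom : ∀ i < n, ∀ᵐ ω ∂μ, ω ∈ D i → |μ[f | F i] ω - Z i ω| ≤ c i ω) {t : ℝ}
    (ht : |t| * (2 * R) ≤ 1) {B₀ : ℝ} (hB₀ : 0 < B₀) {g : Ω → ℝ} (hg : StronglyMeasurable[F n] g)
    (hg0 : ∀ ω, 0 ≤ g ω) {Cg : ℝ} (hCg : 0 ≤ Cg) (hgC : ∀ ω, g ω ≤ Cg) :
    ∫ ω, g ω * Real.exp (t * f ω) ∂μ ≤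
      Real.exp (t ^ 2 * B₀) * ∫ ω, g ω * Real.exp (t * μ[f | F n] ω) ∂μ +
        Real.exp (|t| * R) * (Cg * (B₀⁻¹ * ∑ i ∈ range n, ∫ ω, c i ω ^ 2 ∂μ +
          μ.real (⋃ i ∈ range n, (D i)ᶜ))) := by
  have hmain := integral_mul_exp_le_of_predictableDomainSplit hF hFle hf0 hfR n hZm hZb hD hcm hcb hdom ht
    B₀ hg hg0 hCg hgC
  have hc2m : ∀ i < n, StronglyMeasurable[F (i + 1)] (fun ω => c i ω ^ 2) := fun i hi => (hcm i hi).pow 2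
  have hc2b : ∀ i < n, ∀ᵐ ω ∂μ, |c i ω ^ 2| ≤ cmax ^ 2 := fun i hi => ae_of_all μ fun ω => by
    rw [abs_of_nonneg (sq_nonneg _)]
    calc c i ω ^ 2 = |c i ω| ^ 2 := (sq_abs _).symm
      _ ≤ cmax ^ 2 := pow_le_pow_left₀ (abs_nonneg _) (hcb i hi ω) 2
  have hc20 : ∀ i < n, ∀ᵐ ω ∂μ, 0 ≤ c i ω ^ 2 := fun i _ => ae_of_all μ fun ω => sq_nonneg _
  have htail := measureReal_lt_sum_le_inv_mul_sum_integral (μ := μ) hFle n hc2m hc2b hc20 hB₀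
  have h0 : μ.real {ω | B₀ < ∑ i ∈ range n, c i ω ^ 2} + μ.real (⋃ i ∈ range n, (D i)ᶜ) ≤
      B₀⁻¹ * ∑ i ∈ range n, ∫ ω, c i ω ^ 2 ∂μ + μ.real (⋃ i ∈ range n, (D i)ᶜ) :=
    add_le_add htail le_rfl
  have h1 := mul_le_mul_of_nonneg_left h0 hCg
  have h2 := mul_le_mul_of_nonneg_left h1 (Real.exp_pos (|t| * R)).le
  exact hmain.trans (add_le_add le_rfl h2)

end Coupling

/-! ## §5  K-uniform arithmetic of the fluctuation budget `Σσ²` with WORST-CASE counts -/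

section Budget

variable {ι : Type*}

/-- [folklore] **AN AGE-PROFILED BUDGET IS K-UNIFORM.**  Index real weights `w e` by events `e ∈ s` with an AGE
`lvl e` (number of remaining scales); if at most `N₀Λ^n` events have age `n` and an event of age `n` has
`w e ≤ A(n+1)^q(θ²)^n`, then for `Λθ² < 1`: `Σ_{e∈s} w e ≤ N₀·A·C_q(Λθ²)` with `C_q = T4TubeBudget.geomPolyConst q` —
no `K`, no weights `e^{−p₀}`, no tube budget.  (Ages may be bounded by any `K`; the bound does not see it.)  Used with
`w = σ²` (Hoeffding form, `sqBudget_le`) and with `w = v` (variance form). -/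
theorem budget_le [DecidableEq ι] (s : Finset ι) (lvl : ι → ℕ) (w : ι → ℝ) {N₀ A Λ θ : ℝ} {q K : ℕ}
    (hN₀ : 0 ≤ N₀) (hA : 0 ≤ A) (hΛ : 0 ≤ Λ) (hr : Λ * θ ^ 2 < 1) (hlvl : ∀ e ∈ s, lvl e < K)
    (hcard : ∀ n < K, ((s.filter fun e => lvl e = n).card : ℝ) ≤ N₀ * Λ ^ n)
    (hw : ∀ e ∈ s, w e ≤ A * ((lvl e : ℝ) + 1) ^ q * (θ ^ 2) ^ lvl e) :
    ∑ e ∈ s, w e ≤ N₀ * A * geomPolyConst q (Λ * θ ^ 2) := by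
  have hx0 : 0 ≤ Λ * θ ^ 2 := mul_nonneg hΛ (sq_nonneg θ)
  -- fibre the sum over ages
  have hfib : ∑ e ∈ s, w e = ∑ n ∈ range K, ∑ e ∈ s.filter (fun e => lvl e = n), w e := by
    rw [← sum_fiberwise_of_maps_to (g := lvl) (t := range K) (fun e he => mem_range.mpr (hlvl e he))]
  rw [hfib]
  -- per age: count × size
  have hage : ∀ n ∈ range K, ∑ e ∈ s.filter (fun e => lvl e = n), w e ≤
      N₀ * A * (((n : ℝ) + 1) ^ q * (Λ * θ ^ 2) ^ n) := by
    intro n hn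
    have hn' := mem_range.mp hn
    calc ∑ e ∈ s.filter (fun e => lvl e = n), w e
        ≤ ∑ e ∈ s.filter (fun e => lvl e = n), A * ((n : ℝ) + 1) ^ q * (θ ^ 2) ^ n := by
          refine sum_le_sum fun e he => ?_
          obtain ⟨hes, hen⟩ := mem_filter.mp he
          have h := hw e hes
          rwa [hen] at h
      _ = ((s.filter fun e => lvl e = n).card : ℝ) * (A * ((n : ℝ) + 1) ^ q * (θ ^ 2) ^ n) := by
          rw [sum_const, nsmul_eq_mul]
      _ ≤ N₀ * Λ ^ n * (A * ((n : ℝ) + 1) ^ q * (θ ^ 2) ^ n) :=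
          mul_le_mul_of_nonneg_right (hcard n hn') (by positivity)
      _ = N₀ * A * (((n : ℝ) + 1) ^ q * (Λ * θ ^ 2) ^ n) := by rw [mul_pow]; ring
  calc ∑ n ∈ range K, ∑ e ∈ s.filter (fun e => lvl e = n), w e
      ≤ ∑ n ∈ range K, N₀ * A * (((n : ℝ) + 1) ^ q * (Λ * θ ^ 2) ^ n) := sum_le_sum hage
    _ = N₀ * A * ∑ n ∈ range K, ((n : ℝ) + 1) ^ q * (Λ * θ ^ 2) ^ n := by rw [mul_sum]
    _ ≤ N₀ * A * geomPolyConst q (Λ * θ ^ 2) := by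
        refine mul_le_mul_of_nonneg_left ?_ (mul_nonneg hN₀ hA)
        exact (T4CauchySum.summable_succ_pow_mul_geometric hx0 hr q).sum_le_tsum (range K)
          fun m _ => by positivity

/-- [folklore] **THE ℓ² BUDGET IS K-UNIFORM** (`budget_le` with `w = σ²`): at most `N₀Λ^n` events of age `n`, each with
`σ_e² ≤ A(n+1)^q(θ²)^n`, `Λθ² < 1` ⇒ `Σ_{e∈s} σ_e² ≤ N₀·A·C_q(Λθ²)`. -/
theorem sqBudget_le [DecidableEq ι] (s : Finset ι) (lvl : ι → ℕ) (σ : ι → ℝ) {N₀ A Λ θ : ℝ} {q K : ℕ}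
    (hN₀ : 0 ≤ N₀) (hA : 0 ≤ A) (hΛ : 0 ≤ Λ) (hr : Λ * θ ^ 2 < 1) (hlvl : ∀ e ∈ s, lvl e < K)
    (hcard : ∀ n < K, ((s.filter fun e => lvl e = n).card : ℝ) ≤ N₀ * Λ ^ n)
    (hσ : ∀ e ∈ s, σ e ^ 2 ≤ A * ((lvl e : ℝ) + 1) ^ q * (θ ^ 2) ^ lvl e) :
    ∑ e ∈ s, σ e ^ 2 ≤ N₀ * A * geomPolyConst q (Λ * θ ^ 2) :=
  budget_le s lvl (fun e => σ e ^ 2) hN₀ hA hΛ hr hlvl hcard hσ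

/-- [folklore] (arithmetic) **THE NE1′ FLUCTUATION-CHANNEL RATIO**: with `Λ = L⁴` (worst-case growth of the number of scale-`k` cubes
under a unit loop tube per remaining scale, `d = 4`) and `θ = θ₁ = L^{-3}` (the certified one-step contraction of unit
loop pull-backs, `T4LoopPullback.theta1_exact` with `d = 4`), `Λθ² = L^{-2} < 1` as soon as `2 ≤ L`. -/
theorem ne1p_sqRate_lt_one {L : ℝ} (hL : 2 ≤ L) : L ^ 4 * (L⁻¹ ^ 3) ^ 2 < 1 := by
  have hL0 : 0 < L := by linarith
  have h : L ^ 4 * (L⁻¹ ^ 3) ^ 2 = (L ^ 2)⁻¹ := by field_simp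
  rw [h]
  have h4 : (1 : ℝ) < L ^ 2 := by nlinarith
  exact inv_lt_one_of_one_lt₀ h4

/-- [folklore] (arithmetic) **THE NE1′ MEAN-CHANNEL RATIO** (header (A2); the channel itself is NOT bounded in this module): with the
same count `Λ = L⁴`, `θ₁ = L^{-3}` and the extra first-order factor `φ = L^{-2}`, `Λθ₁φ = L^{-1} < 1` for `2 ≤ L`
(cf. `T4TubeBudget.tubeBudget_of_sqRate`, conditions `L⁴θ₁² ≤ 1`, `L⁴θ₁φ ≤ 1`). -/
theorem ne1p_meanRate_lt_one {L : ℝ} (hL : 2 ≤ L) : L ^ 4 * (L⁻¹ ^ 3 * L⁻¹ ^ 2) < 1 := by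
  have hL0 : 0 < L := by linarith
  have h : L ^ 4 * (L⁻¹ ^ 3 * L⁻¹ ^ 2) = L⁻¹ := by field_simp
  rw [h]
  exact inv_lt_one_of_one_lt₀ (by linarith)

/-- [folklore] **THE K-UNIFORM FLUCTUATION BUDGET OF NE1′ (assembled shape).**  Under (AZ) with an event-indexed
increment bound whose squares obey the age profile of `sqBudget_le`, the fluctuation channel of the dressing factor is
bounded by `½t²·N₀·A·C_q(Λθ²)` a.e., a constant seeing neither `K` nor the couplings `g_k`. (Pure composition of §3
and §5: the event-indexed family is read along the filtration index `i < n` through ANY enumeration `ev` of the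
events; only `Σ_{i<n} σ(ev i)² = Σ_{e∈s} σ_e²` is used.) -/
theorem fluctuationChannel_le_uniform {Ω : Type*} {mΩ : MeasurableSpace Ω} {μ : Measure Ω} [IsFiniteMeasure μ]
    {F : ℕ → MeasurableSpace Ω} (hF : Antitone F) (hFle : ∀ j, F j ≤ mΩ) {f : Ω → ℝ}
    (hf0 : StronglyMeasurable[F 0] f) {R : ℝ} (hfR : ∀ ω, |f ω| ≤ R) (n : ℕ) {τ : ℕ → ℝ}
    (hτ : IncrementBound μ F f n τ) {B : ℝ} (hB : ∑ i ∈ range n, τ i ^ 2 ≤ B) (t : ℝ) :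
    ∀ᵐ ω ∂μ, 0 ≤ Real.log (μ[fun ω => Real.exp (t * f ω) | F n] ω) - t * μ[f | F n] ω ∧
      Real.log (μ[fun ω => Real.exp (t * f ω) | F n] ω) - t * μ[f | F n] ω ≤ t ^ 2 * B / 2 := by
  filter_upwards [log_dressingFactor_sub_mean_mem hF hFle hf0 hfR n hτ t] with ω hω
  refine ⟨hω.2.1, hω.2.2.trans ?_⟩
  have ht2 : 0 ≤ t ^ 2 := sq_nonneg t
  have := mul_le_mul_of_nonneg_left hB ht2
  linarith

/-- [folklore] **THE K-UNIFORM FLUCTUATION BUDGET OF NE1′, variance form.**  Under `IncrementVarBound μ F f n v`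
with `Σ_{i<n} v i ≤ B` and `|t|·2R ≤ 1`: a.e. the dressing factor is positive and
`0 ≤ log μ[exp(t f) ∣ F n] − t·μ[f ∣ F n] ≤ t²·B` — the budget `B` is fed by `budget_le` with `w = v`. -/
theorem fluctuationChannel_le_uniform_of_condVar {Ω : Type*} {mΩ : MeasurableSpace Ω} {μ : Measure Ω}
    [IsFiniteMeasure μ] {F : ℕ → MeasurableSpace Ω} (hF : Antitone F) (hFle : ∀ j, F j ≤ mΩ) {f : Ω → ℝ}
    (hf0 : StronglyMeasurable[F 0] f) {R : ℝ} (hfR : ∀ ω, |f ω| ≤ R) (n : ℕ) {v : ℕ → ℝ}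
    (hv : IncrementVarBound μ F f n v) {B : ℝ} (hB : ∑ i ∈ range n, v i ≤ B) {t : ℝ}
    (ht : |t| * (2 * R) ≤ 1) :
    ∀ᵐ ω ∂μ, 0 < μ[fun ω => Real.exp (t * f ω) | F n] ω ∧
      0 ≤ Real.log (μ[fun ω => Real.exp (t * f ω) | F n] ω) - t * μ[f | F n] ω ∧
      Real.log (μ[fun ω => Real.exp (t * f ω) | F n] ω) - t * μ[f | F n] ω ≤ t ^ 2 * B := by
  obtain ⟨hlo, hhi⟩ := condExp_exp_dressing_sandwich_of_condVar hF hFle hf0 hfR n hv ht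
  filter_upwards [hlo, hhi] with ω h1 h2
  have hpos : 0 < μ[fun ω => Real.exp (t * f ω) | F n] ω := lt_of_lt_of_le (Real.exp_pos _) h1
  refine ⟨hpos, ?_, ?_⟩
  · have := Real.log_le_log (Real.exp_pos _) h1
    rw [Real.log_exp] at this; linarith
  · have := Real.log_le_log hpos h2
    rw [Real.log_mul (Real.exp_pos _).ne' (Real.exp_pos _).ne', Real.log_exp, Real.log_exp] at this
    have ht2 : 0 ≤ t ^ 2 := sq_nonneg t
    have := mul_le_mul_of_nonneg_left hB ht2
    linarith


/-! ### §5b  LEVEL FIRST MOMENTS: the K-uniform end-to-end form -/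

/-- [folklore] **A LEVEL-PROFILED FIRST-MOMENT BUDGET IS K-UNIFORM.**  Index real weights `w i`, `i < n` (in the cell's
use: `w i = ∫ V i dμ`, the expected proxy of event `i`) by levels `lvl i < K`; if the per-LEVEL sums obey
`Σ_{i<n, lvl i = m} w i ≤ A·(m+1)^q·r^m` with `0 ≤ r < 1`, then `Σ_{i<n} w i ≤ A·C_q(r)`,
`C_q = T4TubeBudget.geomPolyConst q` — no `n`, no `K`.  (The per-level profile is where (MI-1‴) enters: the expected
NUMBER of events at a deep level is unbounded in `K`; only the rate `r^m = (L⁴θ₁²)^m` carried by each expected proxy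
makes the profile summable — header (MI).) -/
theorem levelSum_le (n : ℕ) (lvl : ℕ → ℕ) (w : ℕ → ℝ) {A r : ℝ} {q K : ℕ} (hA : 0 ≤ A) (hr0 : 0 ≤ r)
    (hr1 : r < 1) (hlvl : ∀ i < n, lvl i < K)
    (hlev : ∀ m < K, ∑ i ∈ (range n).filter (fun i => lvl i = m), w i ≤ A * ((m : ℝ) + 1) ^ q * r ^ m) :
    ∑ i ∈ range n, w i ≤ A * geomPolyConst q r := by
  have hfib : ∑ i ∈ range n, w i =
      ∑ m ∈ range K, ∑ i ∈ (range n).filter (fun i => lvl i = m), w i := by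
    rw [← sum_fiberwise_of_maps_to (g := lvl) (t := range K)
      (fun i hi => mem_range.mpr (hlvl i (mem_range.mp hi)))]
  rw [hfib]
  calc ∑ m ∈ range K, ∑ i ∈ (range n).filter (fun i => lvl i = m), w i
      ≤ ∑ m ∈ range K, A * ((m : ℝ) + 1) ^ q * r ^ m := sum_le_sum fun m hm => hlev m (mem_range.mp hm)
    _ = A * ∑ m ∈ range K, ((m : ℝ) + 1) ^ q * r ^ m := by
        rw [mul_sum]; exact sum_congr rfl fun m _ => by ring
    _ ≤ A * geomPolyConst q r := by
        refine mul_le_mul_of_nonneg_left ?_ hA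
        exact (T4CauchySum.summable_succ_pow_mul_geometric hr0 hr1 q).sum_le_tsum (range K)
          fun m _ => by positivity

/-- [folklore] **NE1′-SIZE, END-TO-END AND K-UNIFORM (first-moment channel).**  Hypotheses: the abstract coupling data
(antitone `F ≤ mΩ`, `f` bounded by `R` and `F 0`-measurable), predictable a.e.-bounded variance proxies `V i`
(`IncrementVarProxy`, §3), levels `lvl i < K` of the events, and the LEVEL FIRST-MOMENT PROFILE
`Σ_{i<n, lvl i = m} ∫ V i dμ ≤ A·(m+1)^q·r^m`, `0 ≤ r < 1` (header (MI-1‴): in the cell's dictionary `r = L⁴θ₁²`,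
`< 1` by `ne1p_sqRate_lt_one`).  Conclusion, for `|t|·2R ≤ 1`, `B > 0` and bounded `g ≥ 0` measurable at the endpoint:
`∫ g e^{tf} ≤ e^{t²B}·∫ g e^{t·μ[f∣F n]} + e^{|t|R}·Cg·B⁻¹·A·C_q(r)` — NOTHING on the right depends on the number of
events `n` or the number of steps `K`: DRESSED ≤ (UNDRESSED reweighted by the mean channel) × `e^{t²B}` + a uniform
remainder, `B` free (the lower companion is `integral_mul_exp_mean_le`).  This is the precise sense in which the
coupling technique reduces NE1′ to (MI-1″) + (MI-1‴) + the mean channel (MI-3); none of those is asserted here. -/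
theorem integral_mul_exp_le_uniform {Ω : Type*} {mΩ : MeasurableSpace Ω} {μ : Measure Ω} [IsFiniteMeasure μ]
    {F : ℕ → MeasurableSpace Ω} (hF : Antitone F) (hFle : ∀ j, F j ≤ mΩ) {f : Ω → ℝ}
    (hf0 : StronglyMeasurable[F 0] f) {R : ℝ} (hfR : ∀ ω, |f ω| ≤ R) (n : ℕ) {V : ℕ → Ω → ℝ} {Vmax : ℝ}
    (hVm : ∀ i < n, StronglyMeasurable[F (i + 1)] (V i)) (hVb : ∀ i < n, ∀ᵐ ω ∂μ, |V i ω| ≤ Vmax)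
    (hV : IncrementVarProxy μ F f n V) (lvl : ℕ → ℕ) {A r : ℝ} {q K : ℕ} (hA : 0 ≤ A) (hr0 : 0 ≤ r)
    (hr1 : r < 1) (hlvl : ∀ i < n, lvl i < K)
    (hlev : ∀ m < K, ∑ i ∈ (range n).filter (fun i => lvl i = m), ∫ ω, V i ω ∂μ ≤
      A * ((m : ℝ) + 1) ^ q * r ^ m)
    {t : ℝ} (ht : |t| * (2 * R) ≤ 1) {B : ℝ} (hB : 0 < B) {g : Ω → ℝ} (hg : StronglyMeasurable[F n] g)
    (hg0 : ∀ ω, 0 ≤ g ω) {Cg : ℝ} (hCg : 0 ≤ Cg) (hgC : ∀ ω, g ω ≤ Cg) :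
    ∫ ω, g ω * Real.exp (t * f ω) ∂μ ≤
      Real.exp (t ^ 2 * B) * ∫ ω, g ω * Real.exp (t * μ[f | F n] ω) ∂μ +
        Real.exp (|t| * R) * (Cg * (B⁻¹ * (A * geomPolyConst q r))) := by
  have hmain := integral_mul_exp_le_of_varProxy_moments hF hFle hf0 hfR n hVm hVb hV ht hB hg hg0 hCg hgC
  have hsum := levelSum_le n lvl (fun i => ∫ ω, V i ω ∂μ) hA hr0 hr1 hlvl hlev
  have h1 := mul_le_mul_of_nonneg_left hsum (inv_pos.mpr hB).le
  have h2 := mul_le_mul_of_nonneg_left h1 hCg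
  have h3 := mul_le_mul_of_nonneg_left h2 (Real.exp_pos (|t| * R)).le
  exact hmain.trans (add_le_add le_rfl h3)

/-- [folklore] The same with the cell's rate `r = L⁴θ₁²`, `θ₁ = L⁻³` (`T4LoopPullback.theta1_exact`), `2 ≤ L`:
the hypothesis `r < 1` of `integral_mul_exp_le_uniform` is discharged by `ne1p_sqRate_lt_one`, and `0 ≤ r` here. -/
theorem ne1p_sqRate_nonneg {L : ℝ} (hL : 2 ≤ L) : 0 ≤ L ^ 4 * (L⁻¹ ^ 3) ^ 2 := by
  have hL0 : 0 < L := by linarith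
  positivity


/-- [folklore] **NE1′-SIZE, END-TO-END AND K-UNIFORM — SLOT FORM (worst-case counts × per-slot expected proxies).**
Index the increments by SLOTS `i < n` (in the cell's use: one slot per (level, tube cube) and per T-block; the proxy
of a slot at which no resampling event occurs is `0`), with levels `lvl i < K`, at most `N₀·Λ^m` slots of level `m`
(`Λ = L⁴`: the tube cubes one level down) and PER-SLOT EXPECTED PROXIES `∫ V i dμ ≤ A·(lvl i + 1)^q·(θ²)^{lvl i}`
(`θ = θ₁ = L⁻³`; header (MI-F1)/(MI-F2): `A` = (per-event radius constant)² × the irregular-nesting moment).  If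
`Λθ² < 1` then, for `|t|·2R ≤ 1`, every `B > 0` and bounded `g ≥ 0` measurable at the endpoint,
`∫ g e^{tf} ≤ e^{t²B}·∫ g e^{t·μ[f∣F n]} + e^{|t|R}·Cg·B⁻¹·N₀·A·C_q(Λθ²)` — the WORST-CASE count is affordable because
every expected proxy carries `θ^{2·lvl}` (`budget_le` + `integral_mul_exp_le_of_varProxy_moments`); no `n`, no `K`. -/
theorem integral_mul_exp_le_uniform_of_slots {Ω : Type*} {mΩ : MeasurableSpace Ω} {μ : Measure Ω}
    [IsFiniteMeasure μ] {F : ℕ → MeasurableSpace Ω} (hF : Antitone F) (hFle : ∀ j, F j ≤ mΩ) {f : Ω → ℝ}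
    (hf0 : StronglyMeasurable[F 0] f) {R : ℝ} (hfR : ∀ ω, |f ω| ≤ R) (n : ℕ) {V : ℕ → Ω → ℝ} {Vmax : ℝ}
    (hVm : ∀ i < n, StronglyMeasurable[F (i + 1)] (V i)) (hVb : ∀ i < n, ∀ᵐ ω ∂μ, |V i ω| ≤ Vmax)
    (hV : IncrementVarProxy μ F f n V) (lvl : ℕ → ℕ) {N₀ A Λ θ : ℝ} {q K : ℕ} (hN₀ : 0 ≤ N₀) (hA : 0 ≤ A)
    (hΛ : 0 ≤ Λ) (hr : Λ * θ ^ 2 < 1) (hlvl : ∀ i < n, lvl i < K)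
    (hcard : ∀ m < K, (((range n).filter fun i => lvl i = m).card : ℝ) ≤ N₀ * Λ ^ m)
    (hw : ∀ i < n, ∫ ω, V i ω ∂μ ≤ A * ((lvl i : ℝ) + 1) ^ q * (θ ^ 2) ^ lvl i)
    {t : ℝ} (ht : |t| * (2 * R) ≤ 1) {B : ℝ} (hB : 0 < B) {g : Ω → ℝ} (hg : StronglyMeasurable[F n] g)
    (hg0 : ∀ ω, 0 ≤ g ω) {Cg : ℝ} (hCg : 0 ≤ Cg) (hgC : ∀ ω, g ω ≤ Cg) :
    ∫ ω, g ω * Real.exp (t * f ω) ∂μ ≤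
      Real.exp (t ^ 2 * B) * ∫ ω, g ω * Real.exp (t * μ[f | F n] ω) ∂μ +
        Real.exp (|t| * R) * (Cg * (B⁻¹ * (N₀ * A * geomPolyConst q (Λ * θ ^ 2)))) := by
  have hmain := integral_mul_exp_le_of_varProxy_moments hF hFle hf0 hfR n hVm hVb hV ht hB hg hg0 hCg hgC
  have hsum := budget_le (range n) lvl (fun i => ∫ ω, V i ω ∂μ) hN₀ hA hΛ hr
    (fun i hi => hlvl i (mem_range.mp hi)) hcard (fun i hi => hw i (mem_range.mp hi))
  have h1 := mul_le_mul_of_nonneg_left hsum (inv_pos.mpr hB).le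
  have h2 := mul_le_mul_of_nonneg_left h1 hCg
  have h3 := mul_le_mul_of_nonneg_left h2 (Real.exp_pos (|t| * R)).le
  exact hmain.trans (add_le_add le_rfl h3)


/-! ### §5c  Irregular-nesting moments from multi-level domination (v7; header (MI-F2))

Pure finite probability: if a finite family of events `A j`, `j ∈ J` (in the cell's use — header (MI-F2′) — the
ELEMENTARY large-field CREATION events at the (level, place) pairs `j` within reach of a fixed tube cube's nested boxes;
NOT «the level-`j` block is irregular», which persists across levels) is DOMINATED BY PRODUCTS —
`μ(⋂_{j∈S} A j) ≤ μ(Ω)·∏_{j∈S} ε j` for every `S ⊆ J` — then the exponential moment of the COUNT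
`N(ω) = #{j ∈ J : ω ∈ A j}` obeys `∫ κ^N dμ ≤ μ(Ω)·∏_{j∈J}(1 + (κ−1)ε j) ≤ μ(Ω)·exp((κ−1)Σ_{j∈J} ε j)` for `κ ≥ 1`
(expand `κ^N = ∏_j (1 + (κ−1)1_{A j})` over subsets).  This is the kernel form of the reduction stated in (MI-F2)/
(MI-F2′): since `irr ≤ N_life·N` (each created region keeps the nested blocks irregular for at most its lifetime), the
irregular-nesting moment `sup_{k,c} ∫ κ^{2·irr_k(c)} dμ ≤ A′` FOLLOWS (with `κ^{2N_life}` for `κ`) from creation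
probabilities dominated by products with `Σ_j ε_j` bounded uniformly in `K` — the currency of the printed inductive
large-field bounds (located, NOT re-read, NOT proved here; CONDITIONAL on (B) there). -/

variable {Ω : Type*} {mΩ : MeasurableSpace Ω} {μ : Measure Ω} [IsFiniteMeasure μ]

open scoped Classical in
/-- [folklore] Pointwise: `∏_{j∈J} (1 + a·1_{A j}(ω)) = (1 + a)^{#{j ∈ J : ω ∈ A j}}`. -/
theorem prod_one_add_mul_indicator_eq_pow (J : Finset ι) (A : ι → Set Ω) (a : ℝ) (ω : Ω) :
    ∏ j ∈ J, (1 + a * (A j).indicator (fun _ => (1 : ℝ)) ω) = (1 + a) ^ (J.filter fun j => ω ∈ A j).card := by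
  rw [← Finset.prod_const, Finset.prod_filter]
  refine Finset.prod_congr rfl fun j _ => ?_
  by_cases h : ω ∈ A j
  · simp only [Set.indicator_of_mem h, mul_one, if_pos h]
  · simp only [Set.indicator_of_notMem h, mul_zero, add_zero, if_neg h]

open scoped Classical in
/-- [folklore] Pointwise subset expansion: `κ^{#{j ∈ J : ω ∈ A j}} = Σ_{S ⊆ J} (κ−1)^{|S|}·1_{⋂_{j∈S} A j}(ω)`. -/
theorem pow_card_filter_eq_sum_powerset (J : Finset ι) (A : ι → Set Ω) (κ : ℝ) (ω : Ω) :
    κ ^ (J.filter fun j => ω ∈ A j).card =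
      ∑ S ∈ J.powerset, (κ - 1) ^ S.card * (⋂ j ∈ S, A j).indicator (fun _ => (1 : ℝ)) ω := by
  have h1 := prod_one_add_mul_indicator_eq_pow J A (κ - 1) ω
  rw [show (1 : ℝ) + (κ - 1) = κ by ring] at h1
  rw [← h1, Finset.prod_one_add]
  refine Finset.sum_congr rfl fun S _ => ?_
  rw [Finset.prod_mul_distrib, Finset.prod_const]
  congr 1
  by_cases hω : ∀ j ∈ S, ω ∈ A j
  · rw [Set.indicator_of_mem (Set.mem_iInter₂.mpr hω)]
    exact Finset.prod_eq_one fun j hj => by rw [Set.indicator_of_mem (hω j hj)]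
  · push Not at hω
    obtain ⟨j, hj, hjω⟩ := hω
    rw [Set.indicator_of_notMem (fun h => hjω (Set.mem_iInter₂.mp h j hj))]
    exact Finset.prod_eq_zero hj (by rw [Set.indicator_of_notMem hjω])

open scoped Classical in
/-- [folklore] **EXPONENTIAL MOMENT OF A COUNT OF PRODUCT-DOMINATED EVENTS.**  If
`μ(⋂_{j∈S} A j) ≤ μ(Ω)·∏_{j∈S} ε j` for every `S ⊆ J`, then for `κ ≥ 1`,
`∫ κ^{#{j∈J : ω ∈ A j}} dμ ≤ μ(Ω)·∏_{j∈J}(1 + (κ−1)·ε j)`.  (MI-F2)'s reduction: the irregular-nesting moment of a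
tube cube is bounded by multi-level irregularity probabilities dominated by products. -/
theorem integral_pow_card_filter_le_prod (J : Finset ι) {A : ι → Set Ω} (hA : ∀ j ∈ J, MeasurableSet (A j))
    {ε : ι → ℝ} {κ : ℝ} (hκ : 1 ≤ κ)
    (hdom : ∀ S ⊆ J, μ.real (⋂ j ∈ S, A j) ≤ μ.real Set.univ * ∏ j ∈ S, ε j) :
    ∫ ω, κ ^ (J.filter fun j => ω ∈ A j).card ∂μ ≤ μ.real Set.univ * ∏ j ∈ J, (1 + (κ - 1) * ε j) := by
  have hmeasS : ∀ S ∈ J.powerset, MeasurableSet (⋂ j ∈ S, A j) := fun S hS =>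
    S.measurableSet_biInter fun j hj => hA j (Finset.mem_powerset.mp hS hj)
  simp_rw [pow_card_filter_eq_sum_powerset J A κ]
  rw [integral_finsetSum J.powerset fun S hS =>
    ((integrable_const (1 : ℝ)).indicator (hmeasS S hS)).const_mul ((κ - 1) ^ S.card)]
  calc ∑ S ∈ J.powerset, ∫ ω, (κ - 1) ^ S.card * (⋂ j ∈ S, A j).indicator (fun _ => (1 : ℝ)) ω ∂μ
      = ∑ S ∈ J.powerset, (κ - 1) ^ S.card * μ.real (⋂ j ∈ S, A j) := by
        refine Finset.sum_congr rfl fun S hS => ?_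
        rw [integral_const_mul, integral_indicator_const (1 : ℝ) (hmeasS S hS), smul_eq_mul, mul_one]
    _ ≤ ∑ S ∈ J.powerset, (κ - 1) ^ S.card * (μ.real Set.univ * ∏ j ∈ S, ε j) :=
        Finset.sum_le_sum fun S hS => mul_le_mul_of_nonneg_left (hdom S (Finset.mem_powerset.mp hS))
          (pow_nonneg (sub_nonneg.mpr hκ) _)
    _ = μ.real Set.univ * ∏ j ∈ J, (1 + (κ - 1) * ε j) := by
        rw [Finset.prod_one_add, Finset.mul_sum]
        refine Finset.sum_congr rfl fun S _ => ?_
        rw [Finset.prod_mul_distrib, Finset.prod_const]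
        ring

open scoped Classical in
/-- [folklore] Same, in the exponential form used in (MI-F2): with `ε j ≥ 0` on `J`,
`∫ κ^{#{j∈J : ω ∈ A j}} dμ ≤ μ(Ω)·exp((κ−1)·Σ_{j∈J} ε j)` — K-UNIFORM as soon as `Σ_j ε_j` is (the multi-level
large-field suppressions being summable along the levels). -/
theorem integral_pow_card_filter_le_exp (J : Finset ι) {A : ι → Set Ω} (hA : ∀ j ∈ J, MeasurableSet (A j))
    {ε : ι → ℝ} (hε : ∀ j ∈ J, 0 ≤ ε j) {κ : ℝ} (hκ : 1 ≤ κ)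
    (hdom : ∀ S ⊆ J, μ.real (⋂ j ∈ S, A j) ≤ μ.real Set.univ * ∏ j ∈ S, ε j) :
    ∫ ω, κ ^ (J.filter fun j => ω ∈ A j).card ∂μ ≤ μ.real Set.univ * Real.exp ((κ - 1) * ∑ j ∈ J, ε j) := by
  refine (integral_pow_card_filter_le_prod (μ := μ) J hA hκ hdom).trans
    (mul_le_mul_of_nonneg_left ?_ measureReal_nonneg)
  rw [Finset.mul_sum, Real.exp_sum]
  refine Finset.prod_le_prod (fun j hj => ?_) fun j hj => ?_
  · have := mul_nonneg (sub_nonneg.mpr hκ) (hε j hj); linarith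
  · linarith [Real.add_one_le_exp ((κ - 1) * ε j)]


open scoped Classical in
/-- [folklore] Integrability of the count moment `κ^{#{j ∈ J : ω ∈ A j}}` (a finite sum of indicators of measurable
finite intersections, on a finite measure). -/
theorem integrable_pow_card_filter (J : Finset ι) {A : ι → Set Ω} (hA : ∀ j ∈ J, MeasurableSet (A j)) (κ : ℝ) :
    Integrable (fun ω => κ ^ (J.filter fun j => ω ∈ A j).card) μ := by
  have hmeasS : ∀ S ∈ J.powerset, MeasurableSet (⋂ j ∈ S, A j) := fun S hS =>
    S.measurableSet_biInter fun j hj => hA j (Finset.mem_powerset.mp hS hj)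
  have heq : (fun ω => κ ^ (J.filter fun j => ω ∈ A j).card) = fun ω =>
      ∑ S ∈ J.powerset, (κ - 1) ^ S.card * (⋂ j ∈ S, A j).indicator (fun _ => (1 : ℝ)) ω :=
    funext fun ω => pow_card_filter_eq_sum_powerset J A κ ω
  rw [heq]
  exact integrable_finsetSum J.powerset fun S hS =>
    ((integrable_const (1 : ℝ)).indicator (hmeasS S hS)).const_mul ((κ - 1) ^ S.card)

open scoped Classical in
/-- [folklore] **NE1′-SIZE FROM NESTING DOMINATION — the end-to-end shape with (MI-F1)/(MI-F2) in kernel form.**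
Slots `i < n` with levels `lvl i < K` and counts `#{slots of level m} ≤ N₀Λ^m`; for each slot a finite index set `J i`
with events `A i j` (header (MI-F2′): the large-field CREATION events within reach of the slot's nested boxes);
(MI-F1) in the form «the proxy of slot `i` is dominated by `C²·(θ²)^{lvl i}·κ^{#{j ∈ J i : ω ∈ A i j}}` a.e.» (the
squared nesting-regularity radius; `κ` = the squared loss per irregular level raised to the lifetime bound);
(MI-F2) in the form «the events of each slot are dominated by products, `μ(⋂_{j∈S} A i j) ≤ μ(Ω)∏_{j∈S} ε i j`, with
`Σ_{j∈J i} ε i j ≤ E`» (creation probabilities, summable along the levels).  Then for `Λθ² < 1`, `κ ≥ 1`,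
`|t|·2R ≤ 1`, every `B > 0`:
`∫ g e^{tf} ≤ e^{t²B}∫ g e^{t μ[f∣F n]} + e^{|t|R}·Cg·B⁻¹·N₀·(C²·μ(Ω)·e^{(κ−1)E})·C_0(Λθ²)` — no `n`, no `K`.
(`integral_pow_card_filter_le_exp` feeds `hw` of `integral_mul_exp_le_uniform_of_slots` with `q = 0`.) -/
theorem integral_mul_exp_le_uniform_of_nesting {F : ℕ → MeasurableSpace Ω} (hF : Antitone F) (hFle : ∀ j, F j ≤ mΩ) {f : Ω → ℝ}
    (hf0 : StronglyMeasurable[F 0] f) {R : ℝ} (hfR : ∀ ω, |f ω| ≤ R) (n : ℕ) {V : ℕ → Ω → ℝ} {Vmax : ℝ}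
    (hVm : ∀ i < n, StronglyMeasurable[F (i + 1)] (V i)) (hVb : ∀ i < n, ∀ᵐ ω ∂μ, |V i ω| ≤ Vmax)
    (hV : IncrementVarProxy μ F f n V) (lvl : ℕ → ℕ) {N₀ Λ θ : ℝ} {K : ℕ} (hN₀ : 0 ≤ N₀) (hΛ : 0 ≤ Λ)
    (hr : Λ * θ ^ 2 < 1) (hlvl : ∀ i < n, lvl i < K)
    (hcard : ∀ m < K, (((range n).filter fun i => lvl i = m).card : ℝ) ≤ N₀ * Λ ^ m)
    (J : ℕ → Finset ι) (A : ℕ → ι → Set Ω) (hA : ∀ i < n, ∀ j ∈ J i, MeasurableSet (A i j))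
    {ε : ℕ → ι → ℝ} (hε : ∀ i < n, ∀ j ∈ J i, 0 ≤ ε i j) {E : ℝ} (hE : ∀ i < n, ∑ j ∈ J i, ε i j ≤ E)
    {κ : ℝ} (hκ : 1 ≤ κ)
    (hdom : ∀ i < n, ∀ S ⊆ J i, μ.real (⋂ j ∈ S, A i j) ≤ μ.real Set.univ * ∏ j ∈ S, ε i j) (C : ℝ)
    (hVdom : ∀ i < n, ∀ᵐ ω ∂μ, V i ω ≤ C ^ 2 * (θ ^ 2) ^ lvl i * κ ^ ((J i).filter fun j => ω ∈ A i j).card)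
    {t : ℝ} (ht : |t| * (2 * R) ≤ 1) {B : ℝ} (hB : 0 < B) {g : Ω → ℝ} (hg : StronglyMeasurable[F n] g)
    (hg0 : ∀ ω, 0 ≤ g ω) {Cg : ℝ} (hCg : 0 ≤ Cg) (hgC : ∀ ω, g ω ≤ Cg) :
    ∫ ω, g ω * Real.exp (t * f ω) ∂μ ≤
      Real.exp (t ^ 2 * B) * ∫ ω, g ω * Real.exp (t * μ[f | F n] ω) ∂μ +
        Real.exp (|t| * R) *
          (Cg * (B⁻¹ * (N₀ * (C ^ 2 * (μ.real Set.univ * Real.exp ((κ - 1) * E))) *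
            geomPolyConst 0 (Λ * θ ^ 2)))) := by
  have hA0 : 0 ≤ C ^ 2 * (μ.real Set.univ * Real.exp ((κ - 1) * E)) :=
    mul_nonneg (sq_nonneg C) (mul_nonneg measureReal_nonneg (Real.exp_pos _).le)
  refine integral_mul_exp_le_uniform_of_slots hF hFle hf0 hfR n hVm hVb hV lvl hN₀ hA0 hΛ hr hlvl hcard
    (fun i hi => ?_) ht hB hg hg0 hCg hgC
  have hVi : Integrable (V i) μ :=
    integrable_of_ae_abs_le (((hVm i hi).mono (hFle (i + 1))).aestronglyMeasurable) (hVb i hi)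
  have hNi := integrable_pow_card_filter (μ := μ) (J i) (hA i hi) κ
  have hmom : ∫ ω, κ ^ ((J i).filter fun j => ω ∈ A i j).card ∂μ ≤ μ.real Set.univ * Real.exp ((κ - 1) * E) := by
    refine (integral_pow_card_filter_le_exp (μ := μ) (J i) (hA i hi) (hε i hi) hκ (hdom i hi)).trans ?_
    refine mul_le_mul_of_nonneg_left (Real.exp_le_exp.mpr ?_) measureReal_nonneg
    exact mul_le_mul_of_nonneg_left (hE i hi) (sub_nonneg.mpr hκ)
  have hθ : 0 ≤ C ^ 2 * (θ ^ 2) ^ lvl i := mul_nonneg (sq_nonneg C) (pow_nonneg (sq_nonneg θ) _)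
  calc ∫ ω, V i ω ∂μ ≤ ∫ ω, C ^ 2 * (θ ^ 2) ^ lvl i * κ ^ ((J i).filter fun j => ω ∈ A i j).card ∂μ :=
        integral_mono_ae hVi (hNi.const_mul _) (hVdom i hi)
    _ = C ^ 2 * (θ ^ 2) ^ lvl i * ∫ ω, κ ^ ((J i).filter fun j => ω ∈ A i j).card ∂μ := integral_const_mul _ _
    _ ≤ C ^ 2 * (θ ^ 2) ^ lvl i * (μ.real Set.univ * Real.exp ((κ - 1) * E)) :=
        mul_le_mul_of_nonneg_left hmom hθ
    _ = C ^ 2 * (μ.real Set.univ * Real.exp ((κ - 1) * E)) * ((lvl i : ℝ) + 1) ^ 0 * (θ ^ 2) ^ lvl i := by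
        ring


open scoped Classical in
/-- [folklore] **END-TO-END WITH AN ADDITIVE, SEPARATELY BUDGETED PROXY TERM** (receptacle for the locality radii `ℓ_e²`
of (A1) and the T-block proxies of (A3)).  As `integral_mul_exp_le_uniform_of_nesting`, but the proxy of slot `i` is
dominated a.e. by `C²(θ²)^{lvl i}κ^{#{j irregular}} + U i ω` with `U i ≥ 0` predictable-measurable, bounded, and of
TOTAL FIRST MOMENT `Σ_{i<n} ∫ U i dμ ≤ Utot`; the tail becomes
`e^{|t|R}·Cg·B⁻¹·(N₀·C²μ(Ω)e^{(κ−1)E}·C_0(Λθ²) + Utot)`.  (So a closing seat may discharge locality and T-steps by ANY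
K-uniform first-moment budget, not necessarily level-profiled.) -/
theorem integral_mul_exp_le_uniform_of_nesting_add {F : ℕ → MeasurableSpace Ω} (hF : Antitone F)
    (hFle : ∀ j, F j ≤ mΩ) {f : Ω → ℝ} (hf0 : StronglyMeasurable[F 0] f) {R : ℝ} (hfR : ∀ ω, |f ω| ≤ R) (n : ℕ)
    {V : ℕ → Ω → ℝ} {Vmax : ℝ} (hVm : ∀ i < n, StronglyMeasurable[F (i + 1)] (V i))
    (hVb : ∀ i < n, ∀ᵐ ω ∂μ, |V i ω| ≤ Vmax) (hV : IncrementVarProxy μ F f n V) (lvl : ℕ → ℕ) {N₀ Λ θ : ℝ}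
    {K : ℕ} (hN₀ : 0 ≤ N₀) (hΛ : 0 ≤ Λ) (hr : Λ * θ ^ 2 < 1) (hlvl : ∀ i < n, lvl i < K)
    (hcard : ∀ m < K, (((range n).filter fun i => lvl i = m).card : ℝ) ≤ N₀ * Λ ^ m)
    (J : ℕ → Finset ι) (A : ℕ → ι → Set Ω) (hA : ∀ i < n, ∀ j ∈ J i, MeasurableSet (A i j))
    {ε : ℕ → ι → ℝ} (hε : ∀ i < n, ∀ j ∈ J i, 0 ≤ ε i j) {E : ℝ} (hE : ∀ i < n, ∑ j ∈ J i, ε i j ≤ E)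
    {κ : ℝ} (hκ : 1 ≤ κ)
    (hdom : ∀ i < n, ∀ S ⊆ J i, μ.real (⋂ j ∈ S, A i j) ≤ μ.real Set.univ * ∏ j ∈ S, ε i j) (C : ℝ)
    {U : ℕ → Ω → ℝ} {Umax : ℝ} (hUm : ∀ i < n, StronglyMeasurable[F (i + 1)] (U i))
    (hUb : ∀ i < n, ∀ᵐ ω ∂μ, |U i ω| ≤ Umax) {Utot : ℝ} (hU : ∑ i ∈ range n, ∫ ω, U i ω ∂μ ≤ Utot)
    (hVdom : ∀ i < n, ∀ᵐ ω ∂μ,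
      V i ω ≤ C ^ 2 * (θ ^ 2) ^ lvl i * κ ^ ((J i).filter fun j => ω ∈ A i j).card + U i ω)
    {t : ℝ} (ht : |t| * (2 * R) ≤ 1) {B : ℝ} (hB : 0 < B) {g : Ω → ℝ} (hg : StronglyMeasurable[F n] g)
    (hg0 : ∀ ω, 0 ≤ g ω) {Cg : ℝ} (hCg : 0 ≤ Cg) (hgC : ∀ ω, g ω ≤ Cg) :
    ∫ ω, g ω * Real.exp (t * f ω) ∂μ ≤
      Real.exp (t ^ 2 * B) * ∫ ω, g ω * Real.exp (t * μ[f | F n] ω) ∂μ +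
        Real.exp (|t| * R) *
          (Cg * (B⁻¹ * (N₀ * (C ^ 2 * (μ.real Set.univ * Real.exp ((κ - 1) * E))) *
            geomPolyConst 0 (Λ * θ ^ 2) + Utot))) := by
  have hmain := integral_mul_exp_le_of_varProxy_moments hF hFle hf0 hfR n hVm hVb hV ht hB hg hg0 hCg hgC
  -- split the first moments: ∫ V i ≤ (nesting part) + ∫ U i
  set w : ℕ → ℝ := fun i => C ^ 2 * (θ ^ 2) ^ lvl i * (μ.real Set.univ * Real.exp ((κ - 1) * E)) with hw
  have hVi : ∀ i < n, Integrable (V i) μ := fun i hi =>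
    integrable_of_ae_abs_le (((hVm i hi).mono (hFle (i + 1))).aestronglyMeasurable) (hVb i hi)
  have hUi : ∀ i < n, Integrable (U i) μ := fun i hi =>
    integrable_of_ae_abs_le (((hUm i hi).mono (hFle (i + 1))).aestronglyMeasurable) (hUb i hi)
  have hsplit : ∀ i < n, ∫ ω, V i ω ∂μ ≤ w i + ∫ ω, U i ω ∂μ := by
    intro i hi
    have hNi := integrable_pow_card_filter (μ := μ) (J i) (hA i hi) κ
    have hmom : ∫ ω, κ ^ ((J i).filter fun j => ω ∈ A i j).card ∂μ ≤
        μ.real Set.univ * Real.exp ((κ - 1) * E) := by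
      refine (integral_pow_card_filter_le_exp (μ := μ) (J i) (hA i hi) (hε i hi) hκ (hdom i hi)).trans ?_
      refine mul_le_mul_of_nonneg_left (Real.exp_le_exp.mpr ?_) measureReal_nonneg
      exact mul_le_mul_of_nonneg_left (hE i hi) (sub_nonneg.mpr hκ)
    have hθ : 0 ≤ C ^ 2 * (θ ^ 2) ^ lvl i := mul_nonneg (sq_nonneg C) (pow_nonneg (sq_nonneg θ) _)
    calc ∫ ω, V i ω ∂μ
        ≤ ∫ ω, (C ^ 2 * (θ ^ 2) ^ lvl i * κ ^ ((J i).filter fun j => ω ∈ A i j).card + U i ω) ∂μ :=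
          integral_mono_ae (hVi i hi) ((hNi.const_mul _).add (hUi i hi)) (hVdom i hi)
      _ = C ^ 2 * (θ ^ 2) ^ lvl i * ∫ ω, κ ^ ((J i).filter fun j => ω ∈ A i j).card ∂μ + ∫ ω, U i ω ∂μ := by
          rw [integral_add (hNi.const_mul _) (hUi i hi), integral_const_mul]
      _ ≤ w i + ∫ ω, U i ω ∂μ := by
          rw [hw]
          exact add_le_add (mul_le_mul_of_nonneg_left hmom hθ) le_rfl
  -- budget the nesting part by levels, the additive part by Utot
  have hA0 : 0 ≤ C ^ 2 * (μ.real Set.univ * Real.exp ((κ - 1) * E)) :=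
    mul_nonneg (sq_nonneg C) (mul_nonneg measureReal_nonneg (Real.exp_pos _).le)
  have hbud := budget_le (range n) lvl w hN₀ hA0 hΛ hr (fun i hi => hlvl i (mem_range.mp hi)) hcard
    (q := 0) (fun i _ => by rw [hw]; exact le_of_eq (by ring))
  have hsum : ∑ i ∈ range n, ∫ ω, V i ω ∂μ ≤
      N₀ * (C ^ 2 * (μ.real Set.univ * Real.exp ((κ - 1) * E))) * geomPolyConst 0 (Λ * θ ^ 2) + Utot := by
    calc ∑ i ∈ range n, ∫ ω, V i ω ∂μ ≤ ∑ i ∈ range n, (w i + ∫ ω, U i ω ∂μ) :=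
          Finset.sum_le_sum fun i hi => hsplit i (mem_range.mp hi)
      _ = ∑ i ∈ range n, w i + ∑ i ∈ range n, ∫ ω, U i ω ∂μ := Finset.sum_add_distrib
      _ ≤ _ := add_le_add hbud hU
  have h1 := mul_le_mul_of_nonneg_left hsum (inv_pos.mpr hB).le
  have h2 := mul_le_mul_of_nonneg_left h1 hCg
  have h3 := mul_le_mul_of_nonneg_left h2 (Real.exp_pos (|t| * R)).le
  exact hmain.trans (add_le_add le_rfl h3)

end Budget

end Literature.MathematicalPhysics.QuantumFieldTheory.Balaban1983to89.T4PathwiseCoupling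

end
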